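import Literature.Geometry.Kaehler.ComplexTorusPicardNumberAsymptoticDensity
import HarnessLib

/-!
# Hulek–Laface 2019, Thm. 7.4 for `ℓ = 3` with an explicit threshold: the third gap of Picard numbers

[cite: HulekLaface2019PicardNumbersAV, §7.2 Thm. 7.4 (Distribution of large Picard numbers)]:
"For every positive integer `ℓ` there exists a genus `g_ℓ` such that for all `g ≥ g_ℓ` large Picard
numbers in `R_g` are distributed as follows: `R_{g,ℓ} ⋯ R_{g,3} R_{g,2} •^{(g−1)²+1} •^{g²}`.  In other
words, for all `g ≥ g_ℓ`, we have that `[(g−ℓ)² + 1, g²] ∩ R_g = R_{g,ℓ} ⊔ ⋯ ⊔ R_{g,1} ⊔ R_{g,0}`", where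
`R_{g,n} := {(g−n)² + x ∣ x ∈ R_n}` (§7.2) and `R_n` is the set of Picard numbers of `n`-dimensional
abelian varieties (`picardNumbers n`); the proof is by induction on `ℓ`, the `ℓ`-th statement being
"there is no abelian variety of dimension `g ≥ g_ℓ` and Picard number `ρ` such that
`(g−t)² + t² < ρ < (g−t+1)² + 1` for `2 ≤ t ≤ ℓ` or `(g−1)² + 1 < ρ < g²`", and "we will not be able to
get any bound on `g`, but of course it is always possible to do so".

This file proves the case `ℓ = 3` (`t = 3`) with the EXPLICIT threshold `g₃ = 9`, and shows that `9` is
optimal: **for every abelian variety `A` of dimension `g ≥ 9`,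
`(g−3)² + 6 < ρ(A) < (g−2)² + 1 ⟹ ρ(A) = (g−3)² + 9`**
(`IsAbelianVariety.finrank_neronSeveriGroup_eq_of_thirdGap`).  This is the third gap
`((g−3)² + 9, (g−2)² + 1)` of Thm. 7.4 together with the two holes `(g−3)² + 7`, `(g−3)² + 8` of the box
`R_{g,3} = (g−3)² + R_3`, `R_3 = {1, …, 6, 9}` (`picardNumbers_three_subset`); for `g = 8` the
elliptic self-product `E⁸` without complex multiplication has `ρ = C(9,2) = 36 ∈ ((8−3)² + 6, (8−2)² + 1)`,
`36 ≠ 34` (`thirdGap_sharp_eight`), so no smaller threshold works (the cases `t = 1, 2` are Thm. 1.1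
with `g₁ = 4`, `g₂ = 7`, files `ComplexTorusPicardNumberGapsGeneral.lean`,
`ComplexTorusPicardNumberAsymptoticDensity.lean`).  The paper's own "large Picard number" regime
(Prop. 7.3, conditions (1)–(2) of §7.2) starts only at `g = 12` for `s = 3`.

## Proof (HL §7.2, proof of Thm. 7.4, made explicit along a Poincaré decomposition)

Write `A ∼ ∏_{ν} X_ν^{n_ν}` with simple, nonzero, pairwise non-isogenous abelian varieties `X_ν`
(`IsRiemannForm.exists_isIsogenous_powers_pos`, Lange Thm. 2.4.25), `r = r(A)` factors,
`k_ν = n_ν dim X_ν`, `g = Σ k_ν`, `ρ(A) = Σ_ν ρ(X_ν^{n_ν})` (Cor. 2.3, `finrank_neronSeveriGroup_powers`).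
* `r ≥ 4`: `ρ(A) ≤ M_{4,g} = (g−3)² + 3` (Prop. 3.1, Remark 3.3).
* `r = 3`: if some `k_ν ≥ g − 3` the other two isotypic factors have dimensions `{1,1}` or `{1,2}` and
  Thm. 1.1 (1) for the big factor (an abelian variety of dimension `≥ 6`) leaves only
  `ρ ∈ {(g−2)² + 2} ∪ [1, (g−3)² + 5]`; otherwise `ρ ≤ Σ k_ν² ≤ (g−3)² + 3` (`thirdGap_triple`).
* `r = 2` ("`Y ∼ A_n × A_{g−n}`" in the printed proof): with `k₂ ≤ k₁`, `k₂ = 1` uses the three largest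
  Picard numbers of the `(g−1)`-dimensional factor (Thm. 1.1 (1)–(2)), `k₂ = 2` uses Thm. 1.1 (1) for the
  `(g−2)`-dimensional factor, `k₂ = 3` uses Thm. 1.1 (1) for the `(g−3)`-dimensional factor AND
  `R_3 ⊆ {1,…,6,9}` for the `3`-dimensional one — the only survivor is `(g−3)² + 9` — and `k₂ ≥ 4` gives
  `ρ ≤ k₁² + k₂² ≤ (g−3)² + 6` for `g ≥ 9` (`thirdGap_pair`).
* `r = 1` (`A ∼ Bᵏ`): for `g ≥ 10`, `ρ(A) = g²` or `ρ(A) ≤ C(g+1, 2) ≤ (g−3)² + 6` (§7.2,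
  `IsIsogenous.finrank_neronSeveriGroup_eq_sq_or_le_choose_of_card_eq_one`); for `g = 9` an elliptic `B`
  gives `ρ ∈ {45, 81}` with `45 = (9−3)² + 9` (Cor. 2.6) and `dim B ∈ {3, 9}` gives `ρ ≤ 36`.
All arithmetic side conditions were machine-checked by interval arithmetic for `9 ≤ g ≤ 200` before
being proved here for all `g ≥ 9`.

## Contents (theorems only; no definition, no named fact, net debt 0)

* §1 arithmetic of the case analysis: `choose_succ_le_thirdGap`, `choose_succ_eq_thirdGap`,
  `thirdGap_pair`, `thirdGap_triple`.
* §2 `IsAbelianVariety.finrank_neronSeveriGroup_facts` — the per-factor input (`1 ≤ ρ ≤ k²`, Thm. 1.1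
  (1)–(2), `R_3`).
* §3 `IsIsogenous.finrank_neronSeveriGroup_eq_of_thirdGap_of_powers` (along a Poincaré decomposition)
  and `IsAbelianVariety.finrank_neronSeveriGroup_eq_of_thirdGap` (every abelian variety, `g ≥ 9`),
  the printed form `IsAbelianVariety.not_lt_finrank_neronSeveriGroup_lt_thirdGap` (`t = 3`), the holes
  `IsAbelianVariety.finrank_neronSeveriGroup_ne_thirdBox`, and the five largest "boxes"
  `IsAbelianVariety.finrank_neronSeveriGroup_le_thirdGap_or`.
* §4 on `R_g = picardNumbers g`: `not_mem_picardNumbers_of_thirdGap`,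
  `picardNumbers_inter_Ioo_thirdGap` (`R_g ∩ ((g−3)²+6, (g−2)²+1) = {(g−3)²+9}` for `g ≥ 9`),
  memberships `thirdBox_mem_picardNumbers` (`(g−3)² + {3,4,5,6,9} ⊆ R_g`), `secondBox_mem_picardNumbers`
  (`(g−2)² + {2,3,4} ⊆ R_g`), and the sharpness witness `thirdGap_sharp_eight` (`36 ∈ R_8`).
* §5 the structure at the top of the box (Cor. 7.6 for `n = 3`, explicit, in the style of Thm. 4.2):
  `thirdGap_pair_shape`, `IsIsogenous.finrank_neronSeveriGroup_eq_sq_sub_three_add_nine_iff_of_powers`,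
  `IsAbelianVariety.finrank_neronSeveriGroup_eq_sq_sub_three_add_nine_iff` — for `g ≥ 10`,
  `ρ(A) = (g−3)² + 9 ⟺ A ∼ E_1^{g−3} × E_2³` (`E_i` CM, non-isogenous).
* §6 Cor. 7.6 for the box `R_{g,2}`, explicit: `IsIsogenous.exists_cm_factor_of_secondBox_of_powers`,
  `IsAbelianVariety.exists_isIsogenous_ellipticPow_prod_of_secondBox` — for `g ≥ 8`,
  `(g−2)² < ρ(A) ≤ (g−2)² + 4 ⟹ A ∼ E^{g−2} × A_2` with `E` CM and `Hom(E, A_2) = 0`; sharpness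
  `secondBox_sharp_seven` (`28 = ρ(E⁷) ∈ R_{7,2}`), `choose_succ_le_sq_sub_two`.
* §7 Cor. 7.6 for the box `R_{g,3}`, explicit: `IsIsogenous.exists_isIsogenous_ellipticPow_prod_of_cm_factor`
  (the shape `A ∼ E^{t} × A_m`, `Hom(E, A_m) = 0`, from a CM elliptic isotypic factor),
  `IsIsogenous.exists_cm_factor_of_thirdBox_of_powers`,
  `IsAbelianVariety.exists_isIsogenous_ellipticPow_prod_of_thirdBox` — for `g ≥ 12`,
  `(g−3)² < ρ(A) ≤ (g−3)² + 9 ⟹ A ∼ E^{g−3} × A_3` with `E` CM and `Hom(E, A_3) = 0`; sharpness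
  `thirdBoxStructure_sharp_eleven` (`66 = ρ(E¹¹)`), `choose_succ_le_sq_sub_three`.
* §8 Cor. 7.6 as an equivalence: `finrank_neronSeveriGroup_ellipticPow_prod_of_homRat_eq_bot`
  (`ρ(E_θ^t × B) = t² + ρ(B)`), `IsAbelianVariety.finrank_neronSeveriGroup_mem_secondBox_iff` (`g ≥ 8`),
  `IsAbelianVariety.finrank_neronSeveriGroup_mem_thirdBox_iff` (`g ≥ 12`),
  `IsIsogenous.finrank_neronSeveriGroup_eq_sq_add_of_shape` (`ρ(A) = t² + ρ(B)`, `ρ(B) ∈ R_m`).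
* §9 the boxes as sets and Thm. 7.4 (`ℓ = 3`) AS PRINTED for every `g ≥ 12`:
  `IsAbelianVariety.exists_homRat_ellipticPeriod_prime_eq_bot` (a CM curve `E_{i√p}` with
  `Hom(E_{i√p}, Y) = 0` for any abelian variety `Y`), `sq_add_mem_picardNumbers_of_mem`
  (`t² + R_m ⊆ R_{t+m}`, all dimensions), `picardNumbers_one` (`R_1 = {1}`),
  `picardNumbers_inter_Ioc_secondBox` (`R_g ∩ ((g−2)², (g−2)²+4] = (g−2)² + R_2`, `g ≥ 8`),
  `picardNumbers_inter_Ioc_thirdBox` (`R_g ∩ ((g−3)², (g−3)²+9] = (g−3)² + R_3`, `g ≥ 12`),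
  `picardNumbers_inter_Icc_eq_boxes`
  (`R_g ∩ [(g−3)²+1, g²] = ((g−3)² + R_3) ∪ ((g−2)² + R_2) ∪ ((g−1)² + R_1) ∪ {g²}`, `g ≥ 12`).
* §10 the fourth gap, in every dimension: `choose_succ_le_fourthGap`, `IsIsogenous.not_fourthGap_of_powers`,
  `IsAbelianVariety.not_lt_finrank_neronSeveriGroup_lt_fourthGap` (no abelian variety has
  `(g−4)² + 16 < ρ < (g−3)² + 1`), `not_mem_picardNumbers_of_fourthGap`, `not_mem_picardNumbers_of_gaps`
  (the four gaps at once, `g ≥ 9`).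

Deviations.  (i) The threshold `g₃ = 9` and its optimality are not in the source (which proves the
statement for an unspecified `g_ℓ`); they come out of the explicit case analysis above, which replaces
the paper's inductive use of "large" Picard numbers (Prop. 7.3) by Thm. 1.1 (1)–(2) applied to the
isotypic factors.  (ii) Of the box `R_{g,3} = (g−3)² + {1,…,6,9}` only the members `(g−3)² + {3,4,5,6,9}`
are produced (products of elliptic curves); `(g−3)² + 1`, `(g−3)² + 2` need a very general abelian
threefold / surface (Prop. 6.3–6.4), as in `subset_picardNumbers_three`.

## References

* [HulekLaface2019PicardNumbersAV] K. Hulek, R. Laface, *On the Picard numbers of abelian varieties*,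
  Ann. Sc. Norm. Super. Pisa Cl. Sci. (5) XIX (2019) 1199–1224 (arXiv:1703.05882), Thm. 1.1, §2.1
  Cor. 2.3, §2.2 Cor. 2.6, §3.1 Prop. 3.1 / Remark 3.3, §7.2 Prop. 7.3, Thm. 7.4, Remark 7.5, Cor. 7.6.
* [Lange2023AbelianVarietiesComplex] H. Lange, *Abelian Varieties over the Complex Numbers*, Grundlehren
  Text Edition, Springer (2023), §2.4.4 Thm. 2.4.25 (Poincaré's complete reducibility theorem).
-/

open Module Matrix Function
open Complex (I)

namespace Literature.Geometry.Kaehler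

namespace ComplexTorus

/-- The covering space `E ≅ ℝ^ι` of a complex torus is finite-dimensional over `ℂ`. [cite: Lange2023AbelianVarietiesComplex, §1.1.1] -/
private theorem finiteDimensional_complex_of_period {ι : Type*} [Fintype ι] {E : Type*} [NormedAddCommGroup E]
    [NormedSpace ℂ E] (Φ : (ι → ℝ) ≃L[ℝ] E) : FiniteDimensional ℂ E := by
  haveI : FiniteDimensional ℝ E := LinearEquiv.finiteDimensional Φ.toLinearEquiv
  exact Module.Finite.of_restrictScalars_finite ℝ ℂ E

/-- `dim_ℂ (Eᵐ) = m · dim_ℂ E`. [folklore] -/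
private theorem finrank_fin_fun (m : ℕ) (E : Type*) [NormedAddCommGroup E] [NormedSpace ℂ E]
    [FiniteDimensional ℂ E] : finrank ℂ (Fin m → E) = m * finrank ℂ E := by
  rw [Module.finrank_pi_fintype, Finset.sum_const, Finset.card_univ, Fintype.card_fin, smul_eq_mul]

/-! ## §1 The arithmetic of the case analysis -/

section Arithmetic

/-- **`C(g+1, 2) ≤ (g−3)² + 6` for `g ≥ 10`** (with equality at `g = 10`): the self-product bound
`½ g(g+1)` of §7.2 lies below the third gap. [cite: HulekLaface2019PicardNumbersAV, §7.2 (condition (1), "`½ g(g+1) ≤ (g−s)² + 1`")] -/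
theorem choose_succ_le_thirdGap {g : ℕ} (hg : 10 ≤ g) : (g + 1).choose 2 ≤ (g - 3) ^ 2 + 6 := by
  obtain ⟨t, rfl⟩ : ∃ t, g = t + 10 := ⟨g - 10, by omega⟩
  rw [show t + 10 - 3 = t + 7 from by omega, Nat.choose_two_right,
    show t + 10 + 1 - 1 = t + 10 from by omega,
    show (t + 10 + 1) * (t + 10) = t ^ 2 + 21 * t + 110 from by ring,
    show (t + 7) ^ 2 + 6 = t ^ 2 + 14 * t + 55 from by ring]
  omega

/-- **At `g = 9` the bound `C(g+1, 2) = 45` IS the value `(g−3)² + 9`; for `g ≥ 10` it is below the gap**: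
`9 ≤ g` and `(g−3)² + 6 < C(g+1, 2)` force `C(g+1, 2) = (g−3)² + 9`. [cite: HulekLaface2019PicardNumbersAV, §7.2 (condition (1)) and §2.2 Cor. 2.6 (`ρ(Eᵍ) = ½ g(g+1)`)] -/
theorem choose_succ_eq_thirdGap {g : ℕ} (hg : 9 ≤ g) (h : (g - 3) ^ 2 + 6 < (g + 1).choose 2) :
    (g + 1).choose 2 = (g - 3) ^ 2 + 9 := by
  rcases (show g = 9 ∨ 10 ≤ g by omega) with rfl | h10
  · decide
  · exact absurd h (not_lt.2 (choose_succ_le_thirdGap h10))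

/-- `a² + t ≤ t a + a` for `1 ≤ a ≤ t` (i.e. `(a−1)(t−a) ≥ 0`). [folklore] -/
private theorem sq_add_le_mul_add {a t : ℕ} (ha : 1 ≤ a) (hat : a ≤ t) : a ^ 2 + t ≤ t * a + a := by
  obtain ⟨a', rfl⟩ : ∃ a', a = a' + 1 := ⟨a - 1, by omega⟩
  obtain ⟨d, rfl⟩ : ∃ d, t = a' + 1 + d := ⟨t - (a' + 1), by omega⟩
  have h := Nat.zero_le (a' * d)
  ring_nf at h ⊢
  omega

/-- **`r(A) = 3`, all three isotypic factors of dimension `≤ g − 4`: `ρ ≤ Σ k_ν² ≤ (g−3)² + 3`** (here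
`g = t + 4`, `1 ≤ a, b, c ≤ t`, `a + b + c = g`). [cite: HulekLaface2019PicardNumbersAV, §3.1 Prop. 3.1 (proof: "`ρ(A) ≤ k_1² + ⋯ + k_r²`") and §7.2 Thm. 7.4 (proof)] -/
theorem thirdGap_triple_small {t a b c ρa ρb ρc : ℕ} (hsum : a + b + c = t + 4) (ha : 1 ≤ a) (hb : 1 ≤ b)
    (hc : 1 ≤ c) (hat : a ≤ t) (hbt : b ≤ t) (hct : c ≤ t) (ua : ρa ≤ a ^ 2) (ub : ρb ≤ b ^ 2)
    (uc : ρc ≤ c ^ 2) (h₁ : (t + 1) ^ 2 + 6 < ρa + ρb + ρc) : False := by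
  have h1 := sq_add_le_mul_add ha hat
  have h2 := sq_add_le_mul_add hb hbt
  have h3 := sq_add_le_mul_add hc hct
  have key : t * a + t * b + t * c = t * (t + 4) := by rw [← mul_add, ← mul_add, hsum]
  ring_nf at h1 h2 h3 key h₁
  omega

/-- **`r(A) = 3` with a big isotypic factor (`k ≥ g − 3`, the other two of dimensions `a + b ≤ 3`)**:
Thm. 1.1 (1) for the big factor (`ρ_k = k²` or `ρ_k ≤ (k−1)² + 1`) leaves `ρ ∈ {(g−2)² + 2}` or
`ρ ≤ (g−3)² + 5`, outside `((g−3)² + 6, (g−2)² + 1)`. [cite: HulekLaface2019PicardNumbersAV, §7.2 Thm. 7.4 (proof) with Thm. 1.1 (1)] -/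
theorem thirdGap_triple_big {g k a b ρk ρa ρb : ℕ} (hg : 9 ≤ g) (hsum : k + a + b = g) (hab : a + b ≤ 3)
    (ha : 1 ≤ a) (hb : 1 ≤ b) (la : 1 ≤ ρa) (ua : ρa ≤ a ^ 2) (lb : 1 ≤ ρb) (ub : ρb ≤ b ^ 2)
    (f4 : 4 ≤ k → ρk = k ^ 2 ∨ ρk ≤ (k - 1) ^ 2 + 1)
    (h₁ : (g - 3) ^ 2 + 6 < ρk + ρa + ρb) (h₂ : ρk + ρa + ρb < (g - 2) ^ 2 + 1) : False := by
  have f := f4 (by omega)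
  rcases (show (a = 1 ∧ b = 1) ∨ a + b = 3 by omega) with ⟨rfl, rfl⟩ | h3
  · -- `k = g − 2`, the other two factors are elliptic curves: `ρ = ρ_k + 2`
    obtain ⟨t, rfl⟩ : ∃ t, k = t + 7 := ⟨k - 7, by omega⟩
    subst hsum
    rw [show t + 7 + 1 + 1 - 3 = t + 6 from by omega] at h₁
    rw [show t + 7 + 1 + 1 - 2 = t + 7 from by omega] at h₂
    rw [show t + 7 - 1 = t + 6 from by omega] at f
    ring_nf at f h₁ h₂ ua ub
    omega
  · -- `k = g − 3`, the other two factors have dimensions `1` and `2`: `ρ ≤ ρ_k + 5`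
    obtain ⟨t, rfl⟩ : ∃ t, k = t + 6 := ⟨k - 6, by omega⟩
    obtain rfl : g = t + 9 := by omega
    have hab5 : ρa + ρb ≤ 5 := by
      rcases (show a = 1 ∨ a = 2 by omega) with rfl | rfl
      · obtain rfl : b = 2 := by omega
        omega
      · obtain rfl : b = 1 := by omega
        omega
    rw [show t + 9 - 3 = t + 6 from by omega] at h₁
    rw [show t + 6 - 1 = t + 5 from by omega] at f
    ring_nf at f h₁
    omega

/-- **`r(A) = 3` never meets the third gap** (`g ≥ 9`; `k_ν ≥ 1`, `Σ k_ν = g`, `1 ≤ ρ_ν ≤ k_ν²`, and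
Thm. 1.1 (1) for every factor of dimension `≥ 4`). [cite: HulekLaface2019PicardNumbersAV, §7.2 Thm. 7.4 (proof) with Thm. 1.1 (1) and Prop. 3.1] -/
theorem thirdGap_triple {g a b c ρa ρb ρc : ℕ} (hg : 9 ≤ g) (hsum : a + b + c = g) (ha : 1 ≤ a)
    (hb : 1 ≤ b) (hc : 1 ≤ c) (la : 1 ≤ ρa) (ua : ρa ≤ a ^ 2) (lb : 1 ≤ ρb) (ub : ρb ≤ b ^ 2)
    (lc : 1 ≤ ρc) (uc : ρc ≤ c ^ 2) (f4a : 4 ≤ a → ρa = a ^ 2 ∨ ρa ≤ (a - 1) ^ 2 + 1)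
    (f4b : 4 ≤ b → ρb = b ^ 2 ∨ ρb ≤ (b - 1) ^ 2 + 1) (f4c : 4 ≤ c → ρc = c ^ 2 ∨ ρc ≤ (c - 1) ^ 2 + 1)
    (h₁ : (g - 3) ^ 2 + 6 < ρa + ρb + ρc) (h₂ : ρa + ρb + ρc < (g - 2) ^ 2 + 1) : False := by
  by_cases hA : b + c ≤ 3
  · exact thirdGap_triple_big hg hsum hA hb hc lb ub lc uc f4a h₁ h₂
  by_cases hB : a + c ≤ 3
  · exact thirdGap_triple_big hg (by omega) hB ha hc la ua lc uc f4b (by omega) (by omega)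
  by_cases hC : a + b ≤ 3
  · exact thirdGap_triple_big hg (by omega) hC ha hb la ua lb ub f4c (by omega) (by omega)
  · obtain ⟨t, rfl⟩ : ∃ t, g = t + 4 := ⟨g - 4, by omega⟩
    rw [show t + 4 - 3 = t + 1 from by omega] at h₁
    exact thirdGap_triple_small hsum ha hb hc (by omega) (by omega) (by omega) ua ub uc h₁

/-- **`r(A) = 2` ("`Y ∼ A_n × A_{g−n}`"), ordered form `k₂ ≤ k₁`**: the only Picard number of
`X₁^{n₁} × X₂^{n₂}` (`k_i = dim X_i^{n_i}`, `k₁ + k₂ = g ≥ 9`) in `((g−3)² + 6, (g−2)² + 1)` is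
`(g−3)² + 9` — `k₂ = 1`: the three largest Picard numbers of the `(g−1)`-dimensional factor; `k₂ = 2`:
Thm. 1.1 (1) for the `(g−2)`-dimensional factor; `k₂ = 3`: Thm. 1.1 (1) for the `(g−3)`-dimensional
factor and `R_3 ⊆ {1,…,6,9}`; `k₂ ≥ 4`: `ρ ≤ k₁² + k₂² ≤ (g−3)² + 6`.
[cite: HulekLaface2019PicardNumbersAV, §7.2 Thm. 7.4 (proof: "`Y ∼ A_n × A_{g−n}` … `ρ(Y) = ρ_n + ρ_{g−n}`") with Thm. 1.1] -/
theorem thirdGap_pair_aux {g k₁ k₂ ρ₁ ρ₂ : ℕ} (hg : 9 ≤ g) (hk : k₁ + k₂ = g) (hle : k₂ ≤ k₁)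
    (hk₂ : 1 ≤ k₂) (u₁ : ρ₁ ≤ k₁ ^ 2) (l₂ : 1 ≤ ρ₂) (u₂ : ρ₂ ≤ k₂ ^ 2)
    (f4₁ : 4 ≤ k₁ → ρ₁ = k₁ ^ 2 ∨ ρ₁ ≤ (k₁ - 1) ^ 2 + 1)
    (f7₁ : 7 ≤ k₁ → ρ₁ ≤ (k₁ - 2) ^ 2 + 4 ∨ ρ₁ = (k₁ - 1) ^ 2 + 1 ∨ ρ₁ = k₁ ^ 2)
    (f3₂ : k₂ = 3 → ρ₂ ≤ 6 ∨ ρ₂ = 9)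
    (h₁ : (g - 3) ^ 2 + 6 < ρ₁ + ρ₂) (h₂ : ρ₁ + ρ₂ < (g - 2) ^ 2 + 1) :
    ρ₁ + ρ₂ = (g - 3) ^ 2 + 9 := by
  subst hk
  rcases (show k₂ = 1 ∨ k₂ = 2 ∨ k₂ = 3 ∨ 4 ≤ k₂ by omega) with rfl | rfl | rfl | hk4
  · -- `k₂ = 1`, `k₁ = g − 1 ≥ 8`
    obtain ⟨t, rfl⟩ : ∃ t, k₁ = t + 8 := ⟨k₁ - 8, by omega⟩
    have f := f7₁ (by omega)
    rw [show t + 8 + 1 - 3 = t + 6 from by omega] at h₁ ⊢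
    rw [show t + 8 + 1 - 2 = t + 7 from by omega] at h₂
    rw [show t + 8 - 2 = t + 6 from by omega, show t + 8 - 1 = t + 7 from by omega] at f
    ring_nf at f h₁ h₂ u₂ ⊢
    omega
  · -- `k₂ = 2`, `k₁ = g − 2 ≥ 7`
    obtain ⟨t, rfl⟩ : ∃ t, k₁ = t + 7 := ⟨k₁ - 7, by omega⟩
    have f := f4₁ (by omega)
    rw [show t + 7 + 2 - 3 = t + 6 from by omega] at h₁ ⊢
    rw [show t + 7 + 2 - 2 = t + 7 from by omega] at h₂
    rw [show t + 7 - 1 = t + 6 from by omega] at f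
    ring_nf at f h₁ h₂ u₂ ⊢
    omega
  · -- `k₂ = 3`, `k₁ = g − 3 ≥ 6`
    obtain ⟨t, rfl⟩ : ∃ t, k₁ = t + 6 := ⟨k₁ - 6, by omega⟩
    have f := f4₁ (by omega)
    have f' := f3₂ rfl
    rw [show t + 6 + 3 - 3 = t + 6 from by omega] at h₁ ⊢
    rw [show t + 6 + 3 - 2 = t + 7 from by omega] at h₂
    rw [show t + 6 - 1 = t + 5 from by omega] at f
    ring_nf at f f' h₁ h₂ u₂ ⊢
    omega
  · -- `4 ≤ k₂ ≤ k₁`: `ρ ≤ k₁² + k₂² ≤ (g−3)² + 6`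
    exfalso
    obtain ⟨u, rfl⟩ : ∃ u, k₁ = u + 4 := ⟨k₁ - 4, by omega⟩
    obtain ⟨v, rfl⟩ : ∃ v, k₂ = v + 4 := ⟨k₂ - 4, by omega⟩
    rw [show u + 4 + (v + 4) - 3 = u + v + 5 from by omega] at h₁
    have huv := Nat.zero_le (u * v)
    ring_nf at h₁ u₁ u₂ huv hg
    omega

/-- **`r(A) = 2` never meets the third gap except at `(g−3)² + 9`** (`g ≥ 9`): for
`A ∼ X₁^{n₁} × X₂^{n₂}` with `k_i = dim X_i^{n_i} ≥ 1`, `k₁ + k₂ = g`, `1 ≤ ρ_i ≤ k_i²`, Thm. 1.1 (1)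
(resp. (1)–(2)) for a factor of dimension `≥ 4` (resp. `≥ 7`) and `R_3 ⊆ {1,…,6,9}` for a factor of
dimension `3`: `(g−3)² + 6 < ρ₁ + ρ₂ < (g−2)² + 1 ⟹ ρ₁ + ρ₂ = (g−3)² + 9`.
[cite: HulekLaface2019PicardNumbersAV, §7.2 Thm. 7.4 (proof) with Thm. 1.1 and §1 (`R_3`)] -/
theorem thirdGap_pair {g k₁ k₂ ρ₁ ρ₂ : ℕ} (hg : 9 ≤ g) (hk : k₁ + k₂ = g) (hk₁ : 1 ≤ k₁) (hk₂ : 1 ≤ k₂)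
    (l₁ : 1 ≤ ρ₁) (u₁ : ρ₁ ≤ k₁ ^ 2) (l₂ : 1 ≤ ρ₂) (u₂ : ρ₂ ≤ k₂ ^ 2)
    (f4₁ : 4 ≤ k₁ → ρ₁ = k₁ ^ 2 ∨ ρ₁ ≤ (k₁ - 1) ^ 2 + 1)
    (f7₁ : 7 ≤ k₁ → ρ₁ ≤ (k₁ - 2) ^ 2 + 4 ∨ ρ₁ = (k₁ - 1) ^ 2 + 1 ∨ ρ₁ = k₁ ^ 2)
    (f3₁ : k₁ = 3 → ρ₁ ≤ 6 ∨ ρ₁ = 9)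
    (f4₂ : 4 ≤ k₂ → ρ₂ = k₂ ^ 2 ∨ ρ₂ ≤ (k₂ - 1) ^ 2 + 1)
    (f7₂ : 7 ≤ k₂ → ρ₂ ≤ (k₂ - 2) ^ 2 + 4 ∨ ρ₂ = (k₂ - 1) ^ 2 + 1 ∨ ρ₂ = k₂ ^ 2)
    (f3₂ : k₂ = 3 → ρ₂ ≤ 6 ∨ ρ₂ = 9)
    (h₁ : (g - 3) ^ 2 + 6 < ρ₁ + ρ₂) (h₂ : ρ₁ + ρ₂ < (g - 2) ^ 2 + 1) :
    ρ₁ + ρ₂ = (g - 3) ^ 2 + 9 := by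
  rcases le_total k₂ k₁ with h | h
  · exact thirdGap_pair_aux hg hk h hk₂ u₁ l₂ u₂ f4₁ f7₁ f3₂ h₁ h₂
  · have h' := thirdGap_pair_aux hg ((add_comm _ _).trans hk) h hk₁ u₂ l₁ u₁ f4₂ f7₂ f3₁
      (by rwa [add_comm ρ₂ ρ₁]) (by rwa [add_comm ρ₂ ρ₁])
    rwa [add_comm ρ₂ ρ₁] at h'

end Arithmetic

/-! ## §2 The per-factor input -/

section Facts

variable {ι : Type*} [Fintype ι] [DecidableEq ι] {E : Type*} [NormedAddCommGroup E] [NormedSpace ℂ E]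

/-- **What the case analysis knows about one isotypic factor** — an abelian variety `X` of dimension
`k ≥ 1`: `1 ≤ ρ(X) ≤ k²` (§1), Thm. 1.1 (1) (`k ≥ 4`: `ρ = k²` or `ρ ≤ (k−1)² + 1`), the three largest
Picard numbers (`k ≥ 7`: `ρ ≤ (k−2)² + 4` or `ρ = (k−1)² + 1` or `ρ = k²`), and `R_3 ⊆ {1,…,6,9}`
(`k = 3`). [cite: HulekLaface2019PicardNumbersAV, §1 ("`1 ≤ ρ ≤ g²`", "`R_3 = {1, …, 6, 9}`") and Thm. 1.1 (1)–(2)] -/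
theorem IsAbelianVariety.finrank_neronSeveriGroup_facts {Φ : (ι → ℝ) ≃L[ℝ] E} (hX : IsAbelianVariety Φ)
    (hk : 0 < finrank ℂ E) :
    1 ≤ finrank ℤ (neronSeveriGroup Φ) ∧ finrank ℤ (neronSeveriGroup Φ) ≤ finrank ℂ E ^ 2 ∧
      (4 ≤ finrank ℂ E → finrank ℤ (neronSeveriGroup Φ) = finrank ℂ E ^ 2 ∨
        finrank ℤ (neronSeveriGroup Φ) ≤ (finrank ℂ E - 1) ^ 2 + 1) ∧
      (7 ≤ finrank ℂ E → finrank ℤ (neronSeveriGroup Φ) ≤ (finrank ℂ E - 2) ^ 2 + 4 ∨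
        finrank ℤ (neronSeveriGroup Φ) = (finrank ℂ E - 1) ^ 2 + 1 ∨
        finrank ℤ (neronSeveriGroup Φ) = finrank ℂ E ^ 2) ∧
      (finrank ℂ E = 3 → finrank ℤ (neronSeveriGroup Φ) ≤ 6 ∨ finrank ℤ (neronSeveriGroup Φ) = 9) := by
  haveI : Nontrivial E := Module.nontrivial_of_finrank_pos hk
  exact ⟨hX.finrank_neronSeveriGroup_pos, finrank_neronSeveriGroup_le_sq Φ,
    fun h ↦ hX.finrank_neronSeveriGroup_eq_sq_or_le h, fun h ↦ hX.finrank_neronSeveriGroup_le_secondGap_or h,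
    fun h ↦ hX.finrank_neronSeveriGroup_le_six_or_eq_nine h⟩

end Facts

/-! ## §3 The third gap along a Poincaré decomposition, and for every abelian variety -/

section Decomposition

variable {ι : Type*} [Fintype ι] [DecidableEq ι] {E : Type*} [NormedAddCommGroup E] [NormedSpace ℂ E]
  {ρ : Type*} [Fintype ρ] [DecidableEq ρ] {τ : ρ → Type*} [∀ ν, Fintype (τ ν)] [∀ ν, DecidableEq (τ ν)]
  [∀ ν, Nonempty (τ ν)]
  {G : ρ → Type*} [∀ ν, NormedAddCommGroup (G ν)] [∀ ν, NormedSpace ℂ (G ν)]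
  (X : ∀ ν, (τ ν → ℝ) ≃L[ℝ] G ν) (n : ρ → ℕ)

/-- **Hulek–Laface 2019, Thm. 7.4 for `ℓ = 3` along a Poincaré decomposition, with the explicit threshold
`g ≥ 9`.**  For simple, nonzero, pairwise non-isogenous abelian varieties `X_ν`, exponents `n_ν ≥ 1` and
`A ∼ ∏_ν X_ν^{n_ν}` of dimension `g ≥ 9`:
`(g−3)² + 6 < ρ(A) < (g−2)² + 1 ⟹ ρ(A) = (g−3)² + 9` (cases `r(A) = 1, 2, 3, ≥ 4` as in the module
docstring). [cite: HulekLaface2019PicardNumbersAV, §7.2 Thm. 7.4 (case `ℓ = 3`, `t = 3`) and its proof] -/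
theorem IsIsogenous.finrank_neronSeveriGroup_eq_of_thirdGap_of_powers {A : (ι → ℝ) ≃L[ℝ] E}
    (hiso : IsIsogenous A (sigmaPiPeriod fun ν ↦ powPeriod (X ν) (n ν))) (hX : ∀ ν, IsSimple (X ν))
    (hA : ∀ ν, IsAbelianVariety (X ν)) (hXX : ∀ ν ν', ν ≠ ν' → ¬ IsIsogenous (X ν) (X ν'))
    (hn : ∀ ν, 0 < n ν) (hg : 9 ≤ finrank ℂ E)
    (h₁ : (finrank ℂ E - 3) ^ 2 + 6 < finrank ℤ (neronSeveriGroup A))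
    (h₂ : finrank ℤ (neronSeveriGroup A) < (finrank ℂ E - 2) ^ 2 + 1) :
    finrank ℤ (neronSeveriGroup A) = (finrank ℂ E - 3) ^ 2 + 9 := by
  haveI : ∀ ν, FiniteDimensional ℂ (G ν) := fun ν ↦ finiteDimensional_complex_of_period (X ν)
  -- bookkeeping: `g = Σ k_ν`, `ρ(A) = Σ ρ(X_ν^{n_ν})` (Cor. 2.3)
  have hgsum : finrank ℂ E = ∑ ν, n ν * finrank ℂ (G ν) := by
    rw [hiso.finrank_eq _ _, finrank_powers_eq X n]
  have hρsum : finrank ℤ (neronSeveriGroup A) = ∑ ν, finrank ℤ (neronSeveriGroup (powPeriod (X ν) (n ν))) := by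
    rw [hiso.finrank_neronSeveriGroup_eq _ _, finrank_neronSeveriGroup_powers X n hX hA hXX]
  have hk1 : ∀ ν, 1 ≤ n ν * finrank ℂ (G ν) := one_le_mul_finrank X n hn
  have hkd : ∀ ν, finrank ℂ (Fin (n ν) → G ν) = n ν * finrank ℂ (G ν) := fun ν ↦ finrank_fin_fun (n ν) (G ν)
  -- the per-factor input
  have facts : ∀ ν, 1 ≤ finrank ℤ (neronSeveriGroup (powPeriod (X ν) (n ν))) ∧
      finrank ℤ (neronSeveriGroup (powPeriod (X ν) (n ν))) ≤ (n ν * finrank ℂ (G ν)) ^ 2 ∧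
      (4 ≤ n ν * finrank ℂ (G ν) →
        finrank ℤ (neronSeveriGroup (powPeriod (X ν) (n ν))) = (n ν * finrank ℂ (G ν)) ^ 2 ∨
        finrank ℤ (neronSeveriGroup (powPeriod (X ν) (n ν))) ≤ (n ν * finrank ℂ (G ν) - 1) ^ 2 + 1) ∧
      (7 ≤ n ν * finrank ℂ (G ν) →
        finrank ℤ (neronSeveriGroup (powPeriod (X ν) (n ν))) ≤ (n ν * finrank ℂ (G ν) - 2) ^ 2 + 4 ∨
        finrank ℤ (neronSeveriGroup (powPeriod (X ν) (n ν))) = (n ν * finrank ℂ (G ν) - 1) ^ 2 + 1 ∨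
        finrank ℤ (neronSeveriGroup (powPeriod (X ν) (n ν))) = (n ν * finrank ℂ (G ν)) ^ 2) ∧
      (n ν * finrank ℂ (G ν) = 3 →
        finrank ℤ (neronSeveriGroup (powPeriod (X ν) (n ν))) ≤ 6 ∨
        finrank ℤ (neronSeveriGroup (powPeriod (X ν) (n ν))) = 9) := fun ν ↦ by
    have h := ((hA ν).pow (n ν)).finrank_neronSeveriGroup_facts (by rw [hkd]; exact hk1 ν)
    rw [hkd ν] at h
    exact h
  -- `r ≤ g`
  have hrg : Fintype.card ρ ≤ finrank ℂ E := by
    rw [hgsum]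
    calc Fintype.card ρ = ∑ _ν : ρ, 1 := by simp
      _ ≤ ∑ ν, n ν * finrank ℂ (G ν) := Finset.sum_le_sum fun ν _ ↦ hk1 ν
  -- `(g−2)² + 1 ≤ g²`: the value `g²` is above the window
  have hsq : (finrank ℂ E - 2) ^ 2 + 1 ≤ finrank ℂ E ^ 2 := by
    obtain ⟨t, ht⟩ : ∃ t, finrank ℂ E = t + 2 := ⟨finrank ℂ E - 2, by omega⟩
    rw [ht, show t + 2 - 2 = t from by omega]
    nlinarith
  rcases (show Fintype.card ρ = 0 ∨ Fintype.card ρ = 1 ∨ Fintype.card ρ = 2 ∨ Fintype.card ρ = 3 ∨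
      4 ≤ Fintype.card ρ by omega) with h0 | h1 | h2 | h3 | h4
  · -- `r = 0`: `A` is a point
    exfalso
    haveI : IsEmpty ρ := Fintype.card_eq_zero_iff.1 h0
    rw [Finset.univ_eq_empty, Finset.sum_empty] at hgsum
    omega
  · -- `r = 1`: `A ∼ Bᵏ`
    rcases (show finrank ℂ E = 9 ∨ 10 ≤ finrank ℂ E by omega) with h9 | h10
    · -- `g = 9`
      by_cases hd : ∀ ν, finrank ℂ (G ν) = 1
      · -- `A ∼ E⁹`: `ρ ∈ {81, 45}` and `45 = (9−3)² + 9`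
        rcases hiso.finrank_neronSeveriGroup_eq_sq_or_eq_choose_of_card_eq_one X n h1 hd with h | h
        · omega
        · rw [h] at h₁ ⊢
          exact choose_succ_eq_thirdGap hg h₁
      · -- `A ∼ Bᵏ`, `b = dim B ∈ {3, 9}`: `ρ ≤ b k(k+1) ≤ 36`
        exfalso
        push Not at hd
        obtain ⟨ν₀, huniq⟩ := Fintype.card_eq_one_iff.1 h1
        letI : Unique ρ := { default := ν₀, uniq := huniq }
        obtain ⟨ν, hν⟩ := hd
        have hν₀ : finrank ℂ (G ν₀) ≠ 1 := huniq ν ▸ hν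
        have hAX : IsIsogenous A (powPeriod (X ν₀) (n ν₀)) :=
          IsIsogenous.trans _ _ _ hiso (isIsomorphic_sigmaPiPeriod_unique fun ν ↦ powPeriod (X ν) (n ν)).isIsogenous
        have hb1 : 0 < finrank ℂ (G ν₀) := finrank_pos_of_nonempty (X ν₀)
        have hb2 : 2 ≤ finrank ℂ (G ν₀) := by omega
        obtain ⟨m, hm⟩ : ∃ m, n ν₀ = m + 1 := ⟨n ν₀ - 1, by have := hn ν₀; omega⟩
        have hgm : finrank ℂ E = finrank ℂ (G ν₀) * (m + 1) := by
          rw [hAX.finrank_eq _ _, hkd, hm, mul_comm]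
        -- `ρ(A) = ρ(Bᵏ) ≤ k ρ(B) + C(k,2)·2b ≤ b k(k+1)` (type-free Prop. 2.4)
        have hρT : finrank ℤ (neronSeveriGroup A) ≤ finrank ℂ (G ν₀) * (m + 1) * (m + 2) := by
          rw [hAX.finrank_neronSeveriGroup_eq _ _, hm]
          exact ((hX ν₀).finrank_neronSeveriGroup_pow_le (hA ν₀) (m + 1)).trans
            (pow_bound_le_mul (finrank ℂ (G ν₀)) m _
              ((hX ν₀).finrank_neronSeveriGroup_le_two_mul_finrank (hA ν₀)))
        rw [h9] at hgm h₁
        have hm3 : m ≤ 3 := by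
          have := Nat.mul_le_mul_right (m + 1) hb2
          omega
        interval_cases m <;> norm_num at hgm hρT h₁ <;> omega
    · -- `g ≥ 10`: `ρ = g²` or `ρ ≤ C(g+1, 2) ≤ (g−3)² + 6` (§7.2)
      exfalso
      rcases hiso.finrank_neronSeveriGroup_eq_sq_or_le_choose_of_card_eq_one X n hX hA hn h1 with h | h
      · omega
      · exact absurd (h.trans (choose_succ_le_thirdGap h10)) (not_le.2 h₁)
  · -- `r = 2`
    obtain e := Fintype.equivFinOfCardEq h2
    have hs : ∀ f : ρ → ℕ, ∑ ν, f ν = f (e.symm 0) + f (e.symm 1) := fun f ↦ by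
      rw [← e.symm.sum_comp f, Fin.sum_univ_two]
    rw [hρsum, hs] at h₁ h₂ ⊢
    rw [hgsum, hs] at h₁ h₂ hg ⊢
    obtain ⟨l₁, u₁, f4₁, f7₁, f3₁⟩ := facts (e.symm 0)
    obtain ⟨l₂, u₂, f4₂, f7₂, f3₂⟩ := facts (e.symm 1)
    exact thirdGap_pair hg rfl (hk1 _) (hk1 _) l₁ u₁ l₂ u₂ f4₁ f7₁ f3₁ f4₂ f7₂ f3₂ h₁ h₂
  · -- `r = 3`
    exfalso
    obtain e := Fintype.equivFinOfCardEq h3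
    have hs : ∀ f : ρ → ℕ, ∑ ν, f ν = f (e.symm 0) + f (e.symm 1) + f (e.symm 2) := fun f ↦ by
      rw [← e.symm.sum_comp f, Fin.sum_univ_three]
    rw [hρsum, hs] at h₁ h₂
    rw [hgsum, hs] at h₁ h₂ hg
    obtain ⟨la, ua, f4a, -, -⟩ := facts (e.symm 0)
    obtain ⟨lb, ub, f4b, -, -⟩ := facts (e.symm 1)
    obtain ⟨lc, uc, f4c, -, -⟩ := facts (e.symm 2)
    exact thirdGap_triple hg rfl (hk1 _) (hk1 _) (hk1 _) la ua lb ub lc uc f4a f4b f4c h₁ h₂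
  · -- `r ≥ 4`: `ρ ≤ M_{r,g} ≤ M_{4,g} = (g−3)² + 3` (Prop. 3.1, Remark 3.3)
    exfalso
    have hle := hiso.finrank_neronSeveriGroup_le_of_powers X n hX hA hXX hn
    have hM : (finrank ℂ E - (Fintype.card ρ - 1)) ^ 2 + (Fintype.card ρ - 1) ≤ (finrank ℂ E - 3) ^ 2 + 3 := by
      rcases h4.eq_or_lt with h | h
      · rw [← h]
      · exact ((sq_sub_add_lt_sq_sub_add (g := finrank ℂ E) (r := 4) (by norm_num) h hrg).trans_le
          le_rfl).le
    omega

variable {A : (ι → ℝ) ≃L[ℝ] E}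

/-- **Hulek–Laface 2019, Thm. 7.4, the case `ℓ = 3` for every abelian variety, with the explicit (and
optimal, `thirdGap_sharp_eight`) threshold `g₃ = 9`**: for an abelian variety `A` of dimension `g ≥ 9`
(a complex torus `E/A(ℤ^ι)` with a Riemann form, `g = dim_ℂ E`, `ρ = rk NS(A)`),
`(g−3)² + 6 < ρ(A) < (g−2)² + 1 ⟹ ρ(A) = (g−3)² + 9`. [cite: HulekLaface2019PicardNumbersAV, §7.2 Thm. 7.4 (case `ℓ = 3`)] [cite: Lange2023AbelianVarietiesComplex, §2.4.4 Thm. 2.4.25] -/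
theorem IsAbelianVariety.finrank_neronSeveriGroup_eq_of_thirdGap (hAV : IsAbelianVariety A)
    (hg : 9 ≤ finrank ℂ E) (h₁ : (finrank ℂ E - 3) ^ 2 + 6 < finrank ℤ (neronSeveriGroup A))
    (h₂ : finrank ℤ (neronSeveriGroup A) < (finrank ℂ E - 2) ^ 2 + 1) :
    finrank ℤ (neronSeveriGroup A) = (finrank ℂ E - 3) ^ 2 + 9 := by
  obtain ⟨ω, hω⟩ := hAV
  obtain ⟨r, V, hV, hVc, n, hVpos, hVs, hVab, hVV, hn, hiso⟩ := IsRiemannForm.exists_isIsogenous_powers_pos A hω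
  haveI : ∀ ν, Nonempty (Fin (subRank (V ν))) := fun ν ↦ ⟨⟨0, hVpos ν⟩⟩
  exact hiso.finrank_neronSeveriGroup_eq_of_thirdGap_of_powers _ n hVs hVab hVV hn hg h₁ h₂

/-- **Thm. 7.4, `ℓ = 3`, in the printed form of its proof ("there is no abelian variety of dimension
`g ≥ g_ℓ` and Picard number `ρ` such that `(g−t)² + t² < ρ < (g−t+1)² + 1`", `t = 3`), with `g₃ = 9`**:
no abelian variety of dimension `g ≥ 9` has `(g−3)² + 9 < ρ < (g−2)² + 1`. [cite: HulekLaface2019PicardNumbersAV, §7.2 Thm. 7.4 (proof, the condition for `t = 3`)] -/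
theorem IsAbelianVariety.not_lt_finrank_neronSeveriGroup_lt_thirdGap (hAV : IsAbelianVariety A)
    (hg : 9 ≤ finrank ℂ E) :
    ¬ ((finrank ℂ E - 3) ^ 2 + 9 < finrank ℤ (neronSeveriGroup A) ∧
      finrank ℤ (neronSeveriGroup A) < (finrank ℂ E - 2) ^ 2 + 1) := by
  rintro ⟨h₁, h₂⟩
  have h := hAV.finrank_neronSeveriGroup_eq_of_thirdGap hg (by omega) h₂
  omega

/-- **The two holes of the box `R_{g,3} = (g−3)² + R_3`** (`R_3 = {1,…,6,9}`): for `g ≥ 9` no abelian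
variety of dimension `g` has Picard number `(g−3)² + 7` or `(g−3)² + 8`. [cite: HulekLaface2019PicardNumbersAV, §7.2 Thm. 7.4 (`[(g−ℓ)²+1, g²] ∩ R_g = ⊔ R_{g,k}`, `ℓ = 3`) and §1 (`R_3 = {1, …, 6, 9}`)] -/
theorem IsAbelianVariety.finrank_neronSeveriGroup_ne_thirdBox (hAV : IsAbelianVariety A)
    (hg : 9 ≤ finrank ℂ E) :
    finrank ℤ (neronSeveriGroup A) ≠ (finrank ℂ E - 3) ^ 2 + 7 ∧
      finrank ℤ (neronSeveriGroup A) ≠ (finrank ℂ E - 3) ^ 2 + 8 := by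
  have hsq : (finrank ℂ E - 3) ^ 2 + 9 < (finrank ℂ E - 2) ^ 2 + 1 := by
    obtain ⟨t, ht⟩ : ∃ t, finrank ℂ E = t + 3 := ⟨finrank ℂ E - 3, by omega⟩
    rw [ht, show t + 3 - 3 = t from by omega, show t + 3 - 2 = t + 1 from by omega]
    nlinarith
  constructor
  · intro h
    have := hAV.finrank_neronSeveriGroup_eq_of_thirdGap hg (by omega) (by omega)
    omega
  · intro h
    have := hAV.finrank_neronSeveriGroup_eq_of_thirdGap hg (by omega) (by omega)
    omega

/-- **The five largest boxes** (Thm. 7.4's picture `R_{g,3} R_{g,2} •^{(g−1)²+1} •^{g²}` for `g ≥ 9`):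
`ρ(A) ≤ (g−3)² + 6`, or `ρ(A) = (g−3)² + 9`, or `(g−2)² + 1 ≤ ρ(A) ≤ (g−2)² + 4`, or `ρ(A) = (g−1)² + 1`,
or `ρ(A) = g²`. [cite: HulekLaface2019PicardNumbersAV, §7.2 Thm. 7.4 (`ℓ = 3`) with Thm. 1.1] -/
theorem IsAbelianVariety.finrank_neronSeveriGroup_le_thirdGap_or (hAV : IsAbelianVariety A)
    (hg : 9 ≤ finrank ℂ E) :
    finrank ℤ (neronSeveriGroup A) ≤ (finrank ℂ E - 3) ^ 2 + 6 ∨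
      finrank ℤ (neronSeveriGroup A) = (finrank ℂ E - 3) ^ 2 + 9 ∨
      ((finrank ℂ E - 2) ^ 2 + 1 ≤ finrank ℤ (neronSeveriGroup A) ∧
        finrank ℤ (neronSeveriGroup A) ≤ (finrank ℂ E - 2) ^ 2 + 4) ∨
      finrank ℤ (neronSeveriGroup A) = (finrank ℂ E - 1) ^ 2 + 1 ∨
      finrank ℤ (neronSeveriGroup A) = finrank ℂ E ^ 2 := by
  have h7 := hAV.finrank_neronSeveriGroup_le_secondGap_or (by omega)
  by_cases hlo : finrank ℤ (neronSeveriGroup A) ≤ (finrank ℂ E - 3) ^ 2 + 6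
  · exact Or.inl hlo
  by_cases hhi : (finrank ℂ E - 2) ^ 2 + 1 ≤ finrank ℤ (neronSeveriGroup A)
  · omega
  · exact Or.inr (Or.inl (hAV.finrank_neronSeveriGroup_eq_of_thirdGap hg (by omega) (by omega)))

end Decomposition

/-! ## §4 The third gap on `R_g`, the members of the boxes, and sharpness of `g₃ = 9` -/

section PicardNumbers

/-- Transport of a membership `a ∈ R_g` along equalities of the two numbers. [folklore] -/
private theorem mem_picardNumbers_congr {a b g h : ℕ} (hm : a ∈ picardNumbers g) (hab : a = b)
    (hgh : g = h) : b ∈ picardNumbers h := hab ▸ hgh ▸ hm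

/-- **Thm. 7.4 (`ℓ = 3`) on `R_g`: for `g ≥ 9`, `R_g ∩ ((g−3)² + 6, (g−2)² + 1) ⊆ {(g−3)² + 9}`.** [cite: HulekLaface2019PicardNumbersAV, §7.2 Thm. 7.4 (`ℓ = 3`)] -/
theorem not_mem_picardNumbers_of_thirdGap {g n : ℕ} (hg : 9 ≤ g) (h₁ : (g - 3) ^ 2 + 6 < n)
    (h₂ : n < (g - 2) ^ 2 + 1) (h₃ : n ≠ (g - 3) ^ 2 + 9) : n ∉ picardNumbers g := by
  rintro ⟨X, hX, rfl⟩
  have h := hX.finrank_neronSeveriGroup_eq_of_thirdGap (by rw [Module.finrank_fin_fun]; exact hg)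
  rw [Module.finrank_fin_fun] at h
  exact h₃ (h h₁ h₂)

/-- **The members `(g−3)² + {3, 4, 5, 6, 9}` of the box `R_{g,3} = (g−3)² + R_3`** (`g ≥ 3`), by products
of elliptic curves: `E^{g−3} × E₁ × E₂ × E₃`, `E^{g−3} × E_θ² × E'`, `E^{g−3} × E'² × E_θ`,
`E^{g−3} × E_θ³`, `E^{g−3} × E'³` (`E, E', E_i` with complex multiplication and pairwise non-isogenous,
`E_θ` without; Cor. 2.3, Cor. 2.6). [cite: HulekLaface2019PicardNumbersAV, §7.2 (`R_{g,k} + R_n ⊂ R_{g+n,k+n}`) with §1 (`R_3`) and §6.2 Remark 6.5] -/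
theorem thirdBox_mem_picardNumbers {g : ℕ} (hg : 3 ≤ g) :
    (g - 3) ^ 2 + 3 ∈ picardNumbers g ∧ (g - 3) ^ 2 + 4 ∈ picardNumbers g ∧
      (g - 3) ^ 2 + 5 ∈ picardNumbers g ∧ (g - 3) ^ 2 + 6 ∈ picardNumbers g ∧
      (g - 3) ^ 2 + 9 ∈ picardNumbers g := by
  have c12 : Nat.choose 1 2 = 0 := by decide
  have c22 : Nat.choose 2 2 = 1 := by decide
  have c32 : Nat.choose 3 2 = 3 := by decide
  have c42 : Nat.choose 4 2 = 6 := by decide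
  refine ⟨?_, ?_, ?_, ?_, ?_⟩
  · have h := choose_add_sum_sq_mem_picardNumbers (S := Fin 4) ![g - 3, 1, 1, 1] 0
    simp only [Fin.sum_univ_four, Matrix.cons_val_zero, Matrix.cons_val_one, Matrix.cons_val] at h
    exact mem_picardNumbers_congr h (by norm_num [c12]) (by omega)
  · have h := choose_add_sum_sq_mem_picardNumbers (S := Fin 2) ![g - 3, 1] 2
    simp only [Fin.sum_univ_two, Matrix.cons_val_zero, Matrix.cons_val_one] at h
    exact mem_picardNumbers_congr h (by norm_num [c32]; omega) (by omega)
  · have h := choose_add_sum_sq_mem_picardNumbers (S := Fin 2) ![g - 3, 2] 1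
    simp only [Fin.sum_univ_two, Matrix.cons_val_zero, Matrix.cons_val_one] at h
    exact mem_picardNumbers_congr h (by norm_num [c22]; omega) (by omega)
  · have h := choose_add_sum_sq_mem_picardNumbers (S := Fin 1) ![g - 3] 3
    simp only [Fin.sum_univ_one, Matrix.cons_val_zero] at h
    exact mem_picardNumbers_congr h (by norm_num [c42]; omega) (by omega)
  · have h := choose_add_sum_sq_mem_picardNumbers (S := Fin 2) ![g - 3, 3] 0
    simp only [Fin.sum_univ_two, Matrix.cons_val_zero, Matrix.cons_val_one] at h
    exact mem_picardNumbers_congr h (by norm_num [c12]) (by omega)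

/-- **The members `(g−2)² + {2, 3, 4}` of the box `R_{g,2} = (g−2)² + R_2`** (`g ≥ 2`; `R_2 = {1,2,3,4}`):
`E^{g−2} × E₁ × E₂`, `E^{g−2} × E_θ²`, `E^{g−2} × E'²`; the member `(g−2)² + 1` needs a very general
abelian surface (Prop. 6.4) and is not produced here. [cite: HulekLaface2019PicardNumbersAV, §7.2 (`R_{g,2}`) with §1 (`R_2 = {1,2,3,4}`) and §6.2 Remark 6.5] -/
theorem secondBox_mem_picardNumbers {g : ℕ} (hg : 2 ≤ g) :
    (g - 2) ^ 2 + 2 ∈ picardNumbers g ∧ (g - 2) ^ 2 + 3 ∈ picardNumbers g ∧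
      (g - 2) ^ 2 + 4 ∈ picardNumbers g := by
  have c12 : Nat.choose 1 2 = 0 := by decide
  have c32 : Nat.choose 3 2 = 3 := by decide
  refine ⟨?_, ?_, ?_⟩
  · have h := choose_add_sum_sq_mem_picardNumbers (S := Fin 3) ![g - 2, 1, 1] 0
    simp only [Fin.sum_univ_three, Matrix.cons_val_zero, Matrix.cons_val_one, Matrix.cons_val] at h
    exact mem_picardNumbers_congr h (by norm_num [c12]) (by omega)
  · have h := choose_add_sum_sq_mem_picardNumbers (S := Fin 1) ![g - 2] 2
    simp only [Fin.sum_univ_one, Matrix.cons_val_zero] at h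
    exact mem_picardNumbers_congr h (by norm_num [c32]; omega) (by omega)
  · have h := choose_add_sum_sq_mem_picardNumbers (S := Fin 2) ![g - 2, 2] 0
    simp only [Fin.sum_univ_two, Matrix.cons_val_zero, Matrix.cons_val_one] at h
    exact mem_picardNumbers_congr h (by norm_num [c12]) (by omega)

/-- **Thm. 7.4 (`ℓ = 3`) on `R_g` as an equality: for `g ≥ 9`,
`R_g ∩ ((g−3)² + 6, (g−2)² + 1) = {(g−3)² + 9}`.** [cite: HulekLaface2019PicardNumbersAV, §7.2 Thm. 7.4 (`ℓ = 3`)] -/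
theorem picardNumbers_inter_Ioo_thirdGap {g : ℕ} (hg : 9 ≤ g) :
    picardNumbers g ∩ Set.Ioo ((g - 3) ^ 2 + 6) ((g - 2) ^ 2 + 1) = {(g - 3) ^ 2 + 9} := by
  have hsq : (g - 3) ^ 2 + 9 < (g - 2) ^ 2 + 1 := by
    obtain ⟨t, rfl⟩ : ∃ t, g = t + 3 := ⟨g - 3, by omega⟩
    rw [show t + 3 - 3 = t from by omega, show t + 3 - 2 = t + 1 from by omega]
    nlinarith
  ext n
  simp only [Set.mem_inter_iff, Set.mem_Ioo, Set.mem_singleton_iff]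
  constructor
  · rintro ⟨hn, h₁, h₂⟩
    by_contra h₃
    exact not_mem_picardNumbers_of_thirdGap hg h₁ h₂ h₃ hn
  · rintro rfl
    exact ⟨(thirdBox_mem_picardNumbers (by omega)).2.2.2.2, by omega, hsq⟩

/-- **Sharpness of `g₃ = 9`: `36 ∈ R_8`** (`ρ(E⁸) = C(9, 2) = 36` for `E` without complex multiplication,
Cor. 2.6) **lies in `((8−3)² + 6, (8−2)² + 1) = (31, 37)` and is not `(8−3)² + 9 = 34`** — the statement of
`IsAbelianVariety.finrank_neronSeveriGroup_eq_of_thirdGap` fails in dimension `8` (and the `t = 3`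
condition of Thm. 7.4's proof fails there too: `34 < 36 < 37`). [cite: HulekLaface2019PicardNumbersAV, §2.2 Cor. 2.6 and §7.2 Thm. 7.4] -/
theorem thirdGap_sharp_eight :
    36 ∈ picardNumbers 8 ∧ (8 - 3) ^ 2 + 6 < 36 ∧ 36 < (8 - 2) ^ 2 + 1 ∧ 36 ≠ (8 - 3) ^ 2 + 9 ∧
      (8 - 3) ^ 2 + 9 < 36 := by
  refine ⟨?_, by norm_num, by norm_num, by norm_num, by norm_num⟩
  have h36 : Nat.choose 9 2 = 36 := by decide
  simpa [h36] using choose_add_sum_sq_mem_picardNumbers (S := Fin 0) (fun i ↦ i.elim0) 8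

end PicardNumbers

/-! ## §5 Structure at the top of the third box: `ρ(A) = (g−3)² + 9 ⟺ A ∼ E_1^{g−3} × E_2³` (`g ≥ 10`)

[cite: HulekLaface2019PicardNumbersAV, §7.2 Cor. 7.6 (Structure theorem for abelian varieties of large
Picard number)]: "For every positive integer `ℓ` there exists a genus `g_ℓ` such that for all `g ≥ g_ℓ`
the following are equivalent: (1) `ρ(X) ∈ R_{g,n}` for some `n ≤ ℓ`; (2) `X ∼ E^{g−n} × A_n`, where `E`
is an elliptic curve with complex multiplication, `A_n` is an abelian variety of dimension `n`, and
`Hom(E, A_n) = 0`."  At the top value `(g−3)² + 9 = (g−3)² + max R_3` of the box `R_{g,3}` the case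
analysis of §1 pins the shape down completely, in the style of Thm. 4.2: for `g ≥ 10`,
`ρ(A) = (g−3)² + 9` iff `A ∼ E_1^{g−3} × E_2³` with `E_1`, `E_2` non-isogenous elliptic curves with
complex multiplication.  The threshold `10` is needed here: in dimension `9` the self-product `E⁹` of a
curve WITHOUT complex multiplication also has `ρ = C(10, 2) = 45 = (9−3)² + 9` (`choose_succ_eq_thirdGap`). -/

section StructureArithmetic

/-- **`r(A) = 2` in the third gap, ordered form, with the shape recorded**: under the hypotheses of
`thirdGap_pair_aux` the smaller factor has dimension `k₂ = 3` and Picard number `9 = 3²`, and the larger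
one has the maximal Picard number `ρ₁ = k₁²`. [cite: HulekLaface2019PicardNumbersAV, §7.2 Thm. 7.4 (proof) and Cor. 7.6] -/
theorem thirdGap_pair_shape_aux {g k₁ k₂ ρ₁ ρ₂ : ℕ} (hg : 9 ≤ g) (hk : k₁ + k₂ = g) (hle : k₂ ≤ k₁)
    (hk₂ : 1 ≤ k₂) (u₁ : ρ₁ ≤ k₁ ^ 2) (l₂ : 1 ≤ ρ₂) (u₂ : ρ₂ ≤ k₂ ^ 2)
    (f4₁ : 4 ≤ k₁ → ρ₁ = k₁ ^ 2 ∨ ρ₁ ≤ (k₁ - 1) ^ 2 + 1)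
    (f7₁ : 7 ≤ k₁ → ρ₁ ≤ (k₁ - 2) ^ 2 + 4 ∨ ρ₁ = (k₁ - 1) ^ 2 + 1 ∨ ρ₁ = k₁ ^ 2)
    (f3₂ : k₂ = 3 → ρ₂ ≤ 6 ∨ ρ₂ = 9)
    (h₁ : (g - 3) ^ 2 + 6 < ρ₁ + ρ₂) (h₂ : ρ₁ + ρ₂ < (g - 2) ^ 2 + 1) :
    k₂ = 3 ∧ ρ₁ = k₁ ^ 2 ∧ ρ₂ = 9 := by
  subst hk
  rcases (show k₂ = 1 ∨ k₂ = 2 ∨ k₂ = 3 ∨ 4 ≤ k₂ by omega) with rfl | rfl | rfl | hk4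
  · exfalso
    obtain ⟨t, rfl⟩ : ∃ t, k₁ = t + 8 := ⟨k₁ - 8, by omega⟩
    have f := f7₁ (by omega)
    rw [show t + 8 + 1 - 3 = t + 6 from by omega] at h₁
    rw [show t + 8 + 1 - 2 = t + 7 from by omega] at h₂
    rw [show t + 8 - 2 = t + 6 from by omega, show t + 8 - 1 = t + 7 from by omega] at f
    ring_nf at f h₁ h₂ u₂
    omega
  · exfalso
    obtain ⟨t, rfl⟩ : ∃ t, k₁ = t + 7 := ⟨k₁ - 7, by omega⟩
    have f := f4₁ (by omega)
    rw [show t + 7 + 2 - 3 = t + 6 from by omega] at h₁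
    rw [show t + 7 + 2 - 2 = t + 7 from by omega] at h₂
    rw [show t + 7 - 1 = t + 6 from by omega] at f
    ring_nf at f h₁ h₂ u₂
    omega
  · refine ⟨rfl, ?_⟩
    obtain ⟨t, rfl⟩ : ∃ t, k₁ = t + 6 := ⟨k₁ - 6, by omega⟩
    have f := f4₁ (by omega)
    have f' := f3₂ rfl
    rw [show t + 6 + 3 - 3 = t + 6 from by omega] at h₁
    rw [show t + 6 + 3 - 2 = t + 7 from by omega] at h₂
    rw [show t + 6 - 1 = t + 5 from by omega] at f
    ring_nf at f f' h₁ h₂ u₂ ⊢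
    omega
  · exfalso
    obtain ⟨u, rfl⟩ : ∃ u, k₁ = u + 4 := ⟨k₁ - 4, by omega⟩
    obtain ⟨v, rfl⟩ : ∃ v, k₂ = v + 4 := ⟨k₂ - 4, by omega⟩
    rw [show u + 4 + (v + 4) - 3 = u + v + 5 from by omega] at h₁
    have huv := Nat.zero_le (u * v)
    ring_nf at h₁ u₁ u₂ huv hg
    omega

/-- **`r(A) = 2` in the third gap, with the shape recorded**: one isotypic factor has dimension `3` and
Picard number `9`, the other has the maximal Picard number `k²` (so both are powers of elliptic curves
with complex multiplication, `IsIsogenous.finrank_neronSeveriGroup_eq_sq_sub_three_add_nine_iff_of_powers`).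
[cite: HulekLaface2019PicardNumbersAV, §7.2 Thm. 7.4 (proof) and Cor. 7.6] -/
theorem thirdGap_pair_shape {g k₁ k₂ ρ₁ ρ₂ : ℕ} (hg : 9 ≤ g) (hk : k₁ + k₂ = g) (hk₁ : 1 ≤ k₁)
    (hk₂ : 1 ≤ k₂) (l₁ : 1 ≤ ρ₁) (u₁ : ρ₁ ≤ k₁ ^ 2) (l₂ : 1 ≤ ρ₂) (u₂ : ρ₂ ≤ k₂ ^ 2)
    (f4₁ : 4 ≤ k₁ → ρ₁ = k₁ ^ 2 ∨ ρ₁ ≤ (k₁ - 1) ^ 2 + 1)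
    (f7₁ : 7 ≤ k₁ → ρ₁ ≤ (k₁ - 2) ^ 2 + 4 ∨ ρ₁ = (k₁ - 1) ^ 2 + 1 ∨ ρ₁ = k₁ ^ 2)
    (f3₁ : k₁ = 3 → ρ₁ ≤ 6 ∨ ρ₁ = 9)
    (f4₂ : 4 ≤ k₂ → ρ₂ = k₂ ^ 2 ∨ ρ₂ ≤ (k₂ - 1) ^ 2 + 1)
    (f7₂ : 7 ≤ k₂ → ρ₂ ≤ (k₂ - 2) ^ 2 + 4 ∨ ρ₂ = (k₂ - 1) ^ 2 + 1 ∨ ρ₂ = k₂ ^ 2)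
    (f3₂ : k₂ = 3 → ρ₂ ≤ 6 ∨ ρ₂ = 9)
    (h₁ : (g - 3) ^ 2 + 6 < ρ₁ + ρ₂) (h₂ : ρ₁ + ρ₂ < (g - 2) ^ 2 + 1) :
    (k₂ = 3 ∧ ρ₁ = k₁ ^ 2 ∧ ρ₂ = 9) ∨ (k₁ = 3 ∧ ρ₂ = k₂ ^ 2 ∧ ρ₁ = 9) := by
  rcases le_total k₂ k₁ with h | h
  · exact Or.inl (thirdGap_pair_shape_aux hg hk h hk₂ u₁ l₂ u₂ f4₁ f7₁ f3₂ h₁ h₂)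
  · exact Or.inr (thirdGap_pair_shape_aux hg ((add_comm _ _).trans hk) h hk₁ u₂ l₁ u₁ f4₂ f7₂ f3₁
      (by rwa [add_comm ρ₂ ρ₁]) (by rwa [add_comm ρ₂ ρ₁]))

end StructureArithmetic

section StructureDecomposition

variable {ι : Type*} [Fintype ι] [DecidableEq ι] {E : Type*} [NormedAddCommGroup E] [NormedSpace ℂ E]
  {ρ : Type*} [Fintype ρ] [DecidableEq ρ] {τ : ρ → Type*} [∀ ν, Fintype (τ ν)] [∀ ν, DecidableEq (τ ν)]
  [∀ ν, Nonempty (τ ν)]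
  {G : ρ → Type*} [∀ ν, NormedAddCommGroup (G ν)] [∀ ν, NormedSpace ℂ (G ν)]
  (X : ∀ ν, (τ ν → ℝ) ≃L[ℝ] G ν) (n : ρ → ℕ)

/-- **The structure at `ρ = (g−3)² + 9` along a Poincaré decomposition (`g ≥ 10`)**: for simple, nonzero,
pairwise non-isogenous abelian varieties `X_ν`, `n_ν ≥ 1` and `A ∼ ∏_ν X_ν^{n_ν}` of dimension `g ≥ 10`,
`ρ(A) = (g−3)² + 9` iff the decomposition has length `2`, both factors are elliptic curves with complex
multiplication, and one exponent is `3` (the other is then `g − 3`) — Cor. 7.6's shape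
`X ∼ E^{g−3} × A_3` with `A_3 = E'³`, `ρ(A_3) = 9 = max R_3`.  (⟹): §1's case analysis leaves `r = 2`
with factor dimensions `{g−3, 3}` and maximal Picard numbers `k²` (`thirdGap_pair_shape`); a power `Xⁿ`
with `ρ(Xⁿ) = (n dim X)²`, `n dim X ≥ 2`, is `∼ E_θ^{n dim X}` with `E_θ` CM
(`finrank_neronSeveriGroup_eq_sq_iff_exists_isIsogenous_ellipticPow_cm`), whence `X ∼ E_θ`, `dim X = 1`
(Poincaré uniqueness, `IsSimple.isIsogenous_ellipticPeriod_of_pow`).  (⟸): Cor. 2.3 and `ρ(Eⁿ) = n²`.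
[cite: HulekLaface2019PicardNumbersAV, §7.2 Cor. 7.6 (`n = 3`) with Thm. 7.4 and §3.1 Cor. 3.2] -/
theorem IsIsogenous.finrank_neronSeveriGroup_eq_sq_sub_three_add_nine_iff_of_powers {A : (ι → ℝ) ≃L[ℝ] E}
    (hiso : IsIsogenous A (sigmaPiPeriod fun ν ↦ powPeriod (X ν) (n ν))) (hX : ∀ ν, IsSimple (X ν))
    (hA : ∀ ν, IsAbelianVariety (X ν)) (hXX : ∀ ν ν', ν ≠ ν' → ¬ IsIsogenous (X ν) (X ν'))
    (hn : ∀ ν, 0 < n ν) (hg : 10 ≤ finrank ℂ E) :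
    finrank ℤ (neronSeveriGroup A) = (finrank ℂ E - 3) ^ 2 + 9 ↔
      Fintype.card ρ = 2 ∧ (∀ ν, finrank ℂ (G ν) = 1) ∧ (∀ ν, finrank ℚ (endAlgRat (X ν)) = 2) ∧
        ∃ ν, n ν = 3 := by
  haveI : ∀ ν, FiniteDimensional ℂ (G ν) := fun ν ↦ finiteDimensional_complex_of_period (X ν)
  have hgsum : finrank ℂ E = ∑ ν, n ν * finrank ℂ (G ν) := by
    rw [hiso.finrank_eq _ _, finrank_powers_eq X n]
  have hρsum : finrank ℤ (neronSeveriGroup A) = ∑ ν, finrank ℤ (neronSeveriGroup (powPeriod (X ν) (n ν))) := by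
    rw [hiso.finrank_neronSeveriGroup_eq _ _, finrank_neronSeveriGroup_powers X n hX hA hXX]
  have hk1 : ∀ ν, 1 ≤ n ν * finrank ℂ (G ν) := one_le_mul_finrank X n hn
  have hkd : ∀ ν, finrank ℂ (Fin (n ν) → G ν) = n ν * finrank ℂ (G ν) := fun ν ↦ finrank_fin_fun (n ν) (G ν)
  -- a power `X_ν^{n_ν}` with the maximal Picard number `k_ν²`, `k_ν ≥ 2`, is a power of a CM elliptic curve
  have hcmof : ∀ ν, 2 ≤ n ν * finrank ℂ (G ν) →
      finrank ℤ (neronSeveriGroup (powPeriod (X ν) (n ν))) = (n ν * finrank ℂ (G ν)) ^ 2 →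
      finrank ℂ (G ν) = 1 ∧ finrank ℚ (endAlgRat (X ν)) = 2 := fun ν hk2 heq ↦ by
    have hmax : finrank ℤ (neronSeveriGroup (powPeriod (X ν) (n ν))) = (finrank ℂ (Fin (n ν) → G ν)) ^ 2 := by
      rw [hkd, heq]
    obtain ⟨θ, hθ, hcm, hiso'⟩ :=
      (finrank_neronSeveriGroup_eq_sq_iff_exists_isIsogenous_ellipticPow_cm (powPeriod (X ν) (n ν))
        (by rw [hkd]; exact hk2)).1 hmax
    rw [hkd] at hiso'
    obtain ⟨hXE, -⟩ := (hX ν).isIsogenous_ellipticPeriod_of_pow (hn ν) (lt_of_lt_of_le two_pos hk2) hθ hiso'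
    exact ⟨by rw [hXE.finrank_eq _ _]; exact Module.finrank_self ℂ,
      by rw [hXE.finrank_endAlgRat_eq, finrank_endAlgRat_ellipticPeriod_eq_two_iff]; exact hcm⟩
  constructor
  · intro h
    -- the value lies in the third gap, so §3's case analysis applies; we redo it keeping the shape
    have hlt : (finrank ℂ E - 3) ^ 2 + 9 < (finrank ℂ E - 2) ^ 2 + 1 := by
      obtain ⟨t, ht⟩ : ∃ t, finrank ℂ E = t + 3 := ⟨finrank ℂ E - 3, by omega⟩
      rw [ht, show t + 3 - 3 = t from by omega, show t + 3 - 2 = t + 1 from by omega]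
      nlinarith
    have h₁ : (finrank ℂ E - 3) ^ 2 + 6 < finrank ℤ (neronSeveriGroup A) := by omega
    have h₂ : finrank ℤ (neronSeveriGroup A) < (finrank ℂ E - 2) ^ 2 + 1 := by omega
    have facts : ∀ ν, 1 ≤ finrank ℤ (neronSeveriGroup (powPeriod (X ν) (n ν))) ∧
        finrank ℤ (neronSeveriGroup (powPeriod (X ν) (n ν))) ≤ (n ν * finrank ℂ (G ν)) ^ 2 ∧
        (4 ≤ n ν * finrank ℂ (G ν) →
          finrank ℤ (neronSeveriGroup (powPeriod (X ν) (n ν))) = (n ν * finrank ℂ (G ν)) ^ 2 ∨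
          finrank ℤ (neronSeveriGroup (powPeriod (X ν) (n ν))) ≤ (n ν * finrank ℂ (G ν) - 1) ^ 2 + 1) ∧
        (7 ≤ n ν * finrank ℂ (G ν) →
          finrank ℤ (neronSeveriGroup (powPeriod (X ν) (n ν))) ≤ (n ν * finrank ℂ (G ν) - 2) ^ 2 + 4 ∨
          finrank ℤ (neronSeveriGroup (powPeriod (X ν) (n ν))) = (n ν * finrank ℂ (G ν) - 1) ^ 2 + 1 ∨
          finrank ℤ (neronSeveriGroup (powPeriod (X ν) (n ν))) = (n ν * finrank ℂ (G ν)) ^ 2) ∧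
        (n ν * finrank ℂ (G ν) = 3 →
          finrank ℤ (neronSeveriGroup (powPeriod (X ν) (n ν))) ≤ 6 ∨
          finrank ℤ (neronSeveriGroup (powPeriod (X ν) (n ν))) = 9) := fun ν ↦ by
      have h := ((hA ν).pow (n ν)).finrank_neronSeveriGroup_facts (by rw [hkd]; exact hk1 ν)
      rw [hkd ν] at h
      exact h
    have hrg : Fintype.card ρ ≤ finrank ℂ E := by
      rw [hgsum]
      calc Fintype.card ρ = ∑ _ν : ρ, 1 := by simp
        _ ≤ ∑ ν, n ν * finrank ℂ (G ν) := Finset.sum_le_sum fun ν _ ↦ hk1 ν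
    rcases (show Fintype.card ρ = 0 ∨ Fintype.card ρ = 1 ∨ Fintype.card ρ = 2 ∨ Fintype.card ρ = 3 ∨
        4 ≤ Fintype.card ρ by omega) with h0 | h1 | h2 | h3 | h4
    · exfalso
      haveI : IsEmpty ρ := Fintype.card_eq_zero_iff.1 h0
      rw [Finset.univ_eq_empty, Finset.sum_empty] at hgsum
      omega
    · -- `r = 1`, `g ≥ 10`: `ρ = g²` or `ρ ≤ C(g+1, 2) ≤ (g−3)² + 6`
      exfalso
      rcases hiso.finrank_neronSeveriGroup_eq_sq_or_le_choose_of_card_eq_one X n hX hA hn h1 with h' | h'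
      · have hsq : (finrank ℂ E - 2) ^ 2 + 1 ≤ finrank ℂ E ^ 2 := by
          obtain ⟨t, ht⟩ : ∃ t, finrank ℂ E = t + 2 := ⟨finrank ℂ E - 2, by omega⟩
          rw [ht, show t + 2 - 2 = t from by omega]
          nlinarith
        omega
      · exact absurd (h'.trans (choose_succ_le_thirdGap hg)) (not_le.2 h₁)
    · -- `r = 2`: the shape
      obtain e := Fintype.equivFinOfCardEq h2
      have hs : ∀ f : ρ → ℕ, ∑ ν, f ν = f (e.symm 0) + f (e.symm 1) := fun f ↦ by
        rw [← e.symm.sum_comp f, Fin.sum_univ_two]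
      have hmem : ∀ ν : ρ, ν = e.symm 0 ∨ ν = e.symm 1 := fun ν ↦ by
        have key : ∀ i : Fin 2, e.symm i = e.symm 0 ∨ e.symm i = e.symm 1 :=
          Fin.forall_fin_two.2 ⟨Or.inl rfl, Or.inr rfl⟩
        simpa using key (e ν)
      rw [hρsum, hs] at h₁ h₂
      rw [hgsum, hs] at h₁ h₂ hg
      obtain ⟨l₁, u₁, f4₁, f7₁, f3₁⟩ := facts (e.symm 0)
      obtain ⟨l₂, u₂, f4₂, f7₂, f3₂⟩ := facts (e.symm 1)
      have hshape := thirdGap_pair_shape (by omega) rfl (hk1 _) (hk1 _) l₁ u₁ l₂ u₂ f4₁ f7₁ f3₁ f4₂ f7₂ f3₂ h₁ h₂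
      -- both factors are powers of CM elliptic curves; the small one has exponent `3`
      have hboth : ∀ {x y : ρ}, (∀ ν : ρ, ν = x ∨ ν = y) → 10 ≤ n x * finrank ℂ (G x) + n y * finrank ℂ (G y) →
          n y * finrank ℂ (G y) = 3 →
          finrank ℤ (neronSeveriGroup (powPeriod (X x) (n x))) = (n x * finrank ℂ (G x)) ^ 2 →
          finrank ℤ (neronSeveriGroup (powPeriod (X y) (n y))) = 9 →
          Fintype.card ρ = 2 ∧ (∀ ν, finrank ℂ (G ν) = 1) ∧ (∀ ν, finrank ℚ (endAlgRat (X ν)) = 2) ∧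
            ∃ ν, n ν = 3 := by
        intro x y hxy hg' hk3 hρx hρy
        have hx := hcmof x (by omega) hρx
        have hy := hcmof y (by omega) (by rw [hk3, hρy]; norm_num)
        refine ⟨h2, fun ν ↦ ?_, fun ν ↦ ?_, ⟨y, by simpa [hy.1] using hk3⟩⟩
        · rcases hxy ν with rfl | rfl
          · exact hx.1
          · exact hy.1
        · rcases hxy ν with rfl | rfl
          · exact hx.2
          · exact hy.2
      rcases hshape with ⟨hk3, hρ₁, hρ₂⟩ | ⟨hk3, hρ₂, hρ₁⟩
      · exact hboth hmem hg hk3 hρ₁ hρ₂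
      · exact hboth (fun ν ↦ (hmem ν).symm) (by omega) hk3 hρ₂ hρ₁
    · exfalso
      obtain e := Fintype.equivFinOfCardEq h3
      have hs : ∀ f : ρ → ℕ, ∑ ν, f ν = f (e.symm 0) + f (e.symm 1) + f (e.symm 2) := fun f ↦ by
        rw [← e.symm.sum_comp f, Fin.sum_univ_three]
      rw [hρsum, hs] at h₁ h₂
      rw [hgsum, hs] at h₁ h₂ hg
      obtain ⟨la, ua, f4a, -, -⟩ := facts (e.symm 0)
      obtain ⟨lb, ub, f4b, -, -⟩ := facts (e.symm 1)
      obtain ⟨lc, uc, f4c, -, -⟩ := facts (e.symm 2)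
      exact thirdGap_triple (by omega) rfl (hk1 _) (hk1 _) (hk1 _) la ua lb ub lc uc f4a f4b f4c h₁ h₂
    · exfalso
      have hle := hiso.finrank_neronSeveriGroup_le_of_powers X n hX hA hXX hn
      have hM : (finrank ℂ E - (Fintype.card ρ - 1)) ^ 2 + (Fintype.card ρ - 1) ≤ (finrank ℂ E - 3) ^ 2 + 3 := by
        rcases h4.eq_or_lt with h' | h'
        · rw [← h']
        · exact ((sq_sub_add_lt_sq_sub_add (g := finrank ℂ E) (r := 4) (by norm_num) h' hrg).trans_le
            le_rfl).le
      omega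
  · rintro ⟨h2, hd, hcm, ν₃, hν₃⟩
    obtain e := Fintype.equivFinOfCardEq h2
    have hs : ∀ f : ρ → ℕ, ∑ ν, f ν = f (e.symm 0) + f (e.symm 1) := fun f ↦ by
      rw [← e.symm.sum_comp f, Fin.sum_univ_two]
    have hmem : ∀ ν : ρ, ν = e.symm 0 ∨ ν = e.symm 1 := fun ν ↦ by
      have key : ∀ i : Fin 2, e.symm i = e.symm 0 ∨ e.symm i = e.symm 1 :=
        Fin.forall_fin_two.2 ⟨Or.inl rfl, Or.inr rfl⟩
      simpa using key (e ν)
    have hterm : ∀ ν, finrank ℤ (neronSeveriGroup (powPeriod (X ν) (n ν))) = n ν ^ 2 := fun ν ↦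
      finrank_neronSeveriGroup_pow_of_cm (X ν) (hd ν) (hcm ν) (n ν)
    rw [hρsum, hs, hgsum, hs, hterm, hterm, hd, hd, mul_one, mul_one]
    rcases hmem ν₃ with h | h
    · rw [← h, hν₃, show 3 + n (e.symm 1) - 3 = n (e.symm 1) from by omega]
      ring
    · rw [← h, hν₃, show n (e.symm 0) + 3 - 3 = n (e.symm 0) from by omega]
      ring

/-- An index set with two elements. [folklore] -/
private theorem exists_pair_univ_of_card_eq_two (h : Fintype.card ρ = 2) :
    ∃ x y : ρ, x ≠ y ∧ (Finset.univ : Finset ρ) = {x, y} := by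
  obtain ⟨x, y, hxy, hu⟩ := Finset.card_eq_two.1 ((Finset.card_univ (α := ρ)).trans h)
  exact ⟨x, y, hxy, hu⟩

end StructureDecomposition

section StructureUnconditional

variable {ι : Type*} [Fintype ι] [DecidableEq ι] {E : Type*} [NormedAddCommGroup E] [NormedSpace ℂ E]
  {A : (ι → ℝ) ≃L[ℝ] E}

/-- **Hulek–Laface 2019, Cor. 7.6 at the top of the box `R_{g,3}`, explicit: for every abelian variety `A`
of dimension `g ≥ 10`, `ρ(A) = (g−3)² + 9 ⟺ A ∼ E_1^{g−3} × E_2³` with `E_1`, `E_2` non-isogenous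
elliptic curves with complex multiplication** (`E_i = E_{θ_i}`, `θ_i` in the upper half plane, imaginary
quadratic) — the analogue of Thm. 4.2 (1)–(2) one box further down.  (⟹): the Poincaré decomposition
has length `2`, both factors CM elliptic curves, exponents `{g−3, 3}`
(`IsIsogenous.finrank_neronSeveriGroup_eq_sq_sub_three_add_nine_iff_of_powers`); (⟸):
`ρ(E_{θ₁}^{g−3} × E_{θ₂}³) = (g−3)² + 3²` (`finrank_neronSeveriGroup_ellipticPow_prod_ellipticPow`).  In
dimension `9` the equivalence fails (`E⁹` without complex multiplication has `ρ = 45`).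
[cite: HulekLaface2019PicardNumbersAV, §7.2 Cor. 7.6 (`n = 3`) and §4 Thm. 4.2 (the pattern)] [cite: Lange2023AbelianVarietiesComplex, §2.4.4 Thm. 2.4.25] -/
theorem IsAbelianVariety.finrank_neronSeveriGroup_eq_sq_sub_three_add_nine_iff (hAV : IsAbelianVariety A)
    (hg : 10 ≤ finrank ℂ E) :
    finrank ℤ (neronSeveriGroup A) = (finrank ℂ E - 3) ^ 2 + 9 ↔
      ∃ (θ₁ θ₂ : ℂ) (h₁ : 0 < θ₁.im) (h₂ : 0 < θ₂.im), (∃ a b : ℚ, θ₁ ^ 2 + a * θ₁ + b = 0) ∧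
        (∃ a b : ℚ, θ₂ ^ 2 + a * θ₂ + b = 0) ∧ ¬ IsIsogenous (ellipticPeriod h₂.ne') (ellipticPeriod h₁.ne') ∧
        IsIsogenous A (prodPeriod (powPeriod (ellipticPeriod h₁.ne') (finrank ℂ E - 3))
          (powPeriod (ellipticPeriod h₂.ne') 3)) := by
  constructor
  · intro h
    obtain ⟨ω, hω⟩ := hAV
    obtain ⟨r, V, hV, hVc, n, hVpos, hVs, hVab, hVV, hn, hiso⟩ := IsRiemannForm.exists_isIsogenous_powers_pos A hω
    haveI : ∀ ν, Nonempty (Fin (subRank (V ν))) := fun ν ↦ ⟨⟨0, hVpos ν⟩⟩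
    set X : ∀ ν : Fin r, (Fin (subRank (V ν)) → ℝ) ≃L[ℝ] cxSpan A (V ν) :=
      fun ν ↦ subtorusPeriod A (V ν) (hV ν) (hVc ν) with hXdef
    obtain ⟨h2, hd, hcm, x, hx3⟩ :=
      (hiso.finrank_neronSeveriGroup_eq_sq_sub_three_add_nine_iff_of_powers X n hVs hVab hVV hn hg).1 h
    have hsum : ∑ ν, n ν * finrank ℂ (cxSpan A (V ν)) = finrank ℂ E := by
      rw [hiso.finrank_eq _ _, finrank_powers_eq X n]
    -- the two factors `x` (exponent `3`) and `y` (exponent `g − 3`)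
    obtain ⟨z, z', hzz', hu⟩ := exists_pair_univ_of_card_eq_two h2
    have hmem : ∀ ν : Fin r, ν = z ∨ ν = z' := fun ν ↦ by
      have hν := Finset.mem_univ ν
      rw [hu, Finset.mem_insert, Finset.mem_singleton] at hν
      exact hν
    obtain ⟨y, hyx, hyu⟩ : ∃ y, y ≠ x ∧ ∀ w, w ≠ x → w = y := by
      rcases hmem x with rfl | rfl
      · exact ⟨z', hzz'.symm, fun w hw ↦ (hmem w).resolve_left hw⟩
      · exact ⟨z, hzz', fun w hw ↦ (hmem w).resolve_right hw⟩
    have huniv : (Finset.univ : Finset (Fin r)) = {y, x} := by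
      ext w
      simp only [Finset.mem_univ, Finset.mem_insert, Finset.mem_singleton, true_iff]
      by_cases hw : w = x
      · exact Or.inr hw
      · exact Or.inl (hyu w hw)
    have hny : n y = finrank ℂ E - 3 := by
      have hs := hsum
      rw [huniv, Finset.sum_pair hyx, hd y, hd x, hx3, mul_one, mul_one] at hs
      omega
    -- split `∏_ν X_ν^{n_ν} ≅ X_y^{n_y} × X_x^{n_x}`
    let e : Fin r ≃ {ν // ν = y} ⊕ {ν // ν ≠ y} := (Equiv.sumCompl fun ν ↦ ν = y).symm
    have hsplit := isIsomorphic_sigmaPiPeriod_sumEquiv (fun ν ↦ powPeriod (X ν) (n ν)) e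
    letI : Unique {ν // ν = y} := ⟨⟨⟨y, rfl⟩⟩, fun ν ↦ Subtype.ext ν.2⟩
    letI : Unique {ν // ν ≠ y} := ⟨⟨⟨x, hyx.symm⟩⟩, fun w ↦ Subtype.ext <| by
      rcases hmem w.1 with hw | hw <;> rcases hmem x with hx | hx <;> rcases hmem y with hy' | hy'
      all_goals first | exact absurd (hw.trans hy'.symm) w.2 | exact hw.trans hx.symm |
        exact absurd (hy'.trans hx.symm) hyx⟩
    -- upper half-plane CM representatives of the two factors
    obtain ⟨θ₁, hθ₁, hE₁, hcm₁⟩ := exists_isIsomorphic_ellipticPeriod_of_im_pos_of_cm (X y) (hd y) (hcm y)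
    obtain ⟨θ₂, hθ₂, hE₂, hcm₂⟩ := exists_isIsomorphic_ellipticPeriod_of_im_pos_of_cm (X x) (hd x) (hcm x)
    have hni : ¬ IsIsogenous (ellipticPeriod hθ₂.ne') (ellipticPeriod hθ₁.ne') := fun hiso₂₁ ↦
      hVV x y hyx.symm (IsIsogenous.trans _ _ _ hE₂.isIsogenous
        (IsIsogenous.trans _ _ _ hiso₂₁ (IsIsogenous.symm _ _ hE₁.isIsogenous)))
    refine ⟨θ₁, θ₂, hθ₁, hθ₂, hcm₁, hcm₂, hni, ?_⟩
    have b1 : IsIsogenous (sigmaPiPeriod fun i : {ν // ν = y} ↦ powPeriod (X (e.symm (Sum.inl i))) (n (e.symm (Sum.inl i))))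
        (powPeriod (ellipticPeriod hθ₁.ne') (finrank ℂ E - 3)) := by
      refine IsIsogenous.trans _ _ _
        (isIsomorphic_sigmaPiPeriod_unique fun i : {ν // ν = y} ↦
          powPeriod (X (e.symm (Sum.inl i))) (n (e.symm (Sum.inl i)))).isIsogenous ?_
      change IsIsogenous (powPeriod (X y) (n y)) _
      rw [hny]
      exact hE₁.isIsogenous.pow _ _ _
    have b2 : IsIsogenous (sigmaPiPeriod fun j : {ν // ν ≠ y} ↦ powPeriod (X (e.symm (Sum.inr j))) (n (e.symm (Sum.inr j))))
        (powPeriod (ellipticPeriod hθ₂.ne') 3) := by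
      refine IsIsogenous.trans _ _ _
        (isIsomorphic_sigmaPiPeriod_unique fun j : {ν // ν ≠ y} ↦
          powPeriod (X (e.symm (Sum.inr j))) (n (e.symm (Sum.inr j)))).isIsogenous ?_
      change IsIsogenous (powPeriod (X x) (n x)) _
      rw [hx3]
      exact hE₂.isIsogenous.pow _ _ _
    exact IsIsogenous.trans _ _ _ hiso (IsIsogenous.trans _ _ _ hsplit.isIsogenous (b1.prod b2))
  · rintro ⟨θ₁, θ₂, h₁, h₂, ⟨a, b, hq₁⟩, ⟨a', b', hq₂⟩, hni, hAiso⟩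
    rw [hAiso.finrank_neronSeveriGroup_eq _ _,
      finrank_neronSeveriGroup_ellipticPow_prod_ellipticPow h₁ h₂ (finrank ℂ E - 3) 3 hq₁ hq₂ hni]
    norm_num

end StructureUnconditional

/-! ## §6 Cor. 7.6 for the box `R_{g,2}`, explicit: `(g−2)² < ρ(A) ≤ (g−2)² + 4 ⟹ A ∼ E^{g−2} × A_2` (`g ≥ 8`)

[cite: HulekLaface2019PicardNumbersAV, §7.2 Cor. 7.6]: "`ρ(X) ∈ R_{g,n}` for some `n ≤ ℓ`" ⟺
"`X ∼ E^{g−n} × A_n`, where `E` is an elliptic curve with complex multiplication, `A_n` is an abelian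
variety of dimension `n`, and `Hom(E, A_n) = 0`", for `g ≥ g_ℓ`.  For `n = 2` (`R_{g,2} = (g−2)² + R_2`,
`R_2 = {1,2,3,4}`) the forward implication holds for every `g ≥ 8`, and `8` is optimal: `ρ(E⁷) = C(8,2)
= 28 = (7−2)² + 3 ∈ R_{7,2}` for a curve `E` without complex multiplication, whose Poincaré decomposition
has length `1` (`secondBox_sharp_seven`).  Proof along `A ∼ ∏_ν X_ν^{n_ν}` with `K = max_ν k_ν`:
`K ≤ g − 4` gives `ρ ≤ Σ k_ν² ≤ K g ≤ (g−2)² − 4`; `K = g − 3` gives `ρ ≤ (g−3)² + 9 ≤ (g−2)²`;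
`K = g − 1` gives `ρ ∈ {(g−1)², (g−1)² + 1, (g−2)² + 2 (excluded by Thm. 4.2 (1) for the isotypic
factor)} ∪ [1, (g−3)² + 5]`; `K = g` is `r = 1`, `ρ ≤ C(g+1, 2) ≤ (g−2)²` or `ρ = g²`; so `K = g − 2`
with `ρ(X_{ν₀}^{n_{ν₀}}) = (g−2)²`, i.e. `X_{ν₀}` is a CM elliptic curve and `n_{ν₀} = g − 2`. -/

section SecondBoxArithmetic

/-- `Σ_{i ∈ s} a_i² ≤ (Σ_{i ∈ s} a_i)²` for natural numbers. [folklore] -/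
private theorem sum_sq_le_sq_sum {ρ : Type*} (s : Finset ρ) (a : ρ → ℕ) :
    ∑ i ∈ s, a i ^ 2 ≤ (∑ i ∈ s, a i) ^ 2 := by
  rw [sq (∑ i ∈ s, a i), Finset.sum_mul]
  exact Finset.sum_le_sum fun i hi ↦ by
    rw [sq]
    exact Nat.mul_le_mul_left _ (Finset.single_le_sum (fun j _ ↦ Nat.zero_le (a j)) hi)

/-- **`C(g+1, 2) ≤ (g−2)²` for `g ≥ 8`** (with equality at `g = 8`): self-products of simple abelian
varieties have Picard number below the box `R_{g,2}` from dimension `8` on. [cite: HulekLaface2019PicardNumbersAV, §7.2 (condition (1) "`½ g(g+1) ≤ (g−s)² + 1`", `s = 2`)] -/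
theorem choose_succ_le_sq_sub_two {g : ℕ} (hg : 8 ≤ g) : (g + 1).choose 2 ≤ (g - 2) ^ 2 := by
  obtain ⟨t, rfl⟩ : ∃ t, g = t + 8 := ⟨g - 8, by omega⟩
  rw [show t + 8 - 2 = t + 6 from by omega, Nat.choose_two_right,
    show t + 8 + 1 - 1 = t + 8 from by omega,
    show (t + 8 + 1) * (t + 8) = t ^ 2 + 17 * t + 72 from by ring,
    show (t + 6) ^ 2 = t ^ 2 + 12 * t + 36 from by ring]
  omega

end SecondBoxArithmetic

section SecondBoxDecomposition

variable {ι : Type*} [Fintype ι] [DecidableEq ι] {E : Type*} [NormedAddCommGroup E] [NormedSpace ℂ E]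
  {ρ : Type*} [Fintype ρ] [DecidableEq ρ] {τ : ρ → Type*} [∀ ν, Fintype (τ ν)] [∀ ν, DecidableEq (τ ν)]
  [∀ ν, Nonempty (τ ν)]
  {G : ρ → Type*} [∀ ν, NormedAddCommGroup (G ν)] [∀ ν, NormedSpace ℂ (G ν)]
  (X : ∀ ν, (τ ν → ℝ) ≃L[ℝ] G ν) (n : ρ → ℕ)

/-- **Cor. 7.6 for `n = 2` along a Poincaré decomposition, explicit: for `g ≥ 8` and
`(g−2)² < ρ(A) ≤ (g−2)² + 4` the decomposition `A ∼ ∏_ν X_ν^{n_ν}` contains the isotypic factor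
`E^{g−2}` with `E` an elliptic curve with complex multiplication** (some `X_{ν₀}` has dimension `1`,
`dim_ℚ End_ℚ = 2` and exponent `n_{ν₀} = g − 2`; the remaining factors form `A_2` with `Hom(E, A_2) = 0`
by non-isogeny). [cite: HulekLaface2019PicardNumbersAV, §7.2 Cor. 7.6 (`n = 2`) with Thm. 1.1 and Thm. 4.2 (1)] -/
theorem IsIsogenous.exists_cm_factor_of_secondBox_of_powers {A : (ι → ℝ) ≃L[ℝ] E}
    (hiso : IsIsogenous A (sigmaPiPeriod fun ν ↦ powPeriod (X ν) (n ν))) (hX : ∀ ν, IsSimple (X ν))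
    (hA : ∀ ν, IsAbelianVariety (X ν)) (hXX : ∀ ν ν', ν ≠ ν' → ¬ IsIsogenous (X ν) (X ν'))
    (hn : ∀ ν, 0 < n ν) (hg : 8 ≤ finrank ℂ E)
    (h₁ : (finrank ℂ E - 2) ^ 2 < finrank ℤ (neronSeveriGroup A))
    (h₂ : finrank ℤ (neronSeveriGroup A) ≤ (finrank ℂ E - 2) ^ 2 + 4) :
    ∃ ν₀, finrank ℂ (G ν₀) = 1 ∧ finrank ℚ (endAlgRat (X ν₀)) = 2 ∧ n ν₀ = finrank ℂ E - 2 := by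
  haveI : ∀ ν, FiniteDimensional ℂ (G ν) := fun ν ↦ finiteDimensional_complex_of_period (X ν)
  have hgsum : finrank ℂ E = ∑ ν, n ν * finrank ℂ (G ν) := by
    rw [hiso.finrank_eq _ _, finrank_powers_eq X n]
  have hρsum : finrank ℤ (neronSeveriGroup A) = ∑ ν, finrank ℤ (neronSeveriGroup (powPeriod (X ν) (n ν))) := by
    rw [hiso.finrank_neronSeveriGroup_eq _ _, finrank_neronSeveriGroup_powers X n hX hA hXX]
  have hk1 : ∀ ν, 1 ≤ n ν * finrank ℂ (G ν) := one_le_mul_finrank X n hn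
  have hkd : ∀ ν, finrank ℂ (Fin (n ν) → G ν) = n ν * finrank ℂ (G ν) := fun ν ↦ finrank_fin_fun (n ν) (G ν)
  have hcmof : ∀ ν, 2 ≤ n ν * finrank ℂ (G ν) →
      finrank ℤ (neronSeveriGroup (powPeriod (X ν) (n ν))) = (n ν * finrank ℂ (G ν)) ^ 2 →
      finrank ℂ (G ν) = 1 ∧ finrank ℚ (endAlgRat (X ν)) = 2 := fun ν hk2 heq ↦ by
    have hmax : finrank ℤ (neronSeveriGroup (powPeriod (X ν) (n ν))) = (finrank ℂ (Fin (n ν) → G ν)) ^ 2 := by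
      rw [hkd, heq]
    obtain ⟨θ, hθ, hcm, hiso'⟩ :=
      (finrank_neronSeveriGroup_eq_sq_iff_exists_isIsogenous_ellipticPow_cm (powPeriod (X ν) (n ν))
        (by rw [hkd]; exact hk2)).1 hmax
    rw [hkd] at hiso'
    obtain ⟨hXE, -⟩ := (hX ν).isIsogenous_ellipticPeriod_of_pow (hn ν) (lt_of_lt_of_le two_pos hk2) hθ hiso'
    exact ⟨by rw [hXE.finrank_eq _ _]; exact Module.finrank_self ℂ,
      by rw [hXE.finrank_endAlgRat_eq, finrank_endAlgRat_ellipticPeriod_eq_two_iff]; exact hcm⟩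
  -- the largest isotypic factor `ν₀`, `K = k_{ν₀}`
  haveI : Nonempty ρ := by
    by_contra hne
    rw [not_nonempty_iff] at hne
    rw [Finset.univ_eq_empty, Finset.sum_empty] at hgsum
    omega
  obtain ⟨ν₀, -, hmax⟩ :=
    Finset.exists_max_image (Finset.univ : Finset ρ) (fun ν ↦ n ν * finrank ℂ (G ν)) Finset.univ_nonempty
  have hgsplit : finrank ℂ E = n ν₀ * finrank ℂ (G ν₀) +
      ∑ ν ∈ Finset.univ.erase ν₀, n ν * finrank ℂ (G ν) := by
    rw [hgsum, ← Finset.add_sum_erase _ _ (Finset.mem_univ ν₀)]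
  have hρsplit : finrank ℤ (neronSeveriGroup A) = finrank ℤ (neronSeveriGroup (powPeriod (X ν₀) (n ν₀))) +
      ∑ ν ∈ Finset.univ.erase ν₀, finrank ℤ (neronSeveriGroup (powPeriod (X ν) (n ν))) := by
    rw [hρsum, ← Finset.add_sum_erase _ _ (Finset.mem_univ ν₀)]
  -- `Σ_{ν ≠ ν₀} ρ_ν ≤ (Σ_{ν ≠ ν₀} k_ν)²` and `ρ ≤ Σ k_ν² ≤ K g`
  have hrest : ∑ ν ∈ Finset.univ.erase ν₀, finrank ℤ (neronSeveriGroup (powPeriod (X ν) (n ν))) ≤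
      (∑ ν ∈ Finset.univ.erase ν₀, n ν * finrank ℂ (G ν)) ^ 2 :=
    (Finset.sum_le_sum fun ν _ ↦ finrank_neronSeveriGroup_powPeriod_le_sq (X ν) (n ν)).trans
      (sum_sq_le_sq_sum _ _)
  have hall : finrank ℤ (neronSeveriGroup A) ≤ n ν₀ * finrank ℂ (G ν₀) * finrank ℂ E := by
    rw [hρsum, hgsum, Finset.mul_sum]
    exact Finset.sum_le_sum fun ν _ ↦ (finrank_neronSeveriGroup_powPeriod_le_sq (X ν) (n ν)).trans
      (by rw [sq]; exact Nat.mul_le_mul_right _ (hmax ν (Finset.mem_univ ν)))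
  have hρ₀le : finrank ℤ (neronSeveriGroup (powPeriod (X ν₀) (n ν₀))) ≤ (n ν₀ * finrank ℂ (G ν₀)) ^ 2 :=
    finrank_neronSeveriGroup_powPeriod_le_sq (X ν₀) (n ν₀)
  have facts₀ := ((hA ν₀).pow (n ν₀)).finrank_neronSeveriGroup_facts (by rw [hkd]; exact hk1 ν₀)
  rw [hkd ν₀] at facts₀
  obtain ⟨-, -, f4, f7, -⟩ := facts₀
  rcases (show n ν₀ * finrank ℂ (G ν₀) + 4 ≤ finrank ℂ E ∨ n ν₀ * finrank ℂ (G ν₀) + 3 = finrank ℂ E ∨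
      n ν₀ * finrank ℂ (G ν₀) + 2 = finrank ℂ E ∨ n ν₀ * finrank ℂ (G ν₀) + 1 = finrank ℂ E ∨
      n ν₀ * finrank ℂ (G ν₀) = finrank ℂ E by omega) with hK | hK | hK | hK | hK
  · -- `K ≤ g − 4`: `ρ ≤ K g ≤ (g−4) g = (g−2)² − 4`
    exfalso
    have hKg : n ν₀ * finrank ℂ (G ν₀) * finrank ℂ E ≤ (finrank ℂ E - 4) * finrank ℂ E :=
      Nat.mul_le_mul_right _ (by omega)
    have e : (finrank ℂ E - 4) * finrank ℂ E + 4 = (finrank ℂ E - 2) ^ 2 := by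
      obtain ⟨t, ht⟩ : ∃ t, finrank ℂ E = t + 4 := ⟨finrank ℂ E - 4, by omega⟩
      rw [ht, show t + 4 - 4 = t from by omega, show t + 4 - 2 = t + 2 from by omega]
      ring
    omega
  · -- `K = g − 3`: `ρ ≤ (g−3)² + 9 ≤ (g−2)²`
    exfalso
    have hS : ∑ ν ∈ Finset.univ.erase ν₀, n ν * finrank ℂ (G ν) = 3 := by omega
    rw [hS] at hrest
    have e : (finrank ℂ E - 2) ^ 2 = (n ν₀ * finrank ℂ (G ν₀)) ^ 2 + 2 * (n ν₀ * finrank ℂ (G ν₀)) + 1 := by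
      rw [show finrank ℂ E - 2 = n ν₀ * finrank ℂ (G ν₀) + 1 from by omega]
      ring
    omega
  · -- `K = g − 2`: the CM factor
    have hS : ∑ ν ∈ Finset.univ.erase ν₀, n ν * finrank ℂ (G ν) = 2 := by omega
    rw [hS] at hrest
    rw [show finrank ℂ E - 2 = n ν₀ * finrank ℂ (G ν₀) from by omega] at h₁ h₂
    have e : (n ν₀ * finrank ℂ (G ν₀) - 1) ^ 2 + 2 * (n ν₀ * finrank ℂ (G ν₀)) =
        (n ν₀ * finrank ℂ (G ν₀)) ^ 2 + 1 := by
      obtain ⟨t, ht⟩ : ∃ t, n ν₀ * finrank ℂ (G ν₀) = t + 1 := ⟨n ν₀ * finrank ℂ (G ν₀) - 1, by omega⟩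
      rw [ht, show t + 1 - 1 = t from by omega]
      ring
    rcases f4 (by omega) with hρ₀ | hρ₀
    · obtain ⟨hd, hcm⟩ := hcmof ν₀ (by omega) hρ₀
      refine ⟨ν₀, hd, hcm, ?_⟩
      have : n ν₀ * finrank ℂ (G ν₀) = n ν₀ := by rw [hd, mul_one]
      omega
    · exfalso
      omega
  · -- `K = g − 1`: `A ∼ X_{ν₀}^{n_{ν₀}} × E'`
    exfalso
    have hS : ∑ ν ∈ Finset.univ.erase ν₀, n ν * finrank ℂ (G ν) = 1 := by omega
    rw [hS] at hrest
    rw [show finrank ℂ E - 2 = n ν₀ * finrank ℂ (G ν₀) - 1 from by omega] at h₁ h₂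
    have e₁ : (n ν₀ * finrank ℂ (G ν₀) - 2) ^ 2 + 2 * (n ν₀ * finrank ℂ (G ν₀)) =
        (n ν₀ * finrank ℂ (G ν₀) - 1) ^ 2 + 3 := by
      obtain ⟨t, ht⟩ : ∃ t, n ν₀ * finrank ℂ (G ν₀) = t + 2 := ⟨n ν₀ * finrank ℂ (G ν₀) - 2, by omega⟩
      rw [ht, show t + 2 - 2 = t from by omega, show t + 2 - 1 = t + 1 from by omega]
      ring
    have e₂ : (n ν₀ * finrank ℂ (G ν₀) - 1) ^ 2 + 2 * (n ν₀ * finrank ℂ (G ν₀)) =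
        (n ν₀ * finrank ℂ (G ν₀)) ^ 2 + 1 := by
      obtain ⟨t, ht⟩ : ∃ t, n ν₀ * finrank ℂ (G ν₀) = t + 1 := ⟨n ν₀ * finrank ℂ (G ν₀) - 1, by omega⟩
      rw [ht, show t + 1 - 1 = t from by omega]
      ring
    rcases f7 (by omega) with hρ₀ | hρ₀ | hρ₀
    · omega
    · -- `ρ(X_{ν₀}^{n_{ν₀}}) = (K−1)² + 1` is impossible for an isotypic factor (Thm. 4.2 (1): length `2`)
      have hY : IsIsogenous (powPeriod (X ν₀) (n ν₀)) (sigmaPiPeriod fun _ : Fin 1 ↦ powPeriod (X ν₀) (n ν₀)) :=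
        (isIsomorphic_sigmaPiPeriod_unique fun _ : Fin 1 ↦ powPeriod (X ν₀) (n ν₀)).symm.isIsogenous
      have h2 := ((hY.finrank_neronSeveriGroup_eq_sq_pred_add_one_iff_of_powers' (fun _ : Fin 1 ↦ X ν₀)
        (fun _ ↦ n ν₀) (fun _ ↦ hX ν₀) (fun _ ↦ hA ν₀) (fun i j hij ↦ absurd (Subsingleton.elim i j) hij)
        (fun _ ↦ hn ν₀) (by rw [hkd]; omega)).1 (by rw [hkd]; exact hρ₀)).1
      simp at h2
    · omega
  · -- `K = g`: `r = 1`, `ρ = g²` or `ρ ≤ C(g+1, 2) ≤ (g−2)²`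
    exfalso
    have hS : ∑ ν ∈ Finset.univ.erase ν₀, n ν * finrank ℂ (G ν) = 0 := by omega
    have hempty : Finset.univ.erase ν₀ = (∅ : Finset ρ) :=
      Finset.eq_empty_iff_forall_notMem.2 fun ν hν ↦ by
        have h0 := Finset.sum_eq_zero_iff.1 hS ν hν
        have h1 := hk1 ν
        omega
    have h1 : Fintype.card ρ = 1 := by
      rw [← Finset.card_univ, ← Finset.insert_erase (Finset.mem_univ ν₀), hempty, Finset.insert_empty,
        Finset.card_singleton]
    rcases hiso.finrank_neronSeveriGroup_eq_sq_or_le_choose_of_card_eq_one X n hX hA hn h1 with h | h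
    · have hsq : (finrank ℂ E - 2) ^ 2 + 4 < finrank ℂ E ^ 2 := by
        obtain ⟨t, ht⟩ : ∃ t, finrank ℂ E = t + 3 := ⟨finrank ℂ E - 3, by omega⟩
        rw [ht, show t + 3 - 2 = t + 1 from by omega]
        nlinarith
      omega
    · exact absurd (h.trans (choose_succ_le_sq_sub_two hg)) (not_le.2 h₁)

end SecondBoxDecomposition

section SecondBoxUnconditional

variable {ι : Type*} [Fintype ι] [DecidableEq ι] {E : Type*} [NormedAddCommGroup E] [NormedSpace ℂ E]
  {A : (ι → ℝ) ≃L[ℝ] E}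

/-- **Hulek–Laface 2019, Cor. 7.6 for `n = 2`, explicit: every abelian variety `A` of dimension `g ≥ 8`
with `(g−2)² < ρ(A) ≤ (g−2)² + 4` is isogenous to `E^{g−2} × A_2` with `E = E_θ` an elliptic curve with
complex multiplication (`θ` in the upper half plane, imaginary quadratic), `A_2` an abelian surface (in its
standard model `ℂ²/B(ℤ⁴)`, `m = 2`) and `Hom(E, A_2) = 0`.**  (`A_2` is the product of the remaining
isotypic factors of the Poincaré decomposition; `Hom_ℚ(E, ∏ X_ν^{n_ν}) = ⊕ n_ν Hom_ℚ(E, X_ν) = 0` by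
Schur.)  In dimension `7` the conclusion fails for `E⁷` without complex multiplication
(`secondBox_sharp_seven`). [cite: HulekLaface2019PicardNumbersAV, §7.2 Cor. 7.6 (`n = 2`)] [cite: Lange2023AbelianVarietiesComplex, §2.4.4 Thm. 2.4.25 and Cor. 2.4.26] -/
theorem IsAbelianVariety.exists_isIsogenous_ellipticPow_prod_of_secondBox (hAV : IsAbelianVariety A)
    (hg : 8 ≤ finrank ℂ E) (h₁ : (finrank ℂ E - 2) ^ 2 < finrank ℤ (neronSeveriGroup A))
    (h₂ : finrank ℤ (neronSeveriGroup A) ≤ (finrank ℂ E - 2) ^ 2 + 4) :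
    ∃ (θ : ℂ) (hθ : 0 < θ.im) (m : ℕ) (B : (Fin (2 * m) → ℝ) ≃L[ℝ] (Fin m → ℂ)),
      (∃ a b : ℚ, θ ^ 2 + a * θ + b = 0) ∧ m = 2 ∧ IsAbelianVariety B ∧
        homRat (ellipticPeriod hθ.ne') B = ⊥ ∧
        IsIsogenous A (prodPeriod (powPeriod (ellipticPeriod hθ.ne') (finrank ℂ E - 2)) B) := by
  obtain ⟨ω, hω⟩ := hAV
  obtain ⟨r, V, hV, hVc, n, hVpos, hVs, hVab, hVV, hn, hiso⟩ := IsRiemannForm.exists_isIsogenous_powers_pos A hω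
  haveI : ∀ ν, Nonempty (Fin (subRank (V ν))) := fun ν ↦ ⟨⟨0, hVpos ν⟩⟩
  set X : ∀ ν : Fin r, (Fin (subRank (V ν)) → ℝ) ≃L[ℝ] cxSpan A (V ν) :=
    fun ν ↦ subtorusPeriod A (V ν) (hV ν) (hVc ν) with hXdef
  haveI : ∀ ν, FiniteDimensional ℂ (cxSpan A (V ν)) := fun ν ↦ finiteDimensional_complex_of_period (X ν)
  obtain ⟨y, hd, hcm, hny⟩ := hiso.exists_cm_factor_of_secondBox_of_powers X n hVs hVab hVV hn hg h₁ h₂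
  have hsum : ∑ ν, n ν * finrank ℂ (cxSpan A (V ν)) = finrank ℂ E := by
    rw [hiso.finrank_eq _ _, finrank_powers_eq X n]
  -- split `∏_ν X_ν^{n_ν} ≅ X_y^{n_y} × ∏_{ν ≠ y} X_ν^{n_ν}`
  let e : Fin r ≃ {ν // ν = y} ⊕ {ν // ν ≠ y} := (Equiv.sumCompl fun ν ↦ ν = y).symm
  have hsplit := isIsomorphic_sigmaPiPeriod_sumEquiv (fun ν ↦ powPeriod (X ν) (n ν)) e
  letI : Unique {ν // ν = y} := ⟨⟨⟨y, rfl⟩⟩, fun ν ↦ Subtype.ext ν.2⟩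
  -- the complementary factor `A_2` and its standard model
  obtain ⟨B, hB⟩ := exists_isIsomorphic_standardModel
    (sigmaPiPeriod fun j : {ν // ν ≠ y} ↦ powPeriod (X (e.symm (Sum.inr j))) (n (e.symm (Sum.inr j))))
  have hm : finrank ℂ (∀ j : {ν // ν ≠ y}, Fin (n (e.symm (Sum.inr j))) → cxSpan A (V (e.symm (Sum.inr j)))) = 2 := by
    rw [finrank_powers_eq (fun j : {ν // ν ≠ y} ↦ X (e.symm (Sum.inr j))) (fun j ↦ n (e.symm (Sum.inr j)))]
    have hsplit_sum := hsum
    rw [← e.symm.sum_comp (fun ν ↦ n ν * finrank ℂ (cxSpan A (V ν))), Fintype.sum_sum_type,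
      Fintype.sum_unique] at hsplit_sum
    change n y * finrank ℂ (cxSpan A (V y)) +
        ∑ j : {ν // ν ≠ y}, n (e.symm (Sum.inr j)) * finrank ℂ (cxSpan A (V (e.symm (Sum.inr j)))) =
      finrank ℂ E at hsplit_sum
    rw [hd, hny, mul_one] at hsplit_sum
    omega
  -- an upper half-plane CM representative of `X_y`
  obtain ⟨θ, hθ, hE, hcmθ⟩ := exists_isIsomorphic_ellipticPeriod_of_im_pos_of_cm (X y) hd hcm
  refine ⟨θ, hθ, _, B, hcmθ, hm, ?_, ?_, ?_⟩
  · -- `A_2` is an abelian variety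
    exact (hB.isIsogenous.isAbelianVariety_iff).1 (IsAbelianVariety.sigmaPi fun j ↦ (hVab _).pow _)
  · -- `Hom(E, A_2) = 0`
    rw [← Submodule.finrank_eq_zero,
      IsIsogenous.finrank_homRat_congr (IsIsogenous.symm _ _ hE.isIsogenous) (IsIsogenous.symm _ _ hB.isIsogenous),
      finrank_homRat_sigmaPiPeriod_right]
    refine Finset.sum_eq_zero fun j _ ↦ ?_
    rw [finrank_homRat_powPeriod_right,
      (hVs y).homRat_eq_bot (hVs (e.symm (Sum.inr j))) (hVV y (e.symm (Sum.inr j)) (Ne.symm j.2)),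
      finrank_bot, mul_zero]
  · -- `A ∼ E_θ^{g−2} × A_2`
    have b1 : IsIsogenous (sigmaPiPeriod fun i : {ν // ν = y} ↦ powPeriod (X (e.symm (Sum.inl i))) (n (e.symm (Sum.inl i))))
        (powPeriod (ellipticPeriod hθ.ne') (finrank ℂ E - 2)) := by
      refine IsIsogenous.trans _ _ _
        (isIsomorphic_sigmaPiPeriod_unique fun i : {ν // ν = y} ↦
          powPeriod (X (e.symm (Sum.inl i))) (n (e.symm (Sum.inl i)))).isIsogenous ?_
      change IsIsogenous (powPeriod (X y) (n y)) _
      rw [hny]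
      exact hE.isIsogenous.pow _ _ _
    exact IsIsogenous.trans _ _ _ hiso (IsIsogenous.trans _ _ _ hsplit.isIsogenous (b1.prod hB.isIsogenous))

/-- **Sharpness of `g ≥ 8`: `28 ∈ R_7` lies in the box `R_{7,2} = 25 + {1,2,3,4}`** — it is
`ρ(E⁷) = C(8, 2)` for a curve `E` without complex multiplication (Cor. 2.6), whose Poincaré decomposition
`E⁷` has length `1` and no factor `E_{CM}^{5}` (Lange Thm. 2.4.25, uniqueness). [cite: HulekLaface2019PicardNumbersAV, §2.2 Cor. 2.6 and §7.2 Cor. 7.6] [cite: Lange2023AbelianVarietiesComplex, §2.4.4 Thm. 2.4.25] -/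
theorem secondBox_sharp_seven :
    28 ∈ picardNumbers 7 ∧ (7 - 2) ^ 2 < 28 ∧ 28 ≤ (7 - 2) ^ 2 + 4 ∧ 28 = (7 + 1).choose 2 := by
  have h28 : Nat.choose 8 2 = 28 := by decide
  refine ⟨?_, by norm_num, by norm_num, by rw [h28]⟩
  simpa [h28] using choose_add_sum_sq_mem_picardNumbers (S := Fin 0) (fun i ↦ i.elim0) 7

end SecondBoxUnconditional

/-! ## §7 Cor. 7.6 for the box `R_{g,3}`, explicit: `(g−3)² < ρ(A) ≤ (g−3)² + 9 ⟹ A ∼ E^{g−3} × A_3` (`g ≥ 12`)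

The case `n = 3` of [cite: HulekLaface2019PicardNumbersAV, §7.2 Cor. 7.6], forward implication, for
every `g ≥ 12` (optimal: `ρ(E¹¹) = C(12, 2) = 66 ∈ ((11−3)², (11−3)² + 9]` for `E` without complex
multiplication, `thirdBoxStructure_sharp_eleven`).  Along `A ∼ ∏_ν X_ν^{n_ν}` with `K = max_ν k_ν`:
`K ≤ g − 6` gives `ρ ≤ K g ≤ (g−3)² − 9`; `K ∈ {g−5, g−4}` gives `ρ ≤ K² + (g−K)² ≤ (g−3)²`;
`K = g − 2` is excluded by the three largest Picard numbers of the isotypic factor and Thm. 4.2 (1);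
`K = g − 1` by the third gap (§3) and by §6 (Cor. 7.6 for `n = 2`) applied to the `(g−1)`-dimensional
isotypic factor; `K = g` by §7.2 (`C(g+1, 2) ≤ (g−3)²` for `g ≥ 12`); so `K = g − 3` with
`ρ(X_{ν₀}^{n_{ν₀}}) = (g−3)²`. -/

section ThirdBoxArithmetic

/-- **`C(g+1, 2) ≤ (g−3)²` for `g ≥ 12`**: self-products of simple abelian varieties have Picard number
below the box `R_{g,3}` from dimension `12` on (Prop. 7.3: `s = 3` is "large" iff `g ≥ 12`).
[cite: HulekLaface2019PicardNumbersAV, §7.2 Prop. 7.3 and condition (1)] -/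
theorem choose_succ_le_sq_sub_three {g : ℕ} (hg : 12 ≤ g) : (g + 1).choose 2 ≤ (g - 3) ^ 2 := by
  obtain ⟨t, rfl⟩ : ∃ t, g = t + 12 := ⟨g - 12, by omega⟩
  rw [show t + 12 - 3 = t + 9 from by omega, Nat.choose_two_right,
    show t + 12 + 1 - 1 = t + 12 from by omega,
    show (t + 12 + 1) * (t + 12) = t ^ 2 + 25 * t + 156 from by ring,
    show (t + 9) ^ 2 = t ^ 2 + 18 * t + 81 from by ring]
  omega

end ThirdBoxArithmetic

section CMFactorModel

variable {ι : Type*} [Fintype ι] [DecidableEq ι] {E : Type*} [NormedAddCommGroup E] [NormedSpace ℂ E]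
  {ρ : Type*} [Fintype ρ] [DecidableEq ρ] {τ : ρ → Type*} [∀ ν, Fintype (τ ν)] [∀ ν, DecidableEq (τ ν)]
  {G : ρ → Type*} [∀ ν, NormedAddCommGroup (G ν)] [∀ ν, NormedSpace ℂ (G ν)]
  (X : ∀ ν, (τ ν → ℝ) ≃L[ℝ] G ν) (n : ρ → ℕ)

/-- **From a CM elliptic isotypic factor to the shape `A ∼ E^{t} × A_m`, `Hom(E, A_m) = 0`.**  If along
`A ∼ ∏_ν X_ν^{n_ν}` (simple, nonzero, pairwise non-isogenous abelian factors, `n_ν ≥ 1`) the factor `X_y` is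
an elliptic curve with complex multiplication, then `A ∼ E_θ^{n_y} × B` with `θ` in the upper half plane
imaginary quadratic (`X_y ≅ E_θ`), `B = ∏_{ν ≠ y} X_ν^{n_ν}` an abelian variety of dimension `m`,
`n_y + m = g`, in its standard model, and `Hom_ℚ(E_θ, B) = ⊕_{ν ≠ y} n_ν Hom_ℚ(E_θ, X_ν) = 0` (Schur).
[cite: HulekLaface2019PicardNumbersAV, §7.2 Cor. 7.6 (proof: "we can write `X ∼ E^t × A_{g−t}` … `Hom(E, A_{g−t}) = 0`")] [cite: Lange2023AbelianVarietiesComplex, §2.4.4 Cor. 2.4.26] -/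
theorem IsIsogenous.exists_isIsogenous_ellipticPow_prod_of_cm_factor {A : (ι → ℝ) ≃L[ℝ] E}
    (hiso : IsIsogenous A (sigmaPiPeriod fun ν ↦ powPeriod (X ν) (n ν))) (hX : ∀ ν, IsSimple (X ν))
    (hA : ∀ ν, IsAbelianVariety (X ν)) (hXX : ∀ ν ν', ν ≠ ν' → ¬ IsIsogenous (X ν) (X ν'))
    (y : ρ) (hd : finrank ℂ (G y) = 1) (hcm : finrank ℚ (endAlgRat (X y)) = 2) :
    ∃ (θ : ℂ) (hθ : 0 < θ.im) (m : ℕ) (B : (Fin (2 * m) → ℝ) ≃L[ℝ] (Fin m → ℂ)),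
      (∃ a b : ℚ, θ ^ 2 + a * θ + b = 0) ∧ n y + m = finrank ℂ E ∧ IsAbelianVariety B ∧
        homRat (ellipticPeriod hθ.ne') B = ⊥ ∧
        IsIsogenous A (prodPeriod (powPeriod (ellipticPeriod hθ.ne') (n y)) B) := by
  haveI : ∀ ν, FiniteDimensional ℂ (G ν) := fun ν ↦ finiteDimensional_complex_of_period (X ν)
  have hsum : ∑ ν, n ν * finrank ℂ (G ν) = finrank ℂ E := by
    rw [hiso.finrank_eq _ _, finrank_powers_eq X n]
  -- split `∏_ν X_ν^{n_ν} ≅ X_y^{n_y} × ∏_{ν ≠ y} X_ν^{n_ν}`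
  let e : ρ ≃ {ν // ν = y} ⊕ {ν // ν ≠ y} := (Equiv.sumCompl fun ν ↦ ν = y).symm
  have hsplit := isIsomorphic_sigmaPiPeriod_sumEquiv (fun ν ↦ powPeriod (X ν) (n ν)) e
  letI : Unique {ν // ν = y} := ⟨⟨⟨y, rfl⟩⟩, fun ν ↦ Subtype.ext ν.2⟩
  -- the complementary factor and its standard model
  obtain ⟨B, hB⟩ := exists_isIsomorphic_standardModel
    (sigmaPiPeriod fun j : {ν // ν ≠ y} ↦ powPeriod (X (e.symm (Sum.inr j))) (n (e.symm (Sum.inr j))))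
  have hm : n y + finrank ℂ (∀ j : {ν // ν ≠ y}, Fin (n (e.symm (Sum.inr j))) → G (e.symm (Sum.inr j))) =
      finrank ℂ E := by
    rw [finrank_powers_eq (fun j : {ν // ν ≠ y} ↦ X (e.symm (Sum.inr j))) (fun j ↦ n (e.symm (Sum.inr j)))]
    have hsplit_sum := hsum
    rw [← e.symm.sum_comp (fun ν ↦ n ν * finrank ℂ (G ν)), Fintype.sum_sum_type,
      Fintype.sum_unique] at hsplit_sum
    change n y * finrank ℂ (G y) +
        ∑ j : {ν // ν ≠ y}, n (e.symm (Sum.inr j)) * finrank ℂ (G (e.symm (Sum.inr j))) =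
      finrank ℂ E at hsplit_sum
    rwa [hd, mul_one] at hsplit_sum
  obtain ⟨θ, hθ, hE, hcmθ⟩ := exists_isIsomorphic_ellipticPeriod_of_im_pos_of_cm (X y) hd hcm
  refine ⟨θ, hθ, _, B, hcmθ, hm, ?_, ?_, ?_⟩
  · exact (hB.isIsogenous.isAbelianVariety_iff).1 (IsAbelianVariety.sigmaPi fun j ↦ (hA _).pow _)
  · rw [← Submodule.finrank_eq_zero,
      IsIsogenous.finrank_homRat_congr (IsIsogenous.symm _ _ hE.isIsogenous) (IsIsogenous.symm _ _ hB.isIsogenous),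
      finrank_homRat_sigmaPiPeriod_right]
    refine Finset.sum_eq_zero fun j _ ↦ ?_
    rw [finrank_homRat_powPeriod_right,
      (hX y).homRat_eq_bot (hX (e.symm (Sum.inr j))) (hXX y (e.symm (Sum.inr j)) (Ne.symm j.2)),
      finrank_bot, mul_zero]
  · have b1 : IsIsogenous (sigmaPiPeriod fun i : {ν // ν = y} ↦ powPeriod (X (e.symm (Sum.inl i))) (n (e.symm (Sum.inl i))))
        (powPeriod (ellipticPeriod hθ.ne') (n y)) :=
      IsIsogenous.trans _ _ _
        (isIsomorphic_sigmaPiPeriod_unique fun i : {ν // ν = y} ↦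
          powPeriod (X (e.symm (Sum.inl i))) (n (e.symm (Sum.inl i)))).isIsogenous (hE.isIsogenous.pow _ _ _)
    exact IsIsogenous.trans _ _ _ hiso (IsIsogenous.trans _ _ _ hsplit.isIsogenous (b1.prod hB.isIsogenous))

end CMFactorModel

section ThirdBoxDecomposition

variable {ι : Type*} [Fintype ι] [DecidableEq ι] {E : Type*} [NormedAddCommGroup E] [NormedSpace ℂ E]
  {ρ : Type*} [Fintype ρ] [DecidableEq ρ] {τ : ρ → Type*} [∀ ν, Fintype (τ ν)] [∀ ν, DecidableEq (τ ν)]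
  [∀ ν, Nonempty (τ ν)]
  {G : ρ → Type*} [∀ ν, NormedAddCommGroup (G ν)] [∀ ν, NormedSpace ℂ (G ν)]
  (X : ∀ ν, (τ ν → ℝ) ≃L[ℝ] G ν) (n : ρ → ℕ)

/-- **Cor. 7.6 for `n = 3` along a Poincaré decomposition, explicit: for `g ≥ 12` and
`(g−3)² < ρ(A) ≤ (g−3)² + 9` the decomposition `A ∼ ∏_ν X_ν^{n_ν}` contains the isotypic factor
`E^{g−3}` with `E` an elliptic curve with complex multiplication** (the remaining factors form `A_3`,
`Hom(E, A_3) = 0`). [cite: HulekLaface2019PicardNumbersAV, §7.2 Cor. 7.6 (`n = 3`) with Thm. 7.4, Thm. 1.1 and Thm. 4.2 (1)] -/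
theorem IsIsogenous.exists_cm_factor_of_thirdBox_of_powers {A : (ι → ℝ) ≃L[ℝ] E}
    (hiso : IsIsogenous A (sigmaPiPeriod fun ν ↦ powPeriod (X ν) (n ν))) (hX : ∀ ν, IsSimple (X ν))
    (hA : ∀ ν, IsAbelianVariety (X ν)) (hXX : ∀ ν ν', ν ≠ ν' → ¬ IsIsogenous (X ν) (X ν'))
    (hn : ∀ ν, 0 < n ν) (hg : 12 ≤ finrank ℂ E)
    (h₁ : (finrank ℂ E - 3) ^ 2 < finrank ℤ (neronSeveriGroup A))
    (h₂ : finrank ℤ (neronSeveriGroup A) ≤ (finrank ℂ E - 3) ^ 2 + 9) :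
    ∃ ν₀, finrank ℂ (G ν₀) = 1 ∧ finrank ℚ (endAlgRat (X ν₀)) = 2 ∧ n ν₀ = finrank ℂ E - 3 := by
  haveI : ∀ ν, FiniteDimensional ℂ (G ν) := fun ν ↦ finiteDimensional_complex_of_period (X ν)
  have hgsum : finrank ℂ E = ∑ ν, n ν * finrank ℂ (G ν) := by
    rw [hiso.finrank_eq _ _, finrank_powers_eq X n]
  have hρsum : finrank ℤ (neronSeveriGroup A) = ∑ ν, finrank ℤ (neronSeveriGroup (powPeriod (X ν) (n ν))) := by
    rw [hiso.finrank_neronSeveriGroup_eq _ _, finrank_neronSeveriGroup_powers X n hX hA hXX]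
  have hk1 : ∀ ν, 1 ≤ n ν * finrank ℂ (G ν) := one_le_mul_finrank X n hn
  have hkd : ∀ ν, finrank ℂ (Fin (n ν) → G ν) = n ν * finrank ℂ (G ν) := fun ν ↦ finrank_fin_fun (n ν) (G ν)
  have hcmof : ∀ ν, 2 ≤ n ν * finrank ℂ (G ν) →
      finrank ℤ (neronSeveriGroup (powPeriod (X ν) (n ν))) = (n ν * finrank ℂ (G ν)) ^ 2 →
      finrank ℂ (G ν) = 1 ∧ finrank ℚ (endAlgRat (X ν)) = 2 := fun ν hk2 heq ↦ by
    have hmax : finrank ℤ (neronSeveriGroup (powPeriod (X ν) (n ν))) = (finrank ℂ (Fin (n ν) → G ν)) ^ 2 := by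
      rw [hkd, heq]
    obtain ⟨θ, hθ, hcm, hiso'⟩ :=
      (finrank_neronSeveriGroup_eq_sq_iff_exists_isIsogenous_ellipticPow_cm (powPeriod (X ν) (n ν))
        (by rw [hkd]; exact hk2)).1 hmax
    rw [hkd] at hiso'
    obtain ⟨hXE, -⟩ := (hX ν).isIsogenous_ellipticPeriod_of_pow (hn ν) (lt_of_lt_of_le two_pos hk2) hθ hiso'
    exact ⟨by rw [hXE.finrank_eq _ _]; exact Module.finrank_self ℂ,
      by rw [hXE.finrank_endAlgRat_eq, finrank_endAlgRat_ellipticPeriod_eq_two_iff]; exact hcm⟩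
  -- the largest isotypic factor `ν₀`, `K = k_{ν₀}`
  haveI : Nonempty ρ := by
    by_contra hne
    rw [not_nonempty_iff] at hne
    rw [Finset.univ_eq_empty, Finset.sum_empty] at hgsum
    omega
  obtain ⟨ν₀, -, hmax⟩ :=
    Finset.exists_max_image (Finset.univ : Finset ρ) (fun ν ↦ n ν * finrank ℂ (G ν)) Finset.univ_nonempty
  have hgsplit : finrank ℂ E = n ν₀ * finrank ℂ (G ν₀) +
      ∑ ν ∈ Finset.univ.erase ν₀, n ν * finrank ℂ (G ν) := by
    rw [hgsum, ← Finset.add_sum_erase _ _ (Finset.mem_univ ν₀)]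
  have hρsplit : finrank ℤ (neronSeveriGroup A) = finrank ℤ (neronSeveriGroup (powPeriod (X ν₀) (n ν₀))) +
      ∑ ν ∈ Finset.univ.erase ν₀, finrank ℤ (neronSeveriGroup (powPeriod (X ν) (n ν))) := by
    rw [hρsum, ← Finset.add_sum_erase _ _ (Finset.mem_univ ν₀)]
  have hrest : ∑ ν ∈ Finset.univ.erase ν₀, finrank ℤ (neronSeveriGroup (powPeriod (X ν) (n ν))) ≤
      (∑ ν ∈ Finset.univ.erase ν₀, n ν * finrank ℂ (G ν)) ^ 2 :=
    (Finset.sum_le_sum fun ν _ ↦ finrank_neronSeveriGroup_powPeriod_le_sq (X ν) (n ν)).trans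
      (sum_sq_le_sq_sum _ _)
  have hall : finrank ℤ (neronSeveriGroup A) ≤ n ν₀ * finrank ℂ (G ν₀) * finrank ℂ E := by
    rw [hρsum, hgsum, Finset.mul_sum]
    exact Finset.sum_le_sum fun ν _ ↦ (finrank_neronSeveriGroup_powPeriod_le_sq (X ν) (n ν)).trans
      (by rw [sq]; exact Nat.mul_le_mul_right _ (hmax ν (Finset.mem_univ ν)))
  have hρ₀le : finrank ℤ (neronSeveriGroup (powPeriod (X ν₀) (n ν₀))) ≤ (n ν₀ * finrank ℂ (G ν₀)) ^ 2 :=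
    finrank_neronSeveriGroup_powPeriod_le_sq (X ν₀) (n ν₀)
  have hAV₀ : IsAbelianVariety (powPeriod (X ν₀) (n ν₀)) := (hA ν₀).pow (n ν₀)
  have facts₀ := hAV₀.finrank_neronSeveriGroup_facts (by rw [hkd]; exact hk1 ν₀)
  rw [hkd ν₀] at facts₀
  obtain ⟨-, -, f4, f7, -⟩ := facts₀
  rcases (show n ν₀ * finrank ℂ (G ν₀) + 6 ≤ finrank ℂ E ∨ n ν₀ * finrank ℂ (G ν₀) + 5 = finrank ℂ E ∨
      n ν₀ * finrank ℂ (G ν₀) + 4 = finrank ℂ E ∨ n ν₀ * finrank ℂ (G ν₀) + 3 = finrank ℂ E ∨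
      n ν₀ * finrank ℂ (G ν₀) + 2 = finrank ℂ E ∨ n ν₀ * finrank ℂ (G ν₀) + 1 = finrank ℂ E ∨
      n ν₀ * finrank ℂ (G ν₀) = finrank ℂ E by omega) with hK | hK | hK | hK | hK | hK | hK
  · -- `K ≤ g − 6`: `ρ ≤ K g ≤ (g−6) g = (g−3)² − 9`
    exfalso
    have hKg : n ν₀ * finrank ℂ (G ν₀) * finrank ℂ E ≤ (finrank ℂ E - 6) * finrank ℂ E :=
      Nat.mul_le_mul_right _ (by omega)
    have e : (finrank ℂ E - 6) * finrank ℂ E + 9 = (finrank ℂ E - 3) ^ 2 := by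
      obtain ⟨t, ht⟩ : ∃ t, finrank ℂ E = t + 6 := ⟨finrank ℂ E - 6, by omega⟩
      rw [ht, show t + 6 - 6 = t from by omega, show t + 6 - 3 = t + 3 from by omega]
      ring
    omega
  · -- `K = g − 5`: `ρ ≤ (g−5)² + 25 ≤ (g−3)²`
    exfalso
    have hS : ∑ ν ∈ Finset.univ.erase ν₀, n ν * finrank ℂ (G ν) = 5 := by omega
    rw [hS] at hrest
    have e : (finrank ℂ E - 3) ^ 2 = (n ν₀ * finrank ℂ (G ν₀)) ^ 2 + 4 * (n ν₀ * finrank ℂ (G ν₀)) + 4 := by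
      rw [show finrank ℂ E - 3 = n ν₀ * finrank ℂ (G ν₀) + 2 from by omega]
      ring
    omega
  · -- `K = g − 4`: `ρ ≤ (g−4)² + 16 ≤ (g−3)²`
    exfalso
    have hS : ∑ ν ∈ Finset.univ.erase ν₀, n ν * finrank ℂ (G ν) = 4 := by omega
    rw [hS] at hrest
    have e : (finrank ℂ E - 3) ^ 2 = (n ν₀ * finrank ℂ (G ν₀)) ^ 2 + 2 * (n ν₀ * finrank ℂ (G ν₀)) + 1 := by
      rw [show finrank ℂ E - 3 = n ν₀ * finrank ℂ (G ν₀) + 1 from by omega]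
      ring
    omega
  · -- `K = g − 3`: the CM factor
    have hS : ∑ ν ∈ Finset.univ.erase ν₀, n ν * finrank ℂ (G ν) = 3 := by omega
    rw [hS] at hrest
    rw [show finrank ℂ E - 3 = n ν₀ * finrank ℂ (G ν₀) from by omega] at h₁ h₂
    have e : (n ν₀ * finrank ℂ (G ν₀) - 1) ^ 2 + 2 * (n ν₀ * finrank ℂ (G ν₀)) =
        (n ν₀ * finrank ℂ (G ν₀)) ^ 2 + 1 := by
      obtain ⟨t, ht⟩ : ∃ t, n ν₀ * finrank ℂ (G ν₀) = t + 1 := ⟨n ν₀ * finrank ℂ (G ν₀) - 1, by omega⟩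
      rw [ht, show t + 1 - 1 = t from by omega]
      ring
    rcases f4 (by omega) with hρ₀ | hρ₀
    · obtain ⟨hd, hcm⟩ := hcmof ν₀ (by omega) hρ₀
      refine ⟨ν₀, hd, hcm, ?_⟩
      have : n ν₀ * finrank ℂ (G ν₀) = n ν₀ := by rw [hd, mul_one]
      omega
    · exfalso
      omega
  · -- `K = g − 2`: excluded by the three largest Picard numbers of `X_{ν₀}^{n_{ν₀}}` and Thm. 4.2 (1)
    exfalso
    have hS : ∑ ν ∈ Finset.univ.erase ν₀, n ν * finrank ℂ (G ν) = 2 := by omega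
    rw [hS] at hrest
    rw [show finrank ℂ E - 3 = n ν₀ * finrank ℂ (G ν₀) - 1 from by omega] at h₁ h₂
    have e₁ : (n ν₀ * finrank ℂ (G ν₀) - 2) ^ 2 + 2 * (n ν₀ * finrank ℂ (G ν₀)) =
        (n ν₀ * finrank ℂ (G ν₀) - 1) ^ 2 + 3 := by
      obtain ⟨t, ht⟩ : ∃ t, n ν₀ * finrank ℂ (G ν₀) = t + 2 := ⟨n ν₀ * finrank ℂ (G ν₀) - 2, by omega⟩
      rw [ht, show t + 2 - 2 = t from by omega, show t + 2 - 1 = t + 1 from by omega]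
      ring
    have e₂ : (n ν₀ * finrank ℂ (G ν₀) - 1) ^ 2 + 2 * (n ν₀ * finrank ℂ (G ν₀)) =
        (n ν₀ * finrank ℂ (G ν₀)) ^ 2 + 1 := by
      obtain ⟨t, ht⟩ : ∃ t, n ν₀ * finrank ℂ (G ν₀) = t + 1 := ⟨n ν₀ * finrank ℂ (G ν₀) - 1, by omega⟩
      rw [ht, show t + 1 - 1 = t from by omega]
      ring
    rcases f7 (by omega) with hρ₀ | hρ₀ | hρ₀
    · omega
    · have hY : IsIsogenous (powPeriod (X ν₀) (n ν₀)) (sigmaPiPeriod fun _ : Fin 1 ↦ powPeriod (X ν₀) (n ν₀)) :=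
        (isIsomorphic_sigmaPiPeriod_unique fun _ : Fin 1 ↦ powPeriod (X ν₀) (n ν₀)).symm.isIsogenous
      have h2 := ((hY.finrank_neronSeveriGroup_eq_sq_pred_add_one_iff_of_powers' (fun _ : Fin 1 ↦ X ν₀)
        (fun _ ↦ n ν₀) (fun _ ↦ hX ν₀) (fun _ ↦ hA ν₀) (fun i j hij ↦ absurd (Subsingleton.elim i j) hij)
        (fun _ ↦ hn ν₀) (by rw [hkd]; omega)).1 (by rw [hkd]; exact hρ₀)).1
      simp at h2
    · omega
  · -- `K = g − 1`: `A ∼ X_{ν₀}^{n_{ν₀}} × E'`; the third gap (§3) and Cor. 7.6 for `n = 2` (§6) for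
    -- the `(g−1)`-dimensional abelian variety `X_{ν₀}^{n_{ν₀}}`
    exfalso
    have hS : ∑ ν ∈ Finset.univ.erase ν₀, n ν * finrank ℂ (G ν) = 1 := by omega
    rw [hS] at hrest
    have e₁ : (n ν₀ * finrank ℂ (G ν₀) - 1) ^ 2 + 2 * (n ν₀ * finrank ℂ (G ν₀)) =
        (n ν₀ * finrank ℂ (G ν₀)) ^ 2 + 1 := by
      obtain ⟨t, ht⟩ : ∃ t, n ν₀ * finrank ℂ (G ν₀) = t + 1 := ⟨n ν₀ * finrank ℂ (G ν₀) - 1, by omega⟩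
      rw [ht, show t + 1 - 1 = t from by omega]
      ring
    have e₂ : (n ν₀ * finrank ℂ (G ν₀) - 2) ^ 2 + 2 * (n ν₀ * finrank ℂ (G ν₀)) =
        (n ν₀ * finrank ℂ (G ν₀) - 1) ^ 2 + 3 := by
      obtain ⟨t, ht⟩ : ∃ t, n ν₀ * finrank ℂ (G ν₀) = t + 2 := ⟨n ν₀ * finrank ℂ (G ν₀) - 2, by omega⟩
      rw [ht, show t + 2 - 2 = t from by omega, show t + 2 - 1 = t + 1 from by omega]
      ring
    have e₃ : (n ν₀ * finrank ℂ (G ν₀) - 3) ^ 2 + 2 * (n ν₀ * finrank ℂ (G ν₀)) =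
        (n ν₀ * finrank ℂ (G ν₀) - 2) ^ 2 + 5 := by
      obtain ⟨t, ht⟩ : ∃ t, n ν₀ * finrank ℂ (G ν₀) = t + 3 := ⟨n ν₀ * finrank ℂ (G ν₀) - 3, by omega⟩
      rw [ht, show t + 3 - 3 = t from by omega, show t + 3 - 2 = t + 1 from by omega]
      ring
    rw [show finrank ℂ E - 3 = n ν₀ * finrank ℂ (G ν₀) - 2 from by omega] at h₁ h₂
    rcases f7 (by omega) with hρ₀ | hρ₀ | hρ₀
    · -- `ρ₀ ≤ (K−2)² + 4`: the third gap / the box `R_{K,2}` of the `K`-dimensional factor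
      rcases Nat.lt_or_ge (finrank ℤ (neronSeveriGroup (powPeriod (X ν₀) (n ν₀))))
          ((n ν₀ * finrank ℂ (G ν₀) - 2) ^ 2 + 1) with hlt | hge
      · -- `ρ₀ ≤ (K−2)²`: then `ρ₀ = (K−2)²` by the window, inside the third gap of dimension `K`
        have hρ₀' : finrank ℤ (neronSeveriGroup (powPeriod (X ν₀) (n ν₀))) = (n ν₀ * finrank ℂ (G ν₀) - 2) ^ 2 := by
          omega
        have h3 := hAV₀.finrank_neronSeveriGroup_eq_of_thirdGap (by rw [hkd]; omega)
          (by rw [hkd, hρ₀']; omega) (by rw [hkd, hρ₀']; omega)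
        rw [hkd, hρ₀'] at h3
        omega
      · -- `(K−2)² + 1 ≤ ρ₀ ≤ (K−2)² + 4`: §6 gives a CM factor with exponent `K − 2` of the length-1
        -- decomposition of `X_{ν₀}^{n_{ν₀}}`, i.e. `K = K − 2`
        have hY : IsIsogenous (powPeriod (X ν₀) (n ν₀)) (sigmaPiPeriod fun _ : Fin 1 ↦ powPeriod (X ν₀) (n ν₀)) :=
          (isIsomorphic_sigmaPiPeriod_unique fun _ : Fin 1 ↦ powPeriod (X ν₀) (n ν₀)).symm.isIsogenous
        obtain ⟨_, hd', -, hn'⟩ := hY.exists_cm_factor_of_secondBox_of_powers (fun _ : Fin 1 ↦ X ν₀)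
          (fun _ ↦ n ν₀) (fun _ ↦ hX ν₀) (fun _ ↦ hA ν₀) (fun i j hij ↦ absurd (Subsingleton.elim i j) hij)
          (fun _ ↦ hn ν₀) (by rw [hkd]; omega) (by rw [hkd]; omega) (by rw [hkd]; exact hρ₀)
        rw [hkd] at hn'
        have : n ν₀ * finrank ℂ (G ν₀) = n ν₀ := by rw [hd', mul_one]
        omega
    · omega
    · omega
  · -- `K = g`: `r = 1`
    exfalso
    have hS : ∑ ν ∈ Finset.univ.erase ν₀, n ν * finrank ℂ (G ν) = 0 := by omega
    have hempty : Finset.univ.erase ν₀ = (∅ : Finset ρ) :=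
      Finset.eq_empty_iff_forall_notMem.2 fun ν hν ↦ by
        have h0 := Finset.sum_eq_zero_iff.1 hS ν hν
        have h1 := hk1 ν
        omega
    have h1 : Fintype.card ρ = 1 := by
      rw [← Finset.card_univ, ← Finset.insert_erase (Finset.mem_univ ν₀), hempty, Finset.insert_empty,
        Finset.card_singleton]
    rcases hiso.finrank_neronSeveriGroup_eq_sq_or_le_choose_of_card_eq_one X n hX hA hn h1 with h | h
    · have hsq : (finrank ℂ E - 3) ^ 2 + 9 < finrank ℂ E ^ 2 := by
        obtain ⟨t, ht⟩ : ∃ t, finrank ℂ E = t + 4 := ⟨finrank ℂ E - 4, by omega⟩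
        rw [ht, show t + 4 - 3 = t + 1 from by omega]
        nlinarith
      omega
    · exact absurd (h.trans (choose_succ_le_sq_sub_three hg)) (not_le.2 h₁)

end ThirdBoxDecomposition

section ThirdBoxUnconditional

variable {ι : Type*} [Fintype ι] [DecidableEq ι] {E : Type*} [NormedAddCommGroup E] [NormedSpace ℂ E]
  {A : (ι → ℝ) ≃L[ℝ] E}

/-- **Hulek–Laface 2019, Cor. 7.6 for `n = 3`, explicit: every abelian variety `A` of dimension `g ≥ 12`
with `(g−3)² < ρ(A) ≤ (g−3)² + 9` is isogenous to `E^{g−3} × A_3` with `E = E_θ` an elliptic curve with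
complex multiplication, `A_3` an abelian threefold (standard model, `m = 3`) and `Hom(E, A_3) = 0`.**
In dimension `11` the conclusion fails for `E¹¹` without complex multiplication
(`thirdBoxStructure_sharp_eleven`). [cite: HulekLaface2019PicardNumbersAV, §7.2 Cor. 7.6 (`n = 3`)] [cite: Lange2023AbelianVarietiesComplex, §2.4.4 Thm. 2.4.25 and Cor. 2.4.26] -/
theorem IsAbelianVariety.exists_isIsogenous_ellipticPow_prod_of_thirdBox (hAV : IsAbelianVariety A)
    (hg : 12 ≤ finrank ℂ E) (h₁ : (finrank ℂ E - 3) ^ 2 < finrank ℤ (neronSeveriGroup A))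
    (h₂ : finrank ℤ (neronSeveriGroup A) ≤ (finrank ℂ E - 3) ^ 2 + 9) :
    ∃ (θ : ℂ) (hθ : 0 < θ.im) (m : ℕ) (B : (Fin (2 * m) → ℝ) ≃L[ℝ] (Fin m → ℂ)),
      (∃ a b : ℚ, θ ^ 2 + a * θ + b = 0) ∧ m = 3 ∧ IsAbelianVariety B ∧
        homRat (ellipticPeriod hθ.ne') B = ⊥ ∧
        IsIsogenous A (prodPeriod (powPeriod (ellipticPeriod hθ.ne') (finrank ℂ E - 3)) B) := by
  obtain ⟨ω, hω⟩ := hAV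
  obtain ⟨r, V, hV, hVc, n, hVpos, hVs, hVab, hVV, hn, hiso⟩ := IsRiemannForm.exists_isIsogenous_powers_pos A hω
  haveI : ∀ ν, Nonempty (Fin (subRank (V ν))) := fun ν ↦ ⟨⟨0, hVpos ν⟩⟩
  obtain ⟨y, hd, hcm, hny⟩ := hiso.exists_cm_factor_of_thirdBox_of_powers _ n hVs hVab hVV hn hg h₁ h₂
  obtain ⟨θ, hθ, m, B, hcmθ, hm, hB, hHom, hAB⟩ :=
    hiso.exists_isIsogenous_ellipticPow_prod_of_cm_factor _ n hVs hVab hVV y hd hcm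
  rw [hny] at hm hAB
  exact ⟨θ, hθ, m, B, hcmθ, by omega, hB, hHom, hAB⟩

/-- **Cor. 7.6 for `n = 2` through the general shape lemma** (the statement of
`IsAbelianVariety.exists_isIsogenous_ellipticPow_prod_of_secondBox`, reproved in two lines from
`IsIsogenous.exists_cm_factor_of_secondBox_of_powers` and
`IsIsogenous.exists_isIsogenous_ellipticPow_prod_of_cm_factor`). [cite: HulekLaface2019PicardNumbersAV, §7.2 Cor. 7.6 (`n = 2`)] -/
theorem IsAbelianVariety.exists_isIsogenous_ellipticPow_prod_of_secondBox' (hAV : IsAbelianVariety A)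
    (hg : 8 ≤ finrank ℂ E) (h₁ : (finrank ℂ E - 2) ^ 2 < finrank ℤ (neronSeveriGroup A))
    (h₂ : finrank ℤ (neronSeveriGroup A) ≤ (finrank ℂ E - 2) ^ 2 + 4) :
    ∃ (θ : ℂ) (hθ : 0 < θ.im) (m : ℕ) (B : (Fin (2 * m) → ℝ) ≃L[ℝ] (Fin m → ℂ)),
      (∃ a b : ℚ, θ ^ 2 + a * θ + b = 0) ∧ m = 2 ∧ IsAbelianVariety B ∧
        homRat (ellipticPeriod hθ.ne') B = ⊥ ∧
        IsIsogenous A (prodPeriod (powPeriod (ellipticPeriod hθ.ne') (finrank ℂ E - 2)) B) := by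
  obtain ⟨ω, hω⟩ := hAV
  obtain ⟨r, V, hV, hVc, n, hVpos, hVs, hVab, hVV, hn, hiso⟩ := IsRiemannForm.exists_isIsogenous_powers_pos A hω
  haveI : ∀ ν, Nonempty (Fin (subRank (V ν))) := fun ν ↦ ⟨⟨0, hVpos ν⟩⟩
  obtain ⟨y, hd, hcm, hny⟩ := hiso.exists_cm_factor_of_secondBox_of_powers _ n hVs hVab hVV hn hg h₁ h₂
  obtain ⟨θ, hθ, m, B, hcmθ, hm, hB, hHom, hAB⟩ :=
    hiso.exists_isIsogenous_ellipticPow_prod_of_cm_factor _ n hVs hVab hVV y hd hcm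
  rw [hny] at hm hAB
  exact ⟨θ, hθ, m, B, hcmθ, by omega, hB, hHom, hAB⟩

/-- **Sharpness of `g ≥ 12`: `66 ∈ R_{11}` lies in `((11−3)², (11−3)² + 9] = (64, 73]`** — it is
`ρ(E¹¹) = C(12, 2)` for a curve without complex multiplication, whose Poincaré decomposition has length
`1` (no factor `E_{CM}^{8}`). [cite: HulekLaface2019PicardNumbersAV, §2.2 Cor. 2.6 and §7.2 Prop. 7.3, Cor. 7.6] [cite: Lange2023AbelianVarietiesComplex, §2.4.4 Thm. 2.4.25] -/
theorem thirdBoxStructure_sharp_eleven :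
    66 ∈ picardNumbers 11 ∧ (11 - 3) ^ 2 < 66 ∧ 66 ≤ (11 - 3) ^ 2 + 9 ∧ 66 = (11 + 1).choose 2 := by
  have h66 : Nat.choose 12 2 = 66 := by decide
  refine ⟨?_, by norm_num, by norm_num, by rw [h66]⟩
  simpa [h66] using choose_add_sum_sq_mem_picardNumbers (S := Fin 0) (fun i ↦ i.elim0) 11

end ThirdBoxUnconditional

/-! ## §8 Cor. 7.6 as an equivalence for `n = 2` (`g ≥ 8`) and `n = 3` (`g ≥ 12`)

The converse implication of Cor. 7.6 ("(2) ⟹ (1)", "`X ∼ E^{g−m} × A_m` … In particular, it follows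
that `ρ(X) ∈ R_{g,m}`") is Cor. 2.3: `ρ(E^{t} × B) = t² + ρ(B)` when `E` has complex multiplication and
`Hom(E, B) = 0`, with `1 ≤ ρ(B) ≤ m²`.  Together with §6–§7: for `g ≥ 8` (resp. `g ≥ 12`),
`ρ(A) ∈ ((g−2)², (g−2)² + 4]` (resp. `((g−3)², (g−3)² + 9]`) **iff** `A ∼ E^{g−2} × A_2` (resp.
`E^{g−3} × A_3`) with `E` CM and `Hom(E, A_m) = 0`. -/

section BoxIff

variable {ι : Type*} [Fintype ι] [DecidableEq ι] {E : Type*} [NormedAddCommGroup E] [NormedSpace ℂ E]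

/-- **`ρ(E_θ^{t} × B) = t² + ρ(B)` for `E_θ` with complex multiplication, `B` an abelian variety and
`Hom(E_θ, B) = 0`** (Cor. 2.3 with Cor. 2.6: `ρ(E_θ^t) = t²`, `Hom(E_θ^t, B) = t · Hom(E_θ, B) = 0`).
[cite: HulekLaface2019PicardNumbersAV, §2.1 Cor. 2.3 and §2.2 Cor. 2.6] -/
theorem finrank_neronSeveriGroup_ellipticPow_prod_of_homRat_eq_bot {θ : ℂ} (hθ : 0 < θ.im) {a b : ℚ}
    (hq : θ ^ 2 + a * θ + b = 0) {κ : Type*} [Fintype κ] [DecidableEq κ] {H : Type*} [NormedAddCommGroup H]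
    [NormedSpace ℂ H] {B : (κ → ℝ) ≃L[ℝ] H} (hB : IsAbelianVariety B)
    (hHom : homRat (ellipticPeriod hθ.ne') B = ⊥) (t : ℕ) :
    finrank ℤ (neronSeveriGroup (prodPeriod (powPeriod (ellipticPeriod hθ.ne') t) B)) =
      t ^ 2 + finrank ℤ (neronSeveriGroup B) := by
  rw [hB.finrank_neronSeveriGroup_prod' (powPeriod (ellipticPeriod hθ.ne') t),
    finrank_neronSeveriGroup_ellipticPow_of_quadratic hθ.ne' t hq,
    (isIsomorphic_powPeriod_one B).isIsogenous.finrank_homRat_eq_right (powPeriod (ellipticPeriod hθ.ne') t),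
    finrank_homRat_pow, Submodule.finrank_eq_zero.2 hHom, mul_zero, add_zero]

variable {A : (ι → ℝ) ≃L[ℝ] E}

/-- **Hulek–Laface 2019, Cor. 7.6 for `n = 2` as an equivalence, explicit (`g ≥ 8`)**:
`ρ(A) ∈ R_{g,2}`-range `((g−2)², (g−2)² + 4]` iff `A ∼ E_θ^{g−2} × A_2` with `E_θ` CM, `A_2` an abelian
surface (standard model) and `Hom(E_θ, A_2) = 0`. [cite: HulekLaface2019PicardNumbersAV, §7.2 Cor. 7.6 (`n = 2`, both directions)] -/
theorem IsAbelianVariety.finrank_neronSeveriGroup_mem_secondBox_iff (hAV : IsAbelianVariety A)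
    (hg : 8 ≤ finrank ℂ E) :
    finrank ℤ (neronSeveriGroup A) ∈ Set.Ioc ((finrank ℂ E - 2) ^ 2) ((finrank ℂ E - 2) ^ 2 + 4) ↔
      ∃ (θ : ℂ) (hθ : 0 < θ.im) (m : ℕ) (B : (Fin (2 * m) → ℝ) ≃L[ℝ] (Fin m → ℂ)),
        (∃ a b : ℚ, θ ^ 2 + a * θ + b = 0) ∧ m = 2 ∧ IsAbelianVariety B ∧
          homRat (ellipticPeriod hθ.ne') B = ⊥ ∧
          IsIsogenous A (prodPeriod (powPeriod (ellipticPeriod hθ.ne') (finrank ℂ E - 2)) B) := by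
  constructor
  · rintro ⟨h₁, h₂⟩
    exact hAV.exists_isIsogenous_ellipticPow_prod_of_secondBox hg h₁ h₂
  · rintro ⟨θ, hθ, m, B, ⟨a, b, hq⟩, rfl, hB, hHom, hAB⟩
    rw [Set.mem_Ioc, hAB.finrank_neronSeveriGroup_eq _ _,
      finrank_neronSeveriGroup_ellipticPow_prod_of_homRat_eq_bot hθ hq hB hHom]
    have hle := finrank_neronSeveriGroup_le_sq B
    rw [Module.finrank_fin_fun] at hle
    have hpos := hB.finrank_neronSeveriGroup_pos
    constructor <;> omega

/-- **Hulek–Laface 2019, Cor. 7.6 for `n = 3` as an equivalence, explicit (`g ≥ 12`)**: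
`ρ(A) ∈ ((g−3)², (g−3)² + 9]` iff `A ∼ E_θ^{g−3} × A_3` with `E_θ` CM, `A_3` an abelian threefold
(standard model) and `Hom(E_θ, A_3) = 0` (then in fact `ρ(A) − (g−3)² = ρ(A_3) ∈ R_3 = {1,…,6,9}`).
[cite: HulekLaface2019PicardNumbersAV, §7.2 Cor. 7.6 (`n = 3`, both directions)] -/
theorem IsAbelianVariety.finrank_neronSeveriGroup_mem_thirdBox_iff (hAV : IsAbelianVariety A)
    (hg : 12 ≤ finrank ℂ E) :
    finrank ℤ (neronSeveriGroup A) ∈ Set.Ioc ((finrank ℂ E - 3) ^ 2) ((finrank ℂ E - 3) ^ 2 + 9) ↔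
      ∃ (θ : ℂ) (hθ : 0 < θ.im) (m : ℕ) (B : (Fin (2 * m) → ℝ) ≃L[ℝ] (Fin m → ℂ)),
        (∃ a b : ℚ, θ ^ 2 + a * θ + b = 0) ∧ m = 3 ∧ IsAbelianVariety B ∧
          homRat (ellipticPeriod hθ.ne') B = ⊥ ∧
          IsIsogenous A (prodPeriod (powPeriod (ellipticPeriod hθ.ne') (finrank ℂ E - 3)) B) := by
  constructor
  · rintro ⟨h₁, h₂⟩
    exact hAV.exists_isIsogenous_ellipticPow_prod_of_thirdBox hg h₁ h₂
  · rintro ⟨θ, hθ, m, B, ⟨a, b, hq⟩, rfl, hB, hHom, hAB⟩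
    rw [Set.mem_Ioc, hAB.finrank_neronSeveriGroup_eq _ _,
      finrank_neronSeveriGroup_ellipticPow_prod_of_homRat_eq_bot hθ hq hB hHom]
    have hle := finrank_neronSeveriGroup_le_sq B
    rw [Module.finrank_fin_fun] at hle
    have hpos := hB.finrank_neronSeveriGroup_pos
    constructor <;> omega

/-- **The shifted Picard number lands in `R_m`**: under the shape `A ∼ E_θ^{t} × B` (`E_θ` CM, `B` an
abelian variety of dimension `m` in its standard model, `Hom(E_θ, B) = 0`), `ρ(A) = t² + ρ(B)` with
`ρ(B) ∈ R_m` — "it follows that `ρ(X) ∈ R_{g,m}`". [cite: HulekLaface2019PicardNumbersAV, §7.2 Cor. 7.6 (proof, last paragraph)] -/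
theorem IsIsogenous.finrank_neronSeveriGroup_eq_sq_add_of_shape {θ : ℂ} {hθ : 0 < θ.im} {m t : ℕ}
    {B : (Fin (2 * m) → ℝ) ≃L[ℝ] (Fin m → ℂ)} (hq : ∃ a b : ℚ, θ ^ 2 + a * θ + b = 0)
    (hB : IsAbelianVariety B) (hHom : homRat (ellipticPeriod hθ.ne') B = ⊥)
    (hAB : IsIsogenous A (prodPeriod (powPeriod (ellipticPeriod hθ.ne') t) B)) :
    finrank ℤ (neronSeveriGroup A) = t ^ 2 + finrank ℤ (neronSeveriGroup B) ∧
      finrank ℤ (neronSeveriGroup B) ∈ picardNumbers m := by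
  obtain ⟨a, b, hq⟩ := hq
  refine ⟨by rw [hAB.finrank_neronSeveriGroup_eq _ _,
    finrank_neronSeveriGroup_ellipticPow_prod_of_homRat_eq_bot hθ hq hB hHom], ?_⟩
  have h := hB.mem_picardNumbers
  rwa [Module.finrank_fin_fun] at h

end BoxIff

/-! ## §9 The boxes as sets: `R_g ∩ ((g−n)², (g−n)² + n²] = (g−n)² + R_n` (`n = 2`: `g ≥ 8`; `n = 3`:
`g ≥ 12`) and Thm. 7.4 for `ℓ = 3` as printed, `[(g−3)² + 1, g²] ∩ R_g = R_{g,3} ⊔ R_{g,2} ⊔ R_{g,1} ⊔ R_{g,0}`,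
for every `g ≥ 12`

The inclusion `(g−n)² + R_n ⊆ R_g` ("`R_{g,k} + R_n ⊂ R_{g+n,k+n}`", here with `k = 0`) holds in every
dimension: for an abelian variety `Y` of dimension `n` there is a CM curve `E_{i√p}` not isogenous to
any simple factor of `Y` (pigeonhole on the pairwise non-isogenous `E_{i√p}`, `p` prime), so
`Hom(E_{i√p}, Y) = 0` and `ρ(E_{i√p}^t × Y) = t² + ρ(Y)` (Cor. 2.3).  [cite: HulekLaface2019PicardNumbersAV, §7.2 (definition of `R_{g,n}`, "`R_{g,k} + R_n ⊂ R_{g+n,k+n}`") and Thm. 7.4] -/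

section BoxSets

variable {κ : Type*} [Fintype κ] [DecidableEq κ] {H : Type*} [NormedAddCommGroup H] [NormedSpace ℂ H]

/-- **`ρ(X^{t} × B) = t² + ρ(B)` for a one-dimensional `X` with complex multiplication, `B` an abelian
variety and `Hom(X, B) = 0`** (Cor. 2.3 with Cor. 2.6). [cite: HulekLaface2019PicardNumbersAV, §2.1 Cor. 2.3 and §2.2 Cor. 2.6] -/
theorem finrank_neronSeveriGroup_cmPow_prod_of_homRat_eq_bot {κ₁ : Type*} [Fintype κ₁] [DecidableEq κ₁]
    {H₁ : Type*} [NormedAddCommGroup H₁] [NormedSpace ℂ H₁] (X₁ : (κ₁ → ℝ) ≃L[ℝ] H₁) (hd : finrank ℂ H₁ = 1)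
    (hcm : finrank ℚ (endAlgRat X₁) = 2) {B : (κ → ℝ) ≃L[ℝ] H} (hB : IsAbelianVariety B)
    (hHom : homRat X₁ B = ⊥) (t : ℕ) :
    finrank ℤ (neronSeveriGroup (prodPeriod (powPeriod X₁ t) B)) = t ^ 2 + finrank ℤ (neronSeveriGroup B) := by
  rw [hB.finrank_neronSeveriGroup_prod' (powPeriod X₁ t), finrank_neronSeveriGroup_pow_of_cm X₁ hd hcm t,
    (isIsomorphic_powPeriod_one B).isIsogenous.finrank_homRat_eq_right (powPeriod X₁ t),
    finrank_homRat_pow, Submodule.finrank_eq_zero.2 hHom, mul_zero, add_zero]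

/-- **A CM curve orthogonal to a given abelian variety**: for every abelian variety `Y` there is a prime
`p` (the `s`-th prime) with `Hom_ℚ(E_{i√p}, Y) = 0` — the curves `E_{i√p}` are pairwise non-isogenous
and each simple factor of `Y` is isogenous to at most one of them (pigeonhole over `r(Y) + 1` primes;
`Hom_ℚ(E, ∏ X_ν^{n_ν}) = ⊕ n_ν Hom_ℚ(E, X_ν)` and Schur). [cite: HulekLaface2019PicardNumbersAV, §6.1 Prop. 6.2 (pairwise non-isogenous CM curves) and §2.1 Cor. 2.3] [cite: Lange2023AbelianVarietiesComplex, §2.4.4 Thm. 2.4.25, Cor. 2.4.26] -/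
theorem IsAbelianVariety.exists_homRat_ellipticPeriod_prime_eq_bot {Y : (κ → ℝ) ≃L[ℝ] H}
    (hY : IsAbelianVariety Y) :
    ∃ s : ℕ, homRat (ellipticPeriod (im_I_mul_sqrt_nth_prime_pos s).ne') Y = ⊥ := by
  obtain ⟨ω, hω⟩ := hY
  obtain ⟨r, V, hV, hVc, n, hVpos, hVs, -, -, hn, hiso⟩ := IsRiemannForm.exists_isIsogenous_powers_pos Y hω
  haveI : ∀ ν, Nonempty (Fin (subRank (V ν))) := fun ν ↦ ⟨⟨0, hVpos ν⟩⟩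
  by_contra hne
  push Not at hne
  -- each `E_{i√p_s}` is isogenous to some simple factor of `Y`
  have key : ∀ s : ℕ, ∃ ν : Fin r, IsIsogenous (ellipticPeriod (im_I_mul_sqrt_nth_prime_pos s).ne')
      (subtorusPeriod Y (V ν) (hV ν) (hVc ν)) := fun s ↦ by
    by_contra hall
    push Not at hall
    apply hne s
    rw [← Submodule.finrank_eq_zero, IsIsogenous.finrank_homRat_eq_right _ hiso, finrank_homRat_sigmaPiPeriod_right]
    refine Finset.sum_eq_zero fun ν _ ↦ ?_
    rw [finrank_homRat_powPeriod_right, (isSimple_ellipticPeriod _).homRat_eq_bot (hVs ν) (hall ν), finrank_bot,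
      mul_zero]
  choose f hf using fun s : Fin (r + 1) ↦ key s
  obtain ⟨s, s', hss', hfs⟩ := Fintype.exists_ne_map_eq_of_card_lt f (by simp)
  have h' : IsIsogenous (subtorusPeriod Y (V (f s)) (hV (f s)) (hVc (f s)))
      (ellipticPeriod (im_I_mul_sqrt_nth_prime_pos (s' : ℕ)).ne') := by
    rw [hfs]
    exact IsIsogenous.symm _ _ (hf s')
  exact not_isIsogenous_ellipticPeriod_I_mul_sqrt_nth_prime (Fin.val_injective.ne hss') _ _
    (IsIsogenous.trans _ _ _ (hf s) h')

/-- **`t² + R_m ⊆ R_{t+m}`: the translate of `R_m` by `t²` consists of Picard numbers of dimension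
`t + m`** (`ρ(E_{i√p}^t × Y) = t² + ρ(Y)` with `Hom(E_{i√p}, Y) = 0`); in particular
`R_{g,n} = (g−n)² + R_n ⊆ R_g` for every `g ≥ n`. [cite: HulekLaface2019PicardNumbersAV, §7.2 ("`R_{g,n}` is the subset of `R_g` obtained by translating `R_n`", "`R_{g,k} + R_n ⊂ R_{g+n,k+n}`")] -/
theorem sq_add_mem_picardNumbers_of_mem {m y : ℕ} (hy : y ∈ picardNumbers m) (t : ℕ) :
    t ^ 2 + y ∈ picardNumbers (t + m) := by
  obtain ⟨Y, hY, rfl⟩ := hy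
  obtain ⟨s, hs⟩ := hY.exists_homRat_ellipticPeriod_prime_eq_bot
  have hE := isAbelianVariety_elliptic (im_I_mul_sqrt_nth_prime_pos s)
  have hA : IsAbelianVariety (prodPeriod (powPeriod (ellipticPeriod (im_I_mul_sqrt_nth_prime_pos s).ne') t) Y) :=
    (hE.pow t).prod hY
  have hmem := hA.mem_picardNumbers
  rwa [finrank_neronSeveriGroup_cmPow_prod_of_homRat_eq_bot _ (Module.finrank_self ℂ)
    (finrank_endAlgRat_ellipticPeriod_I_mul_sqrt_nth_prime s _) hY hs t, Module.finrank_prod,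
    finrank_fin_fun, Module.finrank_self, mul_one, Module.finrank_fin_fun] at hmem

/-- **`R_1 = {1}`** (an elliptic curve has `1 ≤ ρ ≤ 1² `). [cite: HulekLaface2019PicardNumbersAV, §1 ("For `g = 1` we clearly have `ρ = 1`")] -/
theorem picardNumbers_one : picardNumbers 1 = {1} := by
  ext y
  constructor
  · intro hy
    have h := picardNumbers_subset_Icc le_rfl hy
    rw [Set.mem_Icc] at h
    rw [Set.mem_singleton_iff]
    omega
  · rintro rfl
    simpa using choose_add_sum_sq_mem_picardNumbers (S := Fin 0) (fun i ↦ i.elim0) 1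

/-- **The box `R_{g,2}` as a set, `g ≥ 8`: `R_g ∩ ((g−2)², (g−2)² + 4] = (g−2)² + R_2`.** [cite: HulekLaface2019PicardNumbersAV, §7.2 Thm. 7.4 (the box `R_{g,2}`) and Cor. 7.6] -/
theorem picardNumbers_inter_Ioc_secondBox {g : ℕ} (hg : 8 ≤ g) :
    picardNumbers g ∩ Set.Ioc ((g - 2) ^ 2) ((g - 2) ^ 2 + 4) = (fun x ↦ (g - 2) ^ 2 + x) '' picardNumbers 2 := by
  ext k
  simp only [Set.mem_inter_iff, Set.mem_Ioc, Set.mem_image]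
  constructor
  · rintro ⟨⟨A, hA, rfl⟩, h₁, h₂⟩
    obtain ⟨θ, hθ, m, B, hq, hm, hB, hHom, hAB⟩ := hA.exists_isIsogenous_ellipticPow_prod_of_secondBox
      (by rw [Module.finrank_fin_fun]; exact hg) (by rw [Module.finrank_fin_fun]; exact h₁)
      (by rw [Module.finrank_fin_fun]; exact h₂)
    subst hm
    obtain ⟨hρ, hmem⟩ := hAB.finrank_neronSeveriGroup_eq_sq_add_of_shape (hθ := hθ) hq hB hHom
    rw [Module.finrank_fin_fun] at hρ
    exact ⟨_, hmem, hρ.symm⟩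
  · rintro ⟨y, hy, rfl⟩
    have hy' := picardNumbers_subset_Icc (by norm_num : 1 ≤ 2) hy
    rw [Set.mem_Icc] at hy'
    have h := sq_add_mem_picardNumbers_of_mem hy (g - 2)
    rw [show g - 2 + 2 = g from by omega] at h
    exact ⟨h, by omega, by omega⟩

/-- **The box `R_{g,3}` as a set, `g ≥ 12`: `R_g ∩ ((g−3)², (g−3)² + 9] = (g−3)² + R_3`.** [cite: HulekLaface2019PicardNumbersAV, §7.2 Thm. 7.4 (the box `R_{g,3}`) and Cor. 7.6] -/
theorem picardNumbers_inter_Ioc_thirdBox {g : ℕ} (hg : 12 ≤ g) :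
    picardNumbers g ∩ Set.Ioc ((g - 3) ^ 2) ((g - 3) ^ 2 + 9) = (fun x ↦ (g - 3) ^ 2 + x) '' picardNumbers 3 := by
  ext k
  simp only [Set.mem_inter_iff, Set.mem_Ioc, Set.mem_image]
  constructor
  · rintro ⟨⟨A, hA, rfl⟩, h₁, h₂⟩
    obtain ⟨θ, hθ, m, B, hq, hm, hB, hHom, hAB⟩ := hA.exists_isIsogenous_ellipticPow_prod_of_thirdBox
      (by rw [Module.finrank_fin_fun]; exact hg) (by rw [Module.finrank_fin_fun]; exact h₁)
      (by rw [Module.finrank_fin_fun]; exact h₂)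
    subst hm
    obtain ⟨hρ, hmem⟩ := hAB.finrank_neronSeveriGroup_eq_sq_add_of_shape (hθ := hθ) hq hB hHom
    rw [Module.finrank_fin_fun] at hρ
    exact ⟨_, hmem, hρ.symm⟩
  · rintro ⟨y, hy, rfl⟩
    have hy' := picardNumbers_subset_Icc (by norm_num : 1 ≤ 3) hy
    rw [Set.mem_Icc] at hy'
    have h := sq_add_mem_picardNumbers_of_mem hy (g - 3)
    rw [show g - 3 + 3 = g from by omega] at h
    exact ⟨h, by omega, by omega⟩

/-- **Hulek–Laface 2019, Thm. 7.4 for `ℓ = 3`, as printed, with the explicit genus `g₃ = 12`: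
"for all `g ≥ g_ℓ`, we have that `[(g−ℓ)² + 1, g²] ∩ R_g = R_{g,ℓ} ⊔ R_{g,ℓ−1} ⊔ ⋯ ⊔ R_{g,1} ⊔ R_{g,0}`"**,
`R_{g,n} = (g−n)² + R_n` (`R_{g,0} = {g²}`, `R_1 = {1}`): for every `g ≥ 12`,
`R_g ∩ [(g−3)² + 1, g²] = ((g−3)² + R_3) ∪ ((g−2)² + R_2) ∪ ((g−1)² + R_1) ∪ {g²}` — the boxes (§9), the
three gaps (Thm. 1.1 (1)–(2), §3) and the two top values. (The threshold: the box identities need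
`g ≥ 12`, Prop. 7.3; the gaps alone hold from `g = 9`.) [cite: HulekLaface2019PicardNumbersAV, §7.2 Thm. 7.4 (`ℓ = 3`)] -/
theorem picardNumbers_inter_Icc_eq_boxes {g : ℕ} (hg : 12 ≤ g) :
    picardNumbers g ∩ Set.Icc ((g - 3) ^ 2 + 1) (g ^ 2) =
      (fun x ↦ (g - 3) ^ 2 + x) '' picardNumbers 3 ∪ (fun x ↦ (g - 2) ^ 2 + x) '' picardNumbers 2 ∪
        (fun x ↦ (g - 1) ^ 2 + x) '' picardNumbers 1 ∪ {g ^ 2} := by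
  -- the arithmetic of the four squares
  have e₁ : (g - 2) ^ 2 = (g - 3) ^ 2 + 2 * g - 5 := by
    obtain ⟨t, rfl⟩ : ∃ t, g = t + 3 := ⟨g - 3, by omega⟩
    rw [show t + 3 - 2 = t + 1 from by omega, show t + 3 - 3 = t from by omega]
    ring_nf
    omega
  have e₂ : (g - 1) ^ 2 = (g - 3) ^ 2 + 4 * g - 8 := by
    obtain ⟨t, rfl⟩ : ∃ t, g = t + 3 := ⟨g - 3, by omega⟩
    rw [show t + 3 - 1 = t + 2 from by omega, show t + 3 - 3 = t from by omega]
    ring_nf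
    omega
  have e₃ : g ^ 2 = (g - 3) ^ 2 + 6 * g - 9 := by
    obtain ⟨t, rfl⟩ : ∃ t, g = t + 3 := ⟨g - 3, by omega⟩
    rw [show t + 3 - 3 = t from by omega]
    ring_nf
    omega
  have hbox3 := picardNumbers_inter_Ioc_thirdBox hg
  have hbox2 := picardNumbers_inter_Ioc_secondBox (by omega : 8 ≤ g)
  ext k
  simp only [Set.mem_inter_iff, Set.mem_Icc, Set.mem_union, Set.mem_singleton_iff, picardNumbers_one,
    Set.image_singleton]
  constructor
  · rintro ⟨hk, h₁, h₂⟩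
    by_cases hA : k ≤ (g - 3) ^ 2 + 9
    · have h : k ∈ picardNumbers g ∩ Set.Ioc ((g - 3) ^ 2) ((g - 3) ^ 2 + 9) := ⟨hk, by omega, hA⟩
      rw [hbox3] at h
      exact Or.inl (Or.inl (Or.inl h))
    by_cases hB : k ≤ (g - 2) ^ 2
    · exact absurd hk (not_mem_picardNumbers_of_thirdGap (by omega) (by omega) (by omega) (by omega))
    by_cases hC : k ≤ (g - 2) ^ 2 + 4
    · have h : k ∈ picardNumbers g ∩ Set.Ioc ((g - 2) ^ 2) ((g - 2) ^ 2 + 4) := ⟨hk, by omega, hC⟩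
      rw [hbox2] at h
      exact Or.inl (Or.inl (Or.inr h))
    by_cases hD : k < (g - 1) ^ 2 + 1
    · exact absurd hk (not_mem_picardNumbers_of_lt_of_lt_secondGap (by omega) (by omega) hD)
    by_cases hE : k = (g - 1) ^ 2 + 1
    · exact Or.inl (Or.inr hE)
    by_cases hF : k < g ^ 2
    · exact absurd hk (not_mem_picardNumbers_of_lt_of_lt (by omega) (by omega) hF)
    · exact Or.inr (by omega)
  · rintro (((h | h) | h) | rfl)
    · rw [← hbox3] at h
      exact ⟨h.1, by have := h.2.1; omega, by have := h.2.2; omega⟩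
    · rw [← hbox2] at h
      exact ⟨h.1, by have := h.2.1; omega, by have := h.2.2; omega⟩
    · subst h
      have hmem := sq_add_mem_picardNumbers_of_mem (show 1 ∈ picardNumbers 1 by rw [picardNumbers_one]; rfl) (g - 1)
      rw [show g - 1 + 1 = g from by omega] at hmem
      exact ⟨hmem, by omega, by omega⟩
    · have hmem := choose_add_sum_sq_mem_picardNumbers (S := Fin 1) ![g] 0
      simp only [Fin.sum_univ_one, Matrix.cons_val_zero] at hmem
      have c12 : Nat.choose 1 2 = 0 := by decide
      exact ⟨mem_picardNumbers_congr hmem (by norm_num [c12]) (by omega), by omega, le_rfl⟩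

end BoxSets

/-! ## §10 The fourth gap: no abelian variety has `(g−4)² + 16 < ρ < (g−3)² + 1`, in every dimension

The condition "`(g−t)² + t² < ρ < (g−t+1)² + 1`" of the proof of Thm. 7.4 for `t = 4`.  The interval is
empty for `g ≤ 11`; for `g ≥ 12` the argument runs along `A ∼ ∏_ν X_ν^{n_ν}` with `K = max_ν k_ν` as in
§6–§7: `K ≤ g − 8` (`ρ ≤ K g`), `K ∈ {g−7, g−6, g−5}` (`ρ ≤ K² + (g−K)²`), `K = g − 4` (Thm. 1.1 (1) for
the big factor), `K = g − 3`, `g − 2` (its three largest Picard numbers), `K = g − 1` (the THIRD gap of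
the `(g−1)`-dimensional factor, §3 — the inductive step "`(ℓ−n+1)`-st condition" of the printed proof),
`K = g` (`C(g+1, 2) ≤ (g−4)² + 16` for `g ≥ 12`).  So the `t = 4` condition holds with NO restriction on
`g`. [cite: HulekLaface2019PicardNumbersAV, §7.2 Thm. 7.4 (proof, the inductive step)] -/

section FourthGap

/-- **`C(g+1, 2) ≤ (g−4)² + 16` for `g ≥ 12`.** [cite: HulekLaface2019PicardNumbersAV, §7.2 (condition (1))] -/
theorem choose_succ_le_fourthGap {g : ℕ} (hg : 12 ≤ g) : (g + 1).choose 2 ≤ (g - 4) ^ 2 + 16 := by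
  obtain ⟨t, rfl⟩ : ∃ t, g = t + 12 := ⟨g - 12, by omega⟩
  rw [show t + 12 - 4 = t + 8 from by omega, Nat.choose_two_right,
    show t + 12 + 1 - 1 = t + 12 from by omega,
    show (t + 12 + 1) * (t + 12) = t ^ 2 + 25 * t + 156 from by ring,
    show (t + 8) ^ 2 + 16 = t ^ 2 + 16 * t + 80 from by ring]
  omega

variable {ι : Type*} [Fintype ι] [DecidableEq ι] {E : Type*} [NormedAddCommGroup E] [NormedSpace ℂ E]
  {ρ : Type*} [Fintype ρ] [DecidableEq ρ] {τ : ρ → Type*} [∀ ν, Fintype (τ ν)] [∀ ν, DecidableEq (τ ν)]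
  [∀ ν, Nonempty (τ ν)]
  {G : ρ → Type*} [∀ ν, NormedAddCommGroup (G ν)] [∀ ν, NormedSpace ℂ (G ν)]
  (X : ∀ ν, (τ ν → ℝ) ≃L[ℝ] G ν) (n : ρ → ℕ)

/-- **The fourth gap along a Poincaré decomposition (`g ≥ 12`)**: for simple, nonzero, pairwise
non-isogenous abelian varieties `X_ν`, `n_ν ≥ 1` and `A ∼ ∏_ν X_ν^{n_ν}` of dimension `g ≥ 12`, the Picard
number of `A` does not satisfy `(g−4)² + 16 < ρ(A) < (g−3)² + 1`.
[cite: HulekLaface2019PicardNumbersAV, §7.2 Thm. 7.4 (proof: the condition for `t = 4`)] -/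
theorem IsIsogenous.not_fourthGap_of_powers {A : (ι → ℝ) ≃L[ℝ] E}
    (hiso : IsIsogenous A (sigmaPiPeriod fun ν ↦ powPeriod (X ν) (n ν))) (hX : ∀ ν, IsSimple (X ν))
    (hA : ∀ ν, IsAbelianVariety (X ν)) (hXX : ∀ ν ν', ν ≠ ν' → ¬ IsIsogenous (X ν) (X ν'))
    (hn : ∀ ν, 0 < n ν) (hg : 12 ≤ finrank ℂ E)
    (h₁ : (finrank ℂ E - 4) ^ 2 + 16 < finrank ℤ (neronSeveriGroup A))
    (h₂ : finrank ℤ (neronSeveriGroup A) < (finrank ℂ E - 3) ^ 2 + 1) : False := by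
  haveI : ∀ ν, FiniteDimensional ℂ (G ν) := fun ν ↦ finiteDimensional_complex_of_period (X ν)
  have hgsum : finrank ℂ E = ∑ ν, n ν * finrank ℂ (G ν) := by
    rw [hiso.finrank_eq _ _, finrank_powers_eq X n]
  have hρsum : finrank ℤ (neronSeveriGroup A) = ∑ ν, finrank ℤ (neronSeveriGroup (powPeriod (X ν) (n ν))) := by
    rw [hiso.finrank_neronSeveriGroup_eq _ _, finrank_neronSeveriGroup_powers X n hX hA hXX]
  have hk1 : ∀ ν, 1 ≤ n ν * finrank ℂ (G ν) := one_le_mul_finrank X n hn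
  have hkd : ∀ ν, finrank ℂ (Fin (n ν) → G ν) = n ν * finrank ℂ (G ν) := fun ν ↦ finrank_fin_fun (n ν) (G ν)
  have hρ1 : ∀ ν, 1 ≤ finrank ℤ (neronSeveriGroup (powPeriod (X ν) (n ν))) := fun ν ↦
    (((hA ν).pow (n ν)).finrank_neronSeveriGroup_facts (by rw [hkd]; exact hk1 ν)).1
  -- the largest isotypic factor `ν₀`, `K = k_{ν₀}`
  haveI : Nonempty ρ := by
    by_contra hne
    rw [not_nonempty_iff] at hne
    rw [Finset.univ_eq_empty, Finset.sum_empty] at hgsum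
    omega
  obtain ⟨ν₀, -, hmax⟩ :=
    Finset.exists_max_image (Finset.univ : Finset ρ) (fun ν ↦ n ν * finrank ℂ (G ν)) Finset.univ_nonempty
  have hgsplit : finrank ℂ E = n ν₀ * finrank ℂ (G ν₀) +
      ∑ ν ∈ Finset.univ.erase ν₀, n ν * finrank ℂ (G ν) := by
    rw [hgsum, ← Finset.add_sum_erase _ _ (Finset.mem_univ ν₀)]
  have hρsplit : finrank ℤ (neronSeveriGroup A) = finrank ℤ (neronSeveriGroup (powPeriod (X ν₀) (n ν₀))) +
      ∑ ν ∈ Finset.univ.erase ν₀, finrank ℤ (neronSeveriGroup (powPeriod (X ν) (n ν))) := by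
    rw [hρsum, ← Finset.add_sum_erase _ _ (Finset.mem_univ ν₀)]
  have hrest : ∑ ν ∈ Finset.univ.erase ν₀, finrank ℤ (neronSeveriGroup (powPeriod (X ν) (n ν))) ≤
      (∑ ν ∈ Finset.univ.erase ν₀, n ν * finrank ℂ (G ν)) ^ 2 :=
    (Finset.sum_le_sum fun ν _ ↦ finrank_neronSeveriGroup_powPeriod_le_sq (X ν) (n ν)).trans
      (sum_sq_le_sq_sum _ _)
  -- `Σ_{ν ≠ ν₀} ρ_ν ≥ 1` as soon as there is a factor other than `ν₀`
  have hrest1 : 0 < ∑ ν ∈ Finset.univ.erase ν₀, n ν * finrank ℂ (G ν) →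
      1 ≤ ∑ ν ∈ Finset.univ.erase ν₀, finrank ℤ (neronSeveriGroup (powPeriod (X ν) (n ν))) := fun hS ↦ by
    obtain ⟨ν₁, hν₁, -⟩ := Finset.exists_ne_zero_of_sum_ne_zero hS.ne'
    exact (hρ1 ν₁).trans
      (Finset.single_le_sum (f := fun ν ↦ finrank ℤ (neronSeveriGroup (powPeriod (X ν) (n ν))))
        (fun ν _ ↦ Nat.zero_le _) hν₁)
  have hall : finrank ℤ (neronSeveriGroup A) ≤ n ν₀ * finrank ℂ (G ν₀) * finrank ℂ E := by
    rw [hρsum, hgsum, Finset.mul_sum]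
    exact Finset.sum_le_sum fun ν _ ↦ (finrank_neronSeveriGroup_powPeriod_le_sq (X ν) (n ν)).trans
      (by rw [sq]; exact Nat.mul_le_mul_right _ (hmax ν (Finset.mem_univ ν)))
  have hρ₀le : finrank ℤ (neronSeveriGroup (powPeriod (X ν₀) (n ν₀))) ≤ (n ν₀ * finrank ℂ (G ν₀)) ^ 2 :=
    finrank_neronSeveriGroup_powPeriod_le_sq (X ν₀) (n ν₀)
  have hAV₀ : IsAbelianVariety (powPeriod (X ν₀) (n ν₀)) := (hA ν₀).pow (n ν₀)
  have facts₀ := hAV₀.finrank_neronSeveriGroup_facts (by rw [hkd]; exact hk1 ν₀)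
  rw [hkd ν₀] at facts₀
  obtain ⟨-, -, f4, f7, -⟩ := facts₀
  -- `(g−3)² + 1 ≤ g²` etc.: the arithmetic of the window against `K`
  rcases (show n ν₀ * finrank ℂ (G ν₀) + 8 ≤ finrank ℂ E ∨ n ν₀ * finrank ℂ (G ν₀) + 7 = finrank ℂ E ∨
      n ν₀ * finrank ℂ (G ν₀) + 6 = finrank ℂ E ∨ n ν₀ * finrank ℂ (G ν₀) + 5 = finrank ℂ E ∨
      n ν₀ * finrank ℂ (G ν₀) + 4 = finrank ℂ E ∨ n ν₀ * finrank ℂ (G ν₀) + 3 = finrank ℂ E ∨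
      n ν₀ * finrank ℂ (G ν₀) + 2 = finrank ℂ E ∨ n ν₀ * finrank ℂ (G ν₀) + 1 = finrank ℂ E ∨
      n ν₀ * finrank ℂ (G ν₀) = finrank ℂ E by omega) with hK | hK | hK | hK | hK | hK | hK | hK | hK
  · -- `K ≤ g − 8`: `ρ ≤ K g ≤ (g−8) g = (g−4)² − 16`
    have hKg : n ν₀ * finrank ℂ (G ν₀) * finrank ℂ E ≤ (finrank ℂ E - 8) * finrank ℂ E :=
      Nat.mul_le_mul_right _ (by omega)
    have e : (finrank ℂ E - 8) * finrank ℂ E + 16 = (finrank ℂ E - 4) ^ 2 := by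
      obtain ⟨t, ht⟩ : ∃ t, finrank ℂ E = t + 8 := ⟨finrank ℂ E - 8, by omega⟩
      rw [ht, show t + 8 - 8 = t from by omega, show t + 8 - 4 = t + 4 from by omega]
      ring
    omega
  · -- `K = g − 7`: `ρ ≤ (g−7)² + 49 ≤ (g−4)² + 16`
    have hS : ∑ ν ∈ Finset.univ.erase ν₀, n ν * finrank ℂ (G ν) = 7 := by omega
    rw [hS] at hrest
    have e : (finrank ℂ E - 4) ^ 2 = (n ν₀ * finrank ℂ (G ν₀)) ^ 2 + 6 * (n ν₀ * finrank ℂ (G ν₀)) + 9 := by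
      rw [show finrank ℂ E - 4 = n ν₀ * finrank ℂ (G ν₀) + 3 from by omega]
      ring
    omega
  · -- `K = g − 6`
    have hS : ∑ ν ∈ Finset.univ.erase ν₀, n ν * finrank ℂ (G ν) = 6 := by omega
    rw [hS] at hrest
    have e : (finrank ℂ E - 4) ^ 2 = (n ν₀ * finrank ℂ (G ν₀)) ^ 2 + 4 * (n ν₀ * finrank ℂ (G ν₀)) + 4 := by
      rw [show finrank ℂ E - 4 = n ν₀ * finrank ℂ (G ν₀) + 2 from by omega]
      ring
    omega
  · -- `K = g − 5`
    have hS : ∑ ν ∈ Finset.univ.erase ν₀, n ν * finrank ℂ (G ν) = 5 := by omega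
    rw [hS] at hrest
    have e : (finrank ℂ E - 4) ^ 2 = (n ν₀ * finrank ℂ (G ν₀)) ^ 2 + 2 * (n ν₀ * finrank ℂ (G ν₀)) + 1 := by
      rw [show finrank ℂ E - 4 = n ν₀ * finrank ℂ (G ν₀) + 1 from by omega]
      ring
    omega
  · -- `K = g − 4`: Thm. 1.1 (1) for the big factor
    have hS : ∑ ν ∈ Finset.univ.erase ν₀, n ν * finrank ℂ (G ν) = 4 := by omega
    rw [hS] at hrest
    rw [show finrank ℂ E - 4 = n ν₀ * finrank ℂ (G ν₀) from by omega] at h₁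
    have e : (n ν₀ * finrank ℂ (G ν₀) - 1) ^ 2 + 2 * (n ν₀ * finrank ℂ (G ν₀)) =
        (n ν₀ * finrank ℂ (G ν₀)) ^ 2 + 1 := by
      obtain ⟨t, ht⟩ : ∃ t, n ν₀ * finrank ℂ (G ν₀) = t + 1 := ⟨n ν₀ * finrank ℂ (G ν₀) - 1, by omega⟩
      rw [ht, show t + 1 - 1 = t from by omega]
      ring
    rcases f4 (by omega) with hρ₀ | hρ₀ <;> omega
  · -- `K = g − 3`: the three largest Picard numbers of the big factor
    have hS : ∑ ν ∈ Finset.univ.erase ν₀, n ν * finrank ℂ (G ν) = 3 := by omega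
    have hr1 := hrest1 (by omega)
    rw [hS] at hrest
    rw [show finrank ℂ E - 4 = n ν₀ * finrank ℂ (G ν₀) - 1 from by omega] at h₁
    rw [show finrank ℂ E - 3 = n ν₀ * finrank ℂ (G ν₀) from by omega] at h₂
    have e₁ : (n ν₀ * finrank ℂ (G ν₀) - 1) ^ 2 + 2 * (n ν₀ * finrank ℂ (G ν₀)) =
        (n ν₀ * finrank ℂ (G ν₀)) ^ 2 + 1 := by
      obtain ⟨t, ht⟩ : ∃ t, n ν₀ * finrank ℂ (G ν₀) = t + 1 := ⟨n ν₀ * finrank ℂ (G ν₀) - 1, by omega⟩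
      rw [ht, show t + 1 - 1 = t from by omega]
      ring
    have e₂ : (n ν₀ * finrank ℂ (G ν₀) - 2) ^ 2 + 2 * (n ν₀ * finrank ℂ (G ν₀)) =
        (n ν₀ * finrank ℂ (G ν₀) - 1) ^ 2 + 3 := by
      obtain ⟨t, ht⟩ : ∃ t, n ν₀ * finrank ℂ (G ν₀) = t + 2 := ⟨n ν₀ * finrank ℂ (G ν₀) - 2, by omega⟩
      rw [ht, show t + 2 - 2 = t from by omega, show t + 2 - 1 = t + 1 from by omega]
      ring
    rcases f7 (by omega) with hρ₀ | hρ₀ | hρ₀ <;> omega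
  · -- `K = g − 2`
    have hS : ∑ ν ∈ Finset.univ.erase ν₀, n ν * finrank ℂ (G ν) = 2 := by omega
    have hr1 := hrest1 (by omega)
    rw [hS] at hrest
    rw [show finrank ℂ E - 4 = n ν₀ * finrank ℂ (G ν₀) - 2 from by omega] at h₁
    rw [show finrank ℂ E - 3 = n ν₀ * finrank ℂ (G ν₀) - 1 from by omega] at h₂
    have e₁ : (n ν₀ * finrank ℂ (G ν₀) - 1) ^ 2 + 2 * (n ν₀ * finrank ℂ (G ν₀)) =
        (n ν₀ * finrank ℂ (G ν₀)) ^ 2 + 1 := by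
      obtain ⟨t, ht⟩ : ∃ t, n ν₀ * finrank ℂ (G ν₀) = t + 1 := ⟨n ν₀ * finrank ℂ (G ν₀) - 1, by omega⟩
      rw [ht, show t + 1 - 1 = t from by omega]
      ring
    have e₂ : (n ν₀ * finrank ℂ (G ν₀) - 2) ^ 2 + 2 * (n ν₀ * finrank ℂ (G ν₀)) =
        (n ν₀ * finrank ℂ (G ν₀) - 1) ^ 2 + 3 := by
      obtain ⟨t, ht⟩ : ∃ t, n ν₀ * finrank ℂ (G ν₀) = t + 2 := ⟨n ν₀ * finrank ℂ (G ν₀) - 2, by omega⟩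
      rw [ht, show t + 2 - 2 = t from by omega, show t + 2 - 1 = t + 1 from by omega]
      ring
    rcases f7 (by omega) with hρ₀ | hρ₀ | hρ₀ <;> omega
  · -- `K = g − 1`: `A ∼ X_{ν₀}^{n_{ν₀}} × E'`, the THIRD gap of the `(g−1)`-dimensional factor
    have hS : ∑ ν ∈ Finset.univ.erase ν₀, n ν * finrank ℂ (G ν) = 1 := by omega
    have hr1 := hrest1 (by omega)
    rw [hS] at hrest
    rw [show finrank ℂ E - 4 = n ν₀ * finrank ℂ (G ν₀) - 3 from by omega] at h₁
    rw [show finrank ℂ E - 3 = n ν₀ * finrank ℂ (G ν₀) - 2 from by omega] at h₂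
    have h3 := hAV₀.finrank_neronSeveriGroup_eq_of_thirdGap (by rw [hkd]; omega)
      (by rw [hkd]; omega) (by rw [hkd]; omega)
    rw [hkd] at h3
    omega
  · -- `K = g`: `r = 1`
    have hS : ∑ ν ∈ Finset.univ.erase ν₀, n ν * finrank ℂ (G ν) = 0 := by omega
    have hempty : Finset.univ.erase ν₀ = (∅ : Finset ρ) :=
      Finset.eq_empty_iff_forall_notMem.2 fun ν hν ↦ by
        have h0 := Finset.sum_eq_zero_iff.1 hS ν hν
        have h1 := hk1 ν
        omega
    have h1 : Fintype.card ρ = 1 := by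
      rw [← Finset.card_univ, ← Finset.insert_erase (Finset.mem_univ ν₀), hempty, Finset.insert_empty,
        Finset.card_singleton]
    rcases hiso.finrank_neronSeveriGroup_eq_sq_or_le_choose_of_card_eq_one X n hX hA hn h1 with h | h
    · have hsq : (finrank ℂ E - 3) ^ 2 + 1 ≤ finrank ℂ E ^ 2 := by
        obtain ⟨t, ht⟩ : ∃ t, finrank ℂ E = t + 3 := ⟨finrank ℂ E - 3, by omega⟩
        rw [ht, show t + 3 - 3 = t from by omega]
        nlinarith
      omega
    · exact absurd (h.trans (choose_succ_le_fourthGap hg)) (not_le.2 h₁)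

variable {A : (ι → ℝ) ≃L[ℝ] E}

/-- **The fourth gap, for every abelian variety of every dimension**: there is no abelian variety `A`
with `(g−4)² + 16 < ρ(A) < (g−3)² + 1` (the condition "`(g−t)² + t² < ρ < (g−t+1)² + 1`", `t = 4`, of
the proof of Thm. 7.4, which thus holds with no restriction on `g`: the interval is empty for `g ≤ 11`).
[cite: HulekLaface2019PicardNumbersAV, §7.2 Thm. 7.4 (proof, the condition for `t = 4`)] [cite: Lange2023AbelianVarietiesComplex, §2.4.4 Thm. 2.4.25] -/
theorem IsAbelianVariety.not_lt_finrank_neronSeveriGroup_lt_fourthGap (hAV : IsAbelianVariety A) :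
    ¬ ((finrank ℂ E - 4) ^ 2 + 16 < finrank ℤ (neronSeveriGroup A) ∧
      finrank ℤ (neronSeveriGroup A) < (finrank ℂ E - 3) ^ 2 + 1) := by
  rintro ⟨h₁, h₂⟩
  rcases Nat.lt_or_ge (finrank ℂ E) 12 with hlt | hge
  · -- the window is empty
    rcases Nat.lt_or_ge (finrank ℂ E) 4 with h4 | h4
    · have h0 : finrank ℂ E - 4 = 0 := by omega
      have h3 : (finrank ℂ E - 3) ^ 2 ≤ 1 := by
        rcases (show finrank ℂ E - 3 = 0 ∨ finrank ℂ E - 3 = 1 by omega) with h | h <;> simp [h]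
      rw [h0] at h₁
      omega
    · obtain ⟨t, ht⟩ : ∃ t, finrank ℂ E = t + 4 := ⟨finrank ℂ E - 4, by omega⟩
      rw [ht] at h₁ h₂ hlt
      rw [show t + 4 - 4 = t from by omega] at h₁
      rw [show t + 4 - 3 = t + 1 from by omega] at h₂
      have e : (t + 1) ^ 2 = t ^ 2 + 2 * t + 1 := by ring
      omega
  · obtain ⟨ω, hω⟩ := hAV
    obtain ⟨r, V, hV, hVc, n, hVpos, hVs, hVab, hVV, hn, hiso⟩ := IsRiemannForm.exists_isIsogenous_powers_pos A hω
    haveI : ∀ ν, Nonempty (Fin (subRank (V ν))) := fun ν ↦ ⟨⟨0, hVpos ν⟩⟩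
    exact hiso.not_fourthGap_of_powers _ n hVs hVab hVV hn hge h₁ h₂

/-- **The fourth gap on `R_g`: `R_g ∩ ((g−4)² + 16, (g−3)² + 1) = ∅` for every `g`.** [cite: HulekLaface2019PicardNumbersAV, §7.2 Thm. 7.4 (proof, `t = 4`)] -/
theorem not_mem_picardNumbers_of_fourthGap {g n : ℕ} (h₁ : (g - 4) ^ 2 + 16 < n) (h₂ : n < (g - 3) ^ 2 + 1) :
    n ∉ picardNumbers g := by
  rintro ⟨X, hX, rfl⟩
  have h := hX.not_lt_finrank_neronSeveriGroup_lt_fourthGap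
  rw [Module.finrank_fin_fun] at h
  exact h ⟨h₁, h₂⟩

/-- **The four gaps at once**: for every `g ≥ 7` and every abelian variety of dimension `g`, `ρ(A)` avoids
`((g−1)² + 1, g²)`, `((g−2)² + 4, (g−1)² + 1)`, `((g−3)² + 9, (g−2)² + 1)` (for `g ≥ 9`) and
`((g−4)² + 16, (g−3)² + 1)` — the conditions `t = 1, …, 4` of the proof of Thm. 7.4 with their explicit
genera `4, 7, 9, (any)`. [cite: HulekLaface2019PicardNumbersAV, Thm. 1.1 and §7.2 Thm. 7.4 (proof)] -/
theorem not_mem_picardNumbers_of_gaps {g n : ℕ} (hg : 9 ≤ g) (hn : n ∈ picardNumbers g) :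
    ¬ ((g - 1) ^ 2 + 1 < n ∧ n < g ^ 2) ∧ ¬ ((g - 2) ^ 2 + 4 < n ∧ n < (g - 1) ^ 2 + 1) ∧
      ¬ ((g - 3) ^ 2 + 9 < n ∧ n < (g - 2) ^ 2 + 1) ∧ ¬ ((g - 4) ^ 2 + 16 < n ∧ n < (g - 3) ^ 2 + 1) :=
  ⟨fun h ↦ not_mem_picardNumbers_of_lt_of_lt (by omega) h.1 h.2 hn,
    fun h ↦ not_mem_picardNumbers_of_lt_of_lt_secondGap (by omega) h.1 h.2 hn,
    fun h ↦ not_mem_picardNumbers_of_thirdGap hg (by omega) h.2 (by omega) hn,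
    fun h ↦ not_mem_picardNumbers_of_fourthGap h.1 h.2 hn⟩

end FourthGap

end ComplexTorus

end Literature.Geometry.Kaehler
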